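import Summits.QuantumFields.YangMills.Theses.LuscherReduction
import Summits.QuantumFields.YangMills.Theorems.LuscherReductionTwistedTraceScalingTowerOfUniform
import Summits.QuantumFields.YangMills.Theorems.LuscherReductionTwistedTraceScalingOneSiteTraceLimit
import Summits.QuantumFields.YangMills.Theorems.LuscherReductionTwistedTraceScalingTowerE1
import Summits.QuantumFields.YangMills.Theorems.LuscherReductionTwistedTraceScalingOfFemtoTraceLaw
import Summits.QuantumFields.YangMills.Theorems.TwistedTraceScaling.Negative.FixedLatticeTraceLawFalseWithoutThreshold
import Summits.QuantumFields.YangMills.Theorems.TwistedTraceScaling.Negative.StrongCouplingBranch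
import Summits.QuantumFields.YangMills.Theorems.TwistedTraceScaling.Negative.FalseWithoutBetaGeOne
import Summits.QuantumFields.YangMills.Theorems.TwistedTraceScaling.Negative.TowerFalseWithoutBeta1GeOneOfBase
import Summits.QuantumFields.YangMills.Theorems.TwistedTraceScaling.Negative.TowerE1FalseWithoutBetaGuardsOfBase
import Summits.QuantumFields.YangMills.Theorems.TwistedTraceScaling.Negative.ClockRobustness
import Summits.QuantumFields.YangMills.Theorems.LuscherReductionTwistedTraceScalingTrackStub
import Summits.QuantumFields.YangMills.Theorems.LuscherReductionTwistedTraceScalingTowerE1Converse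
import Literature.MathematicalPhysics.QuantumFieldTheory.Balaban1983to89.T4TwoLoopLaw
import Literature.MathematicalPhysics.QuantumFieldTheory.Balaban1983to89.FlowStepRuns
import Literature.MathematicalPhysics.QuantumFieldTheory.Balaban1983to89.B12Normalization
import Summits.QuantumFields.YangMills.Theorems.TwistedTraceScaling.Negative.TwoLoopCalibrationGuards
import Summits.QuantumFields.YangMills.Theorems.TwistedTraceScaling.Negative.CmpTwoLoopIffUniformOfBase
import Summits.QuantumFields.YangMills.Theorems.TwistedTraceScaling.Negative.InnerValleyTargetsGuards
import Summits.QuantumFields.YangMills.Theorems.TwistedTraceScaling.Negative.AnchoredCompositionGuards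
import Summits.QuantumFields.YangMills.Theorems.TwistedTraceScaling.Negative.CmpSandwichGuards
import Summits.QuantumFields.YangMills.Theorems.TwistedTraceScaling.Negative.FlatProximityQuartic
import Summits.QuantumFields.YangMills.Theorems.TwistedTraceScaling.Negative.FlatProximityExponent
import Summits.QuantumFields.YangMills.Theorems.TwistedTraceScaling.Negative.ConstProximityKit
import Summits.QuantumFields.YangMills.Theorems.TwistedTraceScaling.Negative.ConstProximityCentreTwist
import Summits.QuantumFields.YangMills.Theorems.TwistedTraceScaling.Negative.ToronCellGap
import Summits.QuantumFields.YangMills.Theorems.TwistedTraceScaling.Negative.TwistGaugeOddL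
import Summits.QuantumFields.YangMills.Theorems.TwistedTraceScaling.Negative.ValleyConstProximity
import Summits.QuantumFields.YangMills.Theorems.TwistedTraceScaling.Negative.ValleyGeomExponent
import Summits.QuantumFields.YangMills.Theorems.TwistedTraceScaling.Negative.ValleyLinkProxExponent
import Summits.QuantumFields.YangMills.Theorems.TwistedTraceScaling.Negative.ValleyProximityBigO
import Summits.QuantumFields.YangMills.Theorems.TwistedTraceScaling.Negative.ValleyProximityThreshold
import Summits.QuantumFields.YangMills.Theorems.TwistedTraceScaling.Negative.ValleyFloorLedger
import Summits.QuantumFields.YangMills.Theorems.TwistedTraceScaling.Negative.VacuumFloorLedger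
import Summits.QuantumFields.YangMills.Theorems.TwistedTraceScaling.Negative.IdealFloorLedger
import Summits.QuantumFields.YangMills.Theorems.TwistedTraceScaling.Negative.FloorRouteCeiling
import Summits.QuantumFields.YangMills.Theorems.TwistedTraceScaling.Negative.FloorRouteCeilingPow
import Summits.QuantumFields.YangMills.Theorems.LuscherReductionTwistedTraceScalingFloorNormalisation
import Summits.QuantumFields.YangMills.Theorems.TwistedTraceScaling.Negative.InnerPowWindow
import Summits.QuantumFields.YangMills.Theorems.TwistedTraceScaling.Negative.ZpeKink
import Summits.QuantumFields.YangMills.Theorems.TwistedTraceScaling.Negative.InnerBOPackageIffInner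
import Summits.QuantumFields.YangMills.Theorems.TwistedTraceScaling.Negative.KernelNearEtaFloor
import Summits.QuantumFields.YangMills.Theorems.TwistedTraceScaling.Negative.FeshbachEndgameTight
import Summits.QuantumFields.YangMills.Theorems.TwistedTraceScaling.Negative.ModelPerturbedNearRigidity
import Summits.QuantumFields.YangMills.Theorems.TwistedTraceScaling.Negative.ModelPerturbedNearRegional
import Summits.QuantumFields.YangMills.Theorems.TwistedTraceScaling.Negative.ShellIsValleyBelowLine
import Summits.QuantumFields.YangMills.Theorems.TwistedTraceScaling.Negative.OneSiteGainWindow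
import Summits.QuantumFields.YangMills.Theorems.TwistedTraceScaling.Negative.ValleyOrbitDistPolyakovFloor
import Summits.QuantumFields.YangMills.Theorems.TwistedTraceScaling.Negative.ShellWitnessBelowThreshold
import Summits.QuantumFields.YangMills.Theorems.TwistedTraceScaling.Negative.OneSiteRouteWindow
import Summits.QuantumFields.YangMills.Theorems.TwistedTraceScaling.Negative.OrthoTubeKineticCross
import Summits.QuantumFields.YangMills.Theorems.TwistedTraceScaling.Negative.SoftTubeIffInner
import Summits.QuantumFields.YangMills.Theorems.TwistedTraceScaling.Negative.TubePackageIffInner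
import Summits.QuantumFields.YangMills.Theorems.TwistedTraceScaling.Negative.OrthoTubePolarFrame
import Summits.QuantumFields.YangMills.Theorems.TwistedTraceScaling.Negative.SliceWindingCopies
import Summits.QuantumFields.YangMills.Theorems.TwistedTraceScaling.Negative.OrthoTubeAxialDefect
import Summits.QuantumFields.YangMills.Theorems.TwistedTraceScaling.Negative.TubePackageRhoIffInner
import Summits.QuantumFields.YangMills.Theorems.TwistedTraceScaling.Negative.AvgKernelNoLabSlowFactor
import Summits.QuantumFields.YangMills.Theorems.TwistedTraceScaling.Negative.AvgKernelNoLabSlowFactorKinetic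
import Summits.QuantumFields.YangMills.Theorems.TwistedTraceScaling.Negative.AvgKernelStiffFlip
import Summits.QuantumFields.YangMills.Theorems.TwistedTraceScaling.Negative.AvgKernelNoUntwistedStiffFactor
import Summits.QuantumFields.YangMills.Theorems.TwistedTraceScaling.Negative.AvgKernelStiffFlipOnSlice
import Summits.QuantumFields.YangMills.Theorems.TwistedTraceScaling.Negative.AvgKernelNoStiffFactorOnSlice
import Summits.QuantumFields.YangMills.Theorems.TwistedTraceScaling.Negative.SoftTubeOnIffInner
import Summits.QuantumFields.YangMills.Theorems.TwistedTraceScaling.Negative.StiffGapNotFromDomination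
import Summits.QuantumFields.YangMills.Theorems.TwistedTraceScaling.Negative.SupportRecordRadiusThree
import Summits.QuantumFields.YangMills.Theorems.TwistedTraceScaling.Negative.RecordInputFatRadius
import Summits.QuantumFields.YangMills.Theorems.TwistedTraceScaling.Negative.RecordInputExponentWindow
import Summits.QuantumFields.YangMills.Theorems.TwistedTraceScaling.Negative.FPWeightMustPinColour
import Summits.QuantumFields.YangMills.Theorems.TwistedTraceScaling.Negative.FPWeightMustPinColourTail
import Summits.QuantumFields.YangMills.Theorems.TwistedTraceScaling.Negative.ColourAverageSecondOrder
import Summits.QuantumFields.YangMills.Theorems.TwistedTraceScaling.Negative.StiffCaptureNecessity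
import Summits.QuantumFields.YangMills.Theorems.TwistedTraceScaling.Negative.StiffGapSlowDominance
import Summits.QuantumFields.YangMills.Theorems.TwistedTraceScaling.Negative.StiffGapProfileDominance
import Summits.QuantumFields.YangMills.Theorems.TwistedTraceScaling.Negative.QuasimodeDoorVacuous
import Summits.QuantumFields.YangMills.Theorems.TwistedTraceScaling.Negative.DefectDoorTight
import Summits.QuantumFields.YangMills.Theorems.TwistedTraceScaling.Negative.CentralGlueCoSupport
import Summits.QuantumFields.YangMills.Theorems.TwistedTraceScaling.Negative.CentralGaussianRadiusWindow
import Summits.QuantumFields.YangMills.Theorems.TwistedTraceScaling.Negative.CentralGaussianRadiusWindowLocal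
import Summits.QuantumFields.YangMills.Theorems.TwistedTraceScaling.Negative.CentralEuclideanRadius
import Summits.QuantumFields.YangMills.Theorems.TwistedTraceScaling.Negative.CentralEuclideanRadiusWindow
import Summits.QuantumFields.YangMills.Theorems.TwistedTraceScaling.Negative.ChartTransferWindow
import Summits.QuantumFields.YangMills.Theorems.TwistedTraceScaling.Negative.InnerGlueWindow
import Summits.QuantumFields.YangMills.Theorems.TwistedTraceScaling.Negative.SmearingWindowCost
import Summits.QuantumFields.YangMills.Theorems.TwistedTraceScaling.Negative.SmearingWindowBand
import Summits.QuantumFields.YangMills.Theorems.TwistedTraceScaling.Negative.CentralChartFloorVacuous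
import Summits.QuantumFields.YangMills.Theorems.TwistedTraceScaling.Negative.SmearingWindowSchedule
import Summits.QuantumFields.YangMills.Theorems.TwistedTraceScaling.Negative.ActionWindowSchedule
import Summits.QuantumFields.YangMills.Theorems.TwistedTraceScaling.Negative.ActionWindowRecord
import Summits.QuantumFields.YangMills.Theorems.TwistedTraceScaling.Negative.ActionWindowCoreDefect
import Summits.QuantumFields.YangMills.Theorems.TwistedTraceScaling.Negative.CoreWindowLedger
import Summits.QuantumFields.YangMills.Theorems.TwistedTraceScaling.Negative.CoreWindowBand
import Summits.QuantumFields.YangMills.Theorems.TwistedTraceScaling.Negative.CoreTransferRecordDefect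
import Summits.QuantumFields.YangMills.Theorems.TwistedTraceScaling.Negative.CoreDefectRecordRate
import Summits.QuantumFields.YangMills.Theorems.TwistedTraceScaling.Negative.CoreWindowActionFloor
import Summits.QuantumFields.YangMills.Theorems.TwistedTraceScaling.Negative.CoreWindowSufficiency
import Summits.QuantumFields.YangMills.Theorems.TwistedTraceScaling.Negative.StiffSeparationLeak
import Summits.QuantumFields.YangMills.Theorems.TwistedTraceScaling.Negative.StiffSeparationPureGauge
import Summits.QuantumFields.YangMills.Theorems.TwistedTraceScaling.Negative.ShadowWindowCurrencyFloor
import Summits.QuantumFields.YangMills.Theorems.TwistedTraceScaling.Negative.FrozenProfileOffDiagFloor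
import Summits.QuantumFields.YangMills.Theorems.TwistedTraceScaling.Negative.OutPieceMagneticBound
import Summits.QuantumFields.YangMills.Theorems.TwistedTraceScaling.Negative.StiffGapCeiling
import Summits.QuantumFields.YangMills.Theorems.TwistedTraceScaling.Negative.TensorGapCeiling
import Summits.QuantumFields.YangMills.Theorems.TwistedTraceScaling.Negative.BOStiffBlockCeiling
import Summits.QuantumFields.YangMills.Theorems.TwistedTraceScaling.Negative.BOStiffDoorGainCeiling
import Summits.QuantumFields.YangMills.Theorems.TwistedTraceScaling.Negative.CensoredPoincareKilling
import Summits.QuantumFields.YangMills.Theorems.TwistedTraceScaling.Negative.BasedWindowIslands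
import Summits.QuantumFields.YangMills.Theorems.TwistedTraceScaling.Negative.RecordCurrencyNoSlack
import Summits.QuantumFields.YangMills.Theorems.TwistedTraceScaling.Negative.DoorConductanceFloor
import Summits.QuantumFields.YangMills.Theorems.TwistedTraceScaling.Negative.QuasimodeProfileRigidity
import Summits.QuantumFields.YangMills.Theorems.TwistedTraceScaling.Negative.TwoSidedQuasimodePinch
import Summits.QuantumFields.YangMills.Theorems.TwistedTraceScaling.Negative.FlatModePoincareFailure
import Summits.QuantumFields.YangMills.Theorems.TwistedTraceScaling.Negative.ShellCellLinearGainWindow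
import Summits.QuantumFields.YangMills.Theorems.TwistedTraceScaling.Negative.ShellDominationWindow
import Summits.QuantumFields.YangMills.Theorems.TwistedTraceScaling.Negative.WindowFloorGuards
import Summits.QuantumFields.YangMills.Theorems.TwistedTraceScaling.Negative.FalseWithoutBetaGeOneKeepingThreshold
import Summits.QuantumFields.YangMills.Theorems.TwistedTraceScaling.Negative.WindowFloorTransfer
import Summits.QuantumFields.YangMills.Theorems.TwistedTraceScaling.Negative.WindowFloorOfCount
import Summits.QuantumFields.YangMills.Theorems.TwistedTraceScaling.Negative.WindowFloorOfBOWindow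
import Summits.QuantumFields.YangMills.Theorems.TwistedTraceScaling.Negative.LevelCountOfWindowFloor
import Summits.QuantumFields.YangMills.Theorems.TwistedTraceScaling.Negative.UniformAllSizes
import Summits.QuantumFields.YangMills.Theorems.TwistedTraceScaling.Negative.LabelLimitGuards
import Summits.QuantumFields.YangMills.Theorems.TwistedTraceScaling.Negative.LabelLimitPointwise
import Summits.QuantumFields.YangMills.Theorems.TwistedTraceScaling.Negative.LabelLimitCompact
import Summits.QuantumFields.YangMills.Theorems.TwistedTraceScaling.Negative.InvCouplingFormGuard
import Summits.QuantumFields.YangMills.Theorems.TwistedTraceScaling.Negative.GuardCutEquivalence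
import Summits.QuantumFields.YangMills.Theorems.TwistedTraceScaling.Negative.ClockCoefficientRigidity
import Summits.QuantumFields.YangMills.Theorems.TwistedTraceScaling.Negative.WindowLargeFieldEntropy
import Summits.QuantumFields.YangMills.Theorems.TwistedTraceScaling.Negative.WindowLargeFieldEntropyFixedLattice
import HarnessLib

/-!
# Disproof of `TwistedTraceScaling` — findings of the crux disprover (cycles 1–67)

Crux `LuscherReduction.TwistedTraceScaling` (stmt-QuantumFields-20203), skeleton «twolattice» (rev 1 stubs S-BASE
`stub_fixedLatticeTraceLaw`, S-TOWER `stub_twoLatticeUniversality`; S-OSTL `TraceDoor.oneSiteTraceLimit` landed; REV 2 «E1 COVERAGE»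
(2026-08-27, `Lines/twolattice.lean` sha16 34fd93842c24ce0a): S-BASE unchanged + TOWER-E1 `stub_towerE1`, see §D′; REV 3 «TWO-LOOP
CALIBRATION» (sha16 1a2ae9b1ae61a9c5): S-BASE + CMP-2LOOP `stub_cmpTwoLoop` + TRACK `stub_labelTracking` over a calibrator `φ` obeying the
two-loop law `Stmt.twoLoopLawH`, see §G; TRACK LANDED as a tree theorem `TwoLattice.stub_labelTracking` (LEAD g1, p548356) — see §H for
what that makes of CMP-2LOOP).
HONEST FRAMING: femto rung R2b1 of a CONDITIONAL reduction route — nothing below is a mass-gap or Clay statement.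
SIZE NOTE: the full move log (what moved from this work file to Annexes A–H and when, rev 15–81) is VERBATIM in `DisproofAnnexG.md` §P27 (moved at rev 81), continued for rev 82–84 in Annex G §P27a (Annex G frozen at rev 84) and from rev 84 on in `DisproofAnnexH.md` §P27b; latest entry: rev 84 — import R80/R80b + VERDICT 65–67 (+ V64 pointer) + HANDOFF cycle 65–67 lines + `R80` export + §BW `CycleSixtySevenChecks`; §P31 (VERDICT 64 paragraph, 4317 B) + §P13aa (`CycleSixtyFourChecks`, 3943 B) + §P32 (HANDOFF ledger lines 51–58, 8487 B) → Annex G; this file keeps the headings (A)–(E), VERDICT 1, the current VERDICT, the HANDOFF ledger lines of cycles 59–67, and all Lean re-exports/checks.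

**VERDICT (cycle 1): NO KILL** — the crux is equivalent to `r_L(β, ⌈sL/Λ⌉) → r_𝔥(s)` deep in the femto window (asymptotic scaling + Lüscher's leading order: physically true,
no finite/junk model inside the window contradicts it); the disprover certifies which hypotheses carry the weight.  Paragraph (1.1 kB, first nine landed `Negative/` files)
moved verbatim to Annex C §P6.5 at rev 51; everything conclusive is LANDED under `Theorems/TwistedTraceScaling/Negative/` and re-exported here; the one near-miss is §E.

VERDICT paragraphs of cycles 2–40 live VERBATIM in the annexes (map `DisproofAnnexC.md` §P2; cycles ≤ 19 Annex A, 20–34 Annex B §V1a–§V1o, 35–40 Annex C §V2b–§V2g; the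
docblock pointer/short paragraphs of rev 46–50 are in Annex C §P2–§P6); every cycle's verdict was NO KILL; kernel content re-exported below (`…Disproof.R6`–`R55`, `R50T`, `R53R`, `R53S`, `R54B`, `R54C`, `R54D`).  Cycle 40 in one
clause: the one-radius glue p686369 is dead from both sides (R47W, R48); on the decoupled schedule every landed exponent is `β^{-1/2}·polylog·poly(L)` (thresholds, no kill).
**VERDICT (cycles 41–41d)** — the four docblock paragraphs (rev 51–54; 7045 B) moved VERBATIM to `DisproofAnnexD.md` §P8.1 at rev 56 (full texts Annex C §V2h, §V2h.5–§V2h.7);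
one clause each: 41 (R49) the DECOUPLED glue is instantiable, every constraint a VOLUME floor `ℓ ≳ L^{3/2}` (`R_in < r_f/10.8`); 41b/41c (R50/R50T) the (C1a) windows are
FIRST-ORDER costs `βT²δu`, `βT²√σ` — admissible band `β^{-q}·polylog`, `q > 1/6`, certified both sides; 41d (R51) crude floor ∧ support inclusion ⇒ `χ_lo = 0` (side condition
`a_W < MK·powScale s β`).

**VERDICT (cycles 41e–43)** — the four docblock paragraphs (rev 55–60; 10061 B) moved VERBATIM to `DisproofAnnexE.md` §P14 at rev 67 (full texts also Annex C §V2h.8, Annex D §V3–§V5);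
one clause each: 41e (R52) the schedule window kills the smeared (OD) budget for `s′ < 1/6`; 42 (R53) the action ceiling `σ = β^{-1/3}` kills the (OD) budget of the draft record;
42b (R53R/R53S/R54-pre) the repaired record exponent meets `hb_small` — windows certified both sides; 43 (R54–R54D) the core-window ledger: every (C1)–(C4) window of the repaired
record is met with the typed margins (Annex D §V5 table) — ALL STILL IN FORCE as checks on any re-scheduled record.

**VERDICT pointers (cycles 44–58)** — the one-clause pointer paragraphs for cycles 44–47, 48–49, 50–51, 52–53, 54–55b, 56–56c, 57–57b, 58–58b (rev 65–79b; 5590 B) moved VERBATIM to `DisproofAnnexG.md` §P25 at rev 80; the paragraphs themselves are in Annex E §P15–§P16, Annex F §P17–§P21, Annex G §P22 (full texts Annex D §V6 – Annex G §V20); every guard they index (R55–R71: action floor, stiff separation, frozen-profile off-diagonal floor, stiff/tensor/door gap ceilings,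
censored Poincaré killing slack, based windows in mass form, record currency, door conductance floor, quasimode rigidity, flat-mode Poincaré failure, shell gain/domination windows) is STILL IN FORCE as a check on any re-scheduled record; all were MET BY DESIGN in lane A's landed pen and shells.

**VERDICT (cycles 59, 60)** — docblock paragraphs moved VERBATIM to `DisproofAnnexG.md` §P23 (cycle 59, at rev 79) and §P24 (cycle 60, at rev 80; full texts Annex G §V21, §V22); one clause
each: 59 (R72 `Negative/WindowFloorGuards`) guards on the window floor W(L) — `g 0 = 0`, COUNTING form, trial-state form, no rate in the `∀ A, ∃ β0` gain texts; 60 (R73a–c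
`Negative/StrongCouplingKernelBridge`, `…StrongCouplingTraceBridge`, `…FalseWithoutBetaGeOneKeepingThreshold`) ★ §E CLOSED — `1 ≤ β` is load-bearing with the lattice threshold KEPT
(operator bridge `K_β ↔ 𝕎`, `L`-uniform strong-coupling trace-ratio bound `r_L(β,T) ≥ 1 − 24L³Te^{−⌊T/2⌋}`); verdict NO KILL.

**VERDICT (cycle 61)** — docblock paragraph moved VERBATIM to `DisproofAnnexG.md` §P26 at rev 81 (full text Annex G §V23); one clause: ★★★ S-BASE CLOSED BY NAME by lane A
(✓p763201 `…StubFixedLatticeTraceLaw`, W1–W8 + R1–R5 + ✓p761394) READ FROM THE TREE AND VETTED SOUND; R74a–d (`Negative/WindowFloorTransfer`, `…WindowFloorOfCount`,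
`…WindowFloorOfBOWindow`, `…LevelCountOfWindowFloor`: W(L) ⇔ COUNT(L), fixed-slack robustness, W ⟸ UBO-CAP ∕ (★), COUNT(L) unconditional at `L ≥ 2`); crux = `stub_cmpTwoLoop`
ALONE (✓p763463 `…CruxOfCmpTwoLoop`); verdict NO KILL.

**VERDICT (cycle 62)** — docblock paragraph moved VERBATIM to `DisproofAnnexG.md` §P28 at rev 82 (full text Annex G §V24); one clause: ★★★ the open stub in its SMALLEST CURRENCY —
`R75.cmpTwoLoop_iff_labelLimit : Stmt.stub_cmpTwoLoop ↔ LIM` (window-free, threshold-free label limit; UFTL ⟺ UFTL₀ ⟺ LIM, LIM → FTL), ★ `R75c.labelLimit_pointwise (L)` (LIM lattice by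
lattice is a THEOREM — the stub is ONE quantifier swap `∃ Λ0 ∀ L`), guards `R75b`/`R75c` (LIM false without `1 ≤ β` — strong root, every `L`; false without `0 < Λ` — junk `Λ(1, L) = 0`
past the Landau root, `L ≥ 218`; both also behind a size threshold); verdict NO KILL.

**VERDICT (cycle 63)** — docblock paragraph moved VERBATIM to `DisproofAnnexG.md` §P30 at rev 83 (full text Annex G §V25); one clause: FREE RESTATEMENTS of the open swap —
★ LIM ⟺ TAIL ⟺ `s`-COMPACT-UNIFORM form ⟺ X-FORM (`R76`, with stub-level certificates), the X-FORM's single guard `1 ≤ β` load-bearing and its pointwise-in-`L` form a THEOREM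
(`R77`; open content `∃ X0 ∀ L`), the guard EXACTLY the exclusion of `β → 0⁺` — any fixed cut `c > 0` admissible, the cut `0 < β` false (`R78`); verdict NO KILL.

**VERDICT (cycle 64)** — docblock paragraph moved VERBATIM to `DisproofAnnexG.md` §P31 at rev 84 (full text Annex G §V26); one clause: ★★★ the clock coefficient is
TWO-SIDEDLY RIGID — over-corrected running clocks `c > b₁/b₀` false AS TYPED unconditionally (junk `T = 0`), under-corrected `c < b₁/b₀` false mod FTL (cycle 3), so mod
FTL ∕ the crux ∕ LIM ∕ the stub (law clocked by `Λ_c`) ⟺ `c = b₁/b₀` (`R79`); verdict NO KILL.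

**VERDICT (cycles 65–67)** (gens 65–66, 08:45Z–09:12Z: state checks only, no rev, no module — Annex H §V27.0; gen 67, 09:19Z–09:55Z; modules ✓p768115
`Negative/WindowLargeFieldEntropy.lean` (R80, `…Negative.R80`, 23 theorems) + ✓p768167 `Negative/WindowLargeFieldEntropyFixedLattice.lean` (R80b, `…Negative.R80b`,
3 theorems); def-free, standard axioms, 0 sorry ∕ 0 warnings, no `Theses` import; Annex H §V27).  No new CMP-2LOOP text since cycle 62 (fleet INBOX ends l.2183 — an ops
line for another route; no skeleton rev 4; lane A FINAL g24; owner idle since 08-27; no `disprover-wanted`, no director request) — nothing to vet.  Fresh-eyes audit (paper,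
Annex H §V27.1): the electric-flux ∕ toron sector is projected out on BOTH lattices by `physAvg` (the `L = 1` twist is the centre flip), and tunnelling moves `e = 0` levels by
`O(e^{−c/ḡ})·λ/L`, `L`-uniformly in `Λ` [KollerVanbaal1986] — no lever.  THIS SEAT'S MODULES type the LARGE-FIELD ENTROPY of the window (a direction cycles 1–66 never
typed): ★ `R80.beta_le_of_window_sharp` — for every `θ > 0` there is `C(θ, lam)` with `β ≤ (4b₀ + θ) log L + C` on `W(lam, L)` for ALL `L` (K-trick `log y ≤ y/K + log K − 1` on
the window's `1/ḡ² ≤ 1/lam³`, `b₁/(2b₀²) = 51/121`; `log log` form `R80.beta_le_of_window_loglog`), which with ✓`four_b0_log_lt_beta_of_window` (`4b₀ log L < β`) PINS THE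
WINDOW TO THE TWO-LOOP SCALING TRAJECTORY `β/log L → 4b₀` (`R80.beta_window_two_sided`), i.e. `L⁴ = e^{(β/b₀)(1 + o(1))}` — the femto universe's cutoff 4-volume is `a(β)⁻⁴`.
Hence for a fixed action defect `δ ≥ 0` (tree weight `e^{−βS}`, `S = Σ_p (N − Re tr U_p)`; one plaquette raised by `δ` costs `e^{−δβ}`) the POWER LAW ★ `L^{4−4b₀δ−θ} ≤ L⁴e^{−δβ}
≤ L^{4−4b₀δ}` on `W(lam, L)` (`R80.fourVolume_defect_ge ∕ _le`; lower side eventually in `L`), and ★★ THE ENTROPY THRESHOLD `δ* = 1/b₀ = 24π²/11 ∈ (21, 22)`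
(`R80.inv_b0_eq ∕ inv_b0_bounds`; = `6/11` of the one-instanton action `4π²β`, the number of the Pugh–Teper «entropy bound» `48π²/11`): `δ < 1/b₀` ⇒ `L⁴e^{−δβ}` and the
femto 4-volume weight `L³·T_s·e^{−δβ}` (`T_s = ⌈sL/Λ⌉ ≥ sL/(2 lam)`) UNBOUNDED along the window (`R80.fourVolume_defect_unbounded`, `R80.femtoVolume_defect_unbounded`),
`δ > 1/b₀` ⇒ both `→ 0` (`R80.fourVolume_defect_small`, `R80.femtoVolume_defect_small`); summary `R80.window_entropy_threshold`.  Since ONE `SU(2)` plaquette costs at most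
`δ = 2N = 4 < 21` (`R80.four_lt_inv_b0`, `R80.sixteen_b0_lt_one`), ★★ `R80.cutoffScale_defect_ge_cube`: for EVERY per-plaquette event (`0 ≤ δ ≤ 4`) `L³ ≤ L⁴e^{−δβ}` eventually
on the window — cutoff-scale large fields are ABUNDANT in the femto universe on the scaling window; the union bound «plaquettes × worst Boltzmann factor» certifies nothing
there.  CONTRAST (`R80.fourVolume_defect_tendsto_zero_fixedL`, `R80b.femtoSteps_le_of_one_le` (`T_s ≤ sLβ + 1` for `β ≥ 1`), `R80b.femtoVolume_defect_tendsto_zero_fixedL`,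
`R80b.femtoVolume_defect_fixedL_vs_window`): at FIXED `L`, as `β → ∞`, the same weights tend to `0` for every `δ > 0` — the S-BASE regime (closed stub) is entropy-free, the
window regime is not: one more typed face of the open swap `∀ L ∃` versus `∃ ∀ L`.  Reading for suppliers and a rev 4 (regime (bl), Annex H §H1ao): no single-scale argument
«small-field expansion + large fields suppressed by (4-volume)·e^{−pβ}» with `p` independent of `L` can supply CMP-2LOOP ∕ LIM (void for `p < 1/b₀`, and `p ≤ 4` per
plaquette); cutoff-scale large fields must be renormalised scale by scale (irrelevance is a power of `a/ℓ = 1/L`, not a Boltzmann factor) — the planners' «NOT DECOMPOSED YET: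
multi-scale» made quantitative with the threshold on both sides; an S-BASE technique does not transfer to CMP-2LOOP by "uniformity inspection" unless its large-field step is
re-done scale by scale.  This constrains PROOFS, not the statement: it refutes nothing.  NOT certified and NOT free (unchanged from (bi)(iv)): uniformity down to `s → 0⁺`, a
rate in `Λ`, an `ε`-free depth, uniformity on `[a, ∞)`.  Frontal attack on LIM itself: none available (67 cycles) — believed true (asymptotic freedom), not in print.
VERDICT (cycle 67): NO KILL of the crux; 2 negative-side modules landed (R80, R80b; IMPORTED, re-exported §BW); UPDATE 38 posted; evidence `evidence-g67.md`; ledger Annex H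
§H0as; regime (bl) Annex H §H1ao.
HONEST FRAMING: window-label real analysis and guard ∕ rigidity theorems around the OPEN stub `stub_cmpTwoLoop` (≡ UFTL ≡ LIM ≡ TAIL ≡ X-FORM) of a child of the CONDITIONAL
reduction route R2b1; the crux `TwistedTraceScaling` rests on that stub and is OPEN (not refuted, not closed); fixed-lattice statements only; not infinite volume, not a mass gap,
not Clay.



## (A) Load-bearing analysis (theorems `…_false_without_…`) — body (2208 B) in Annex C §P2 (rev 47); theorems re-exported below.
## (B) Boundary facts (landed) — body in Annex C §P3 (rev 48).
## (C) Natural strengthenings — body in Annex C §P3 (rev 48; depth uniform in `s` TRUE on paper; threshold uniform in `L` is the near-miss §E).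
## (D) Targets (the line's stubs) — body in Annex C §P2 (rev 47).  ## (D′) Targets rev 2 «E1 COVERAGE» — body in Annex B §D1 (rev 41).
## (E) Near-miss — ★ CLOSED at cycle 60 (R73c `Negative/FalseWithoutBetaGeOneKeepingThreshold.lean`; NO `sorry` left in this file); body in Annex C §P3 (rev 48); theorem below (§E).
((A)–(E) pointer sentences as they stood at rev 47–49 (1.5 kB) moved verbatim to Annex C §P5.5 at rev 50.)

## (F)–(W) Cycles 3–19 (clock rigidity, rev-3 targets, CMP-2LOOP, S-BASE sub-targets, round-2 re-cuts, R8–R16, BO package, O′, two zones, D0⁺) — headings, pointer sentences and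
## index lines (4.3 kB) moved VERBATIM to `DisproofAnnexC.md` §P4.2 at rev 49 (bodies in Annex A §F–§W since rev 15/24; (K)–(S) index lines in Annex C §P3.6–§P3.7; index of cycles
## 20–29 in Annex C §P0); the Lean sections (F)–(W) and their `Cycle…Checks` stay below.


## HANDOFF
landed: every `Negative/` module is IMPORTED above and re-exported below; the per-cycle ledgers (sections, what each certifies, lane A's vetted bricks, p-ids) live VERBATIM in the
annexes — cycles 1–19 `DisproofAnnexA.md` §H0, 20–28c `DisproofAnnexB.md` §H0b/§H0c, 29–34 `DisproofAnnexC.md` §H0j, 35 §H0k, 36 §H0l; the two ledger paragraphs kept here at rev 45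
(1071 B: annex map + cycles 29–34 pointer) moved verbatim to Annex C §P1 at rev 46.
cycles 35–40 ledger lines (rev 45–50; R43–R48, §AN–§AS) moved verbatim to Annex C §P2/§P3/§P4.3/§P5.3/§P6.3 (rev 47–51); ledgers Annex C §H0k–§H0p.
cycles 41–41d ledger lines (rev 51–54; R49, R50, R50T, R51 = §AT–§AW; 1553 B) moved verbatim to Annex D §P8.2 (rev 56); ledger Annex C §H0q; all four modules IMPORTED,
re-exported below.
cycles 41e–50 ledger lines (rev 55–65; R52–R62, §AX–§BH; 9640 B) moved VERBATIM to `DisproofAnnexG.md` §P29 at rev 82; ledgers Annex C §H0q – Annex E §H0aa; all modules remain IMPORTED above and re-exported below.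
cycles 51–58 ledger lines (rev 66b–77b; R63–R71, §BI–§BP; 8487 B) moved VERBATIM to `DisproofAnnexG.md` §P32 at rev 84; ledgers Annex E §H0ab – Annex F §H0al; all modules remain IMPORTED above and re-exported below.
cycle 59 (rev 78; `DisproofAnnexG.md` opened — Annex G §V21, ledger §H0am, regime (bf) §H1ai): ✓p758672 `Negative/WindowFloorGuards.lean` (`…Negative.R72`) — guards on the window floor W(L₁) (`hW` of
✓`Base.fixedLatticeTraceLaw_of_upper_lower_window`, verbatim): `g 0 = 0` forced; COUNTING form `N_β(E) ≤ #{g_k < E} ≤ e^{tE}Σ'e^{−tg}` (`E ≤ c₁ log β`); trial-state form via R6;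
squeeze `g_k ≤ Δ_k + ε` against COARSE-LOWER; the `∀ A, ∃ β0` gain texts carry no rate (witness `√log β`); lane A ✓p757703 `…ShellChain`, ✓p757643 `…RecordExposed`, ✓p758044
`…ShellRecordLow` + w1 ✓p757581 `…BODefectCoreRateLow`, ✓p758008 `…BODefectHODLow` vetted SOUND (COARSE-UPPER(L) closing; the 8 `record_low` instances certified §BQ (iv)); verdict
NO KILL — IMPORTED, re-exported below (§BQ).
cycle 60 (rev 79; Annex G §V22, ledger §H0an): ✓p760584 `Negative/StrongCouplingKernelBridge.lean` + ✓p760746 `Negative/StrongCouplingTraceBridge.lean` (`…Negative.StrongRoot`: bridge `K_β ↔ 𝕎`,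
`c·λ₊ ≤ λ₀`, `c𝕎 = A` on physL2, `P_L ≤ c^T Z^{cyc}_L`, ★`r_L(β,T) ≥ 1 − 24L³Te^{−⌊T/2⌋}` `L`-uniformly at strong coupling) + p761024 `Negative/FalseWithoutBetaGeOneKeepingThreshold.lean` (★ §E CLOSED:
`1 ≤ β` load-bearing with the threshold kept); lane A ✓p759005 `…CoarseUpperOfHOD` vetted SOUND (`coarseUpper (2 ≤ L)` = `hUp` verbatim); verdict NO KILL — IMPORTED, re-exported below (§BR).
cycle 61 (rev 80 = 2aadf95b1ca5, 80b = + R74c; Annex G §V23, ledger §H0ao, regime (bh) §H1ak): ✓p761977 `Negative/WindowFloorTransfer.lean` (`…Negative.R74`: W(L) insensitive to FIXED slack; ★★ W(L) ⟸ UBO-CAP(L)) +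
✓p762066 `Negative/WindowFloorOfCount.lean` (`…R74b`: ★ W(L) ⇔ COUNT(L), profile `∃ g` eliminable) + ✓p763547 `Negative/WindowFloorOfBOWindow.lean` (`…R74c`: W(L), S-BASE ⟸ lead's (★)
BO-WINDOW(L)) + ✓p763591 `Negative/LevelCountOfWindowFloor.lean` (`…R74d`: ★ COUNT(L) unconditional at `L ≥ 2`); ★★★ lane A CLOSED S-BASE BY NAME — ✓p763201 `…StubFixedLatticeTraceLaw`
(g24 W1–W8 + w1 g3 R1–R5 + g23 ✓p761394), vetted SOUND (abbrev byte-identical to skeleton r3, axioms standard, guards (bf) honoured); crux = `stub_cmpTwoLoop` ALONE (✓p763463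
`…CruxOfCmpTwoLoop`); verdict NO KILL — IMPORTED, re-exported below (§BS).
cycle 62 (rev 81; Annex G §V24, ledger §H0ap, regime (bi) §H1al): ✓p764256 `Negative/UniformAllSizes.lean` (`…Negative.R75`: UFTL ⟺ UFTL₀ ⟺ LIM — size threshold and dyadic windows carry no
content; ★★★ `cmpTwoLoop_iff_labelLimit : Stmt.stub_cmpTwoLoop ↔ LIM`; `femtoTraceLaw_of_labelLimit : LIM → FTL`) + ✓p764418 `Negative/LabelLimitGuards.lean` (`…R75b`: LIM false without
`1 ≤ β` (strong root, `L = 1`) ∕ without `0 < Λ` (junk `Λ(1, L) = 0` past the Landau root, two-`s` trick, no lattice value)) + ✓p764531 `Negative/LabelLimitPointwise.lean` (`…R75c`: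
★ `labelLimit_pointwise (L)` THEOREM — the stub is ONE quantifier swap `∃ Λ0 ∀ L`; `strongRoot_violates (L)`; both guards load-bearing behind a size threshold); no new CMP-2LOOP text
(lane A FINAL; director: none without new mathematics); verdict NO KILL — IMPORTED, re-exported below (§BT).
cycle 63 (rev 82; Annex G §V25, ledger §H0aq, regime (bj) §H1am): ✓p765081 `Negative/LabelLimitCompact.lean` (`…Negative.R76`: ★ LIM ⟺ TAIL (size threshold chosen with the depth carries no
content) ⟺ `s`-COMPACT-UNIFORM form (Pólya: monotone clocks + ✓`traceRatio_mono` + uniform continuity of `r_𝔥` on `[a, b+1]`) ⟺ X-FORM `∃ X0 ∀ L ∀ β ≥ 1, X0 ≤ 1/ḡ²(β, L) → …` (one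
two-loop scaling trajectory for all cutoffs); stub-level `cmpTwoLoop_iff_tail ∕ _iff_compactUniform ∕ _iff_invCouplingForm`) + ✓p765418 `Negative/InvCouplingFormGuard.lean` (`…R77`: X-FORM
false without `1 ≤ β` (strong root, every `L`, behind thresholds); sign of `X0` cosmetic; ★ X-FORM pointwise in `L` THEOREM — open content `∃ X0 ∀ L`) + ✓p765658
`Negative/GuardCutEquivalence.lean` (`…R78`: ★ any FIXED cut `c > 0` in place of `1 ≤ β` gives the same LIM ∕ X-FORM (⟺ stub: `cmpTwoLoop_iff_labelLimit_cut ∕ _iff_invCouplingForm_cut`); the cut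
`0 < β` gives false texts (`…_false_posCut`); the guard is exactly the exclusion of `β → 0⁺`); no new CMP-2LOOP text (no rev 4;
lane A FINAL; director: none without new mathematics); verdict NO KILL — IMPORTED, re-exported below (§BU).
cycle 64 (rev 83; Annex G §V26, ledger §H0ar, regime (bk) §H1an): ✓p766595 `Negative/ClockCoefficientRigidity.lean` (`…Negative.R79`: ★★ OVER-corrected running clocks
`c > b₁/b₀` (label `A_c = β/2 − 2b₀ log L − c log(β/(2b₀))`) FALSE AS TYPED unconditionally — `A_c ≤ 0` eventually throughout the window (`clockLabel_nonpos_eventually`), junk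
`T = 0` for every `s`, two femto times (`not_fastClockTraceLaw`; LIM currency `not_fastClockLabelLimit`); ★★★ two-sided rigidity `clockTraceLaw_iff_coeff_eq : FTL → (law_c ↔
c = b₁/b₀)`, `clockLabelLimit_iff_coeff_eq (_of_cmpTwoLoop) : LIM ∕ stub → (LIM_c ↔ c = b₁/b₀)` — closes cycle 3's open side (b) of ✓`ClockRigidity`); scheme-content audit of
`b₀, b₁` and the label (universal values; relative `o(1)` class) — no lever; no new CMP-2LOOP text (no rev 4; lane A FINAL; owner idle); verdict NO KILL — IMPORTED, re-exported
below (§BV).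
cycles 65–66 (no rev; Annex H §V27.0; fleet STATUS l.348–349): state checks only (no rev 4 ∕ supplier ∕ `disprover-wanted` since UPDATE 37; tree rev 83 re-checked rc 0 ∕ 0 ∕ 0); fresh-eyes
paper audits (s-uniform absolute, `[a, ∞)`, `ε`-free, `Λ`-rate, toy groups; `β`-normalisation traced to the `wilsonAction` body; two-lattice same-`T` structure; polymer-sum uniformity)
— no bite, nothing filed (no variants); verdict NO KILL.
cycle 67 (rev 84; Annex H §V27, ledger §H0as, regime (bl) §H1ao): ✓p768115 `Negative/WindowLargeFieldEntropy.lean` (`…Negative.R80`: ★ window ⇒ `β ≤ (4b₀ + θ) log L + C(θ, lam)`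
for every `θ > 0`, all `L` (with ✓`4b₀ log L < β`: the window IS the two-loop scaling trajectory, `β/log L → 4b₀`); ★ power law `L^{4−4b₀δ−θ} ≤ L⁴e^{−δβ} ≤ L^{4−4b₀δ}`; ★★ ENTROPY
THRESHOLD `1/b₀ = 24π²/11 ∈ (21, 22)` two-sided (`δ < 1/b₀`: `L⁴e^{−δβ}`, `L³·T_s·e^{−δβ}` unbounded along the window; `δ > 1/b₀`: `→ 0`); ★★ every per-plaquette event (`δ ≤ 2N = 4`)
has `L³ ≤ L⁴e^{−δβ}` eventually — cutoff-scale large fields abundant, union bound void, suppliers must be multi-scale) + ✓p768167 `Negative/WindowLargeFieldEntropyFixedLattice.lean`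
(`…Negative.R80b`: at fixed `L`, `T_s ≤ sLβ + 1` and `L³·T_s·e^{−δβ} → 0` as `β → ∞` — S-BASE regime entropy-free vs window regime); toron ∕ e-flux audit (no lever); no new
CMP-2LOOP text (no rev 4; lane A FINAL; owner idle); verdict NO KILL — IMPORTED, re-exported below (§BW).
sorried: NONE (§E closed at cycle 60 by R73c; cycles 1–59: §E only).  next regimes — ALL STILL IN FORCE, verbatim in `DisproofAnnexB.md`: items (1)–(11), (a)–(k) (cycles 5–23) §H1 (rev 32); (l)–(n) §H1b; (o)–(q)
§H1c; (r)–(s) §H1d; (t) §H1e (rev 41) — the half-line summaries of (l)–(q) kept here at rev 34–40 (1732 B) moved verbatim to Annex B §H1e at rev 41 (size cap).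
(r)–(z): half-line summaries verbatim in Annex B §H1g ((r)–(w)) and Annex C §H1h ((x)–(z)); the (r)–(x) lines kept here at rev 44–45 (1063 B) moved verbatim to Annex C §H1i at
rev 46 — ALL STILL IN FORCE.  (aa)–(ad) (R44–R47, cycles 36–39; originals Annex C §H1i–§H1l): the four regime paragraphs kept here at rev 46–49 (2.2 kB) moved
verbatim to Annex C §P5.2 at rev 50; (ae) (R48, cycle 40; Annex C §H1m/§P6.4: price every SUPPLIER of a chart-ball hypothesis on the CONSUMER's window) — ALL STILL
IN FORCE.  (af) (R49, cycle 41; Annex C §H1n) for every DECOUPLED restatement run the four-slot window — (1) Euclidean kill radius `(8/7)(6R_Ω+50T²)` vs `min(ρ, R₀−R_in)`;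
(2) informativeness `(R₀−6T²R_in)²β > 9L³log 2 + 98βR_in²`; (3) COVERING `R₀ + R_in ≤ R_w ≤ r_f`; (4) CAPTURE `R_in ≳` the profile's mass radius (`≍ L^{3/2}β^{-1/2}`) — report
the VOLUME-dependent floor on `ℓ = r_f√β` (here `ℓ > 2.5…6.25·L^{3/2}`, `R_in < r_f/10.8`) and check the announced numbers (`0.83/(1/12)` is at the edge); an `L`-independent
`ℓ = btLog β` is fine ONLY as "eventually in β at each fixed L" (`β₁ = β₁(L)`); insist that (C4)'s capture radius and (C1)'s inner radius are the SAME `R_in`. (ag) (R50, cycle 41b; Annex C §H1n) for every SMEARING / INDICATOR amplitude price its WINDOW radii as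
first-order costs in the smearing exponent (`βT²·δu`, `βT²·√σ`, with `βT² = 225L²ℓ⁴` on schedule B) against `λ_b^{1/2} ≍ β^{-1/6}`: a window `β^{-q}` needs `q > 1/6`
(so `δu ≍ β^{-s}`, `σ ≍ β^{-4s}…β^{-2s}`, never `β^{-s/2}` / `β^{-s}`). Band certified BOTH sides (cycle 41c):
R50 negative (`q = s/2 < 1/6`), R50T positive (`q = s > 1/6`, polylogs `(log β)^m` included, `polylog_window_affordable`); when a RATES file lands, match its `δu, σ, T`
against `window_floor_affordable` / `action_floor_affordable` (hypothesis shape `βT(β)² ≤ 225L²(log β)⁴`, `β ≥ 1`).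
(ah) (R51, cycle 41d; Annex C §H1n) CROSS EVERY WINDOW FLOOR WITH EVERY SUPPORT INCLUSION: for each pair (floor `χ_lo ≤ χ` on a window of radius `a`; inclusion
`supp(test function) ⊆ {weight ≠ 0}` whose weight has LINK radius `ρ_link`) run the constant one-site configuration `diagSU2(2arcsin(t/2))`, `t ∈ [ρ_link, a]`: non-empty ⇒
`χ_lo = 0` and every constant carrying `χ_lo` dies (`chilo_nonpos_of_floor_window`); demand the explicit side condition `a < ρ_link` (numbers on the schedule) in the RATES file. (ai) (R53, cycle 42; Annex D §H1o) CROSS EVERY WINDOW EXPONENT WITH THE LOG-GROWTH OF `βT²`: on schedule B `βT² ≍ L²ℓ⁴` with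
`ℓ = btLog β → ∞`, so a floor `βT²·β^{-p}` AT THE ENDPOINT `p = 1/6` (`δu = β^{-1/6}`; `√σ = β^{-1/6}`, i.e. `σ = β^{-1/3}`) is not a constant times `λ_b^{1/2}` but
`(log β)⁴·λ_b^{1/2}` and kills `hb_small` (R21's constant-`κ` `offDiag_budget_at_one_sixth` is no defence); demand STRICT exponents `s' > 1/6`, `q > 1/3` in every schedule /
record file and re-run the summand table (Annex D §V3.2) on each record lane A lands — the landed `…BOCentralRecord` (p703178) DOES carry `σ = powScale (1/3) β`: priced
verbatim by R53R (record exponent) and R53S (the (C4) core-defect constant `ε ≥ η` of `core_transfer_defect_le`, all radii) at cycle 42b (§AZ, Annex D §V4/§H1p); next: the twin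
record / `…BOCentralRatio` / the action ceiling of `𝒰_β` in the (C4) files.
(ak) (R54, cycle 43; Annex D §H1q) PRICE EVERY (C4) FILE AGAINST THE WINDOW BOX: read off `(δ, δu, σ)` of its `core_transfer_defect_le` call and the `𝒰_β` its `φ` lives in;
`s ≤ 1/6` / `p ≤ 1/6` / `q ≤ 1/3` ⇒ dead by `not_hb_small_of_output_radius` / `…_of_input_radius` / R53S; `𝒰_β ⊇ core` (`hcore`) ⇒ `δu ≥ (13/4)(L³β)^{-1/5}` — an input window
`powScale p β`, `p > 1/5`, paired with `BOBricks.𝒰` is INCONSISTENT (`record_inputWindow_not_core`); inside the box quote `windows_hb_small` and move on to `c₁P/Λ`, `η_c`, (B-ST).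
(am) (R55, cycle 44; Annex D §H1r) PRICE THE ACTION CLAUSE OF EVERY SLOW / SUPPORT WINDOW AGAINST `hcore`: a clause `L³S(u) ≤ σ_β` on a set that must contain the core needs
`σ_β ≥ L³(13(L³β)^{-1/5})⁴/64 ≍ L^{3/5}β^{-4/5}` (`action_floor_of_hcore`), i.e. `q ≤ 4/5` — with `hb_small` (`q > 1/3`, R54B) the band is `1/3 < q ≤ 4/5`; and audit every brick
quantified over all `φ` supported in `𝒰_β` (`hN`, `hT`, `hOD`, `hOD_of_defect`) for uniformity out to `(L³β/2)S ≍ (L³β)^{1/5}` (`core_magnetic_exponent_unbounded`): a proof step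
using `(L³β)·S(u) = O(1)` (or a Gaussian one-site expansion around `u = 1` with bounded exponent) on the whole window is a bite.
(an) (R56/R56B, cycle 45; Annex D §H1s) PRICE EVERY STIFF-SEPARATION / KINETIC-COERCIVITY STEP BY ITS DOMAIN AND SLACK: a claim `inf_g kinDefect(U^c, V, g) ≥ c‖P_s(x' − x)‖² − δ`
is tested at the pure-gauge copies of the centre (`R56B.exists_pureGauge_witness_two`: defect `0`, `‖P_s x'‖² ≥ ‖x'‖⁴/8192`) — on a domain containing `U` with `‖P_Γ x'‖ ≍ ‖x'‖ = r`
it needs `δ ≥ c r⁴/8192`; at `r ≍ β^{-s}` that is `β^{-4s} ≫ β^{-1}` (bite unless the domain is GAUGE-NEAR, `‖P_Γ x'‖ ≤ β^{-1}ℓ`); the `[u_k − 1, ξ]` cross term is NOT a bite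
(`R56`: constant part ∈ constModes, fluctuation leak ≤ κ × own Γ-component, κ = 24√(3|E|)C_Pτ) — quote `R56.linearised_stiff_separation` and move on to the second-order terms
(`Q² = o(β^{-1})` iff `s > 1/6`) and to (B-ST).
(ao) (R58, cycle 46; Annex D §H1t) PRICE EVERY hOD / (B-OD) RATE CLAIM AGAINST THE FROZEN-PROFILE TILT: the record profile has no slow argument, so at a slow point `u` at the
window edge the true fibre top state is tilted by `θ_u ≍ A_L·orbitDist u` (`L ≥ 3`; `A_2 = 0` at first order) and `b ≥ cos θ_u sin θ_u θ₀` (`R58.offDiag_floor_of_bound`): a claimed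
rate `b = O(β^{-r})` with `r > s` (window exponent `s`), or any `b` uniform over a window of exponent `s ≤ 1/6`, is a bite for `L ≥ 3` (`R58.frozenProfile_not_hb_small`); rates
`Õ(β^{-s})` with `1/6 < s` pass (`R58.firstOrder_floor_affordable`) — then move on to (B-ST) (`θ₀(L) > 0` uniform in `β` at fixed `L`: Rayleigh of the sign-flipped / boundary-supported `v`
is `≈ Λ₁/Λ₀ = r(L) = 1/(μ/2 + 1 + √(μ²/4 + μ))`, `μ = μ_min = 2 − 2cos(2π/L)`, `θ₀ = 1 − r(L)`; `L = 2`: `r ≈ 0.172`) and to the hOD assembly's `b = √(2Σb_i²)` (each `b_i` must itself be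
`Õ(β^{-s})`).
(ap) (R59, cycle 47; Annex D §H1u) BEFORE ATTACKING A KERNEL BOUND, CHECK WHICH FACTOR OF `K_β = latE·e^{−(β/2)(S(U)+S(V))}` THE AUTHOR DROPPED: a `U`-region with
`S(U) ≥ A` has `avgKernel β U V ≤ e^{2β|E|}e^{−βA/2}` for EVERY `V` (`R59.avgKernel_le_magnetic`); on the orthographic tube `S ≥ (gap/16)‖x‖²` once `‖P_Γx‖ ≤ ‖x‖/2` and the record
smallness holds (`R59.wilsonAction_orthoTube_ge_sq`) — so ANY separation / off-diagonal kernel target whose `U`-set sits at fluctuation radius `‖x‖ ≥ R₀` with `βR₀² → ∞` is TRUE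
by magnetics alone (no `g`-analysis) and is not a place to look for a kill; kills, if any, live where `S(U)` AND `S(V)` are both `O(β^{-1})`: the core / the slow window / (B-ST).
(aq) (R60, cycle 48; Annex D §H1v) THE STIFF CONSTANT IS `L`-DEPENDENT: in the Mehler model of (B-ST) the admissible constants are EXACTLY `ρ = 1 − θ ∈ [max_k r_k, 1]`
(`R60.mehlerGap_iff`), so `θ₀ ≤ 1 − mehlerRatio g₀(L) ≤ 2π/L + (2π/L)²` (`R60.stiffGap_le_vacuum`) and NO `L`-uniform `θ₀` exists (`R60.no_uniform_stiffGap`; `θ₀ = 1/2` dies at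
`L = 9`, `R60.stiffGap_half_fails`).  When (B-ST) is filed CHECK: (i) `θ₀` is a function of `L` (or the file is at fixed `L` with `θ₀ < 1 − r(g₀(L))`: `L = 2`: `< 0.83`, `L = 9`:
`< 0.49`); (ii) every CONSUMER of `θ₀` (`SoftTubeBOPackageAt`'s `b² ≤ εθ₀λ_b/16`, the Feshbach denominator, S-TOWER's use of S-BASE constants) tolerates `θ₀ ≍ 1/L`; (iii) the gauge
profile of the dual test function is the record's (`κ = 1`, `frozenProfile_mul_softWeight_orthoTube`) — a mismatched profile is R40-dead, not a new target.  The ceiling is typed: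
do not re-derive it.
(ar) (R61, cycle 49; Annex E §H1w) THE SLOW SIDE OF THE TENSOR MODEL GIVES NOTHING BACK: lane A's `abs_tensorForm_sub_slow_le` is ATTAINED (`R61.tensorGap_attained`) and Hermite
block-diagonal with blocks `λ_α·k` (`R61.tensorForm_hermiteBlock`).  (i) Any (B-ST) constant obtained «after tensoring with the slow kernel» or «under orthogonality at every slow
point» obeys the SAME ceiling `θ₀(L) ≤ 1 − mehlerRatio g₀(L)` (`R61.tensorStiff_iff`, `R61.no_uniform_tensorStiff`; in the package's BO currency: `ρ ≥ 1 − 2π/L − (2π/L)²`,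
NO `L`-uniform `ρ < 1` in `T(Φ−PΦ,Φ−PΦ) ≤ λ₀ρμ₁‖Φ−PΦ‖²`, `R61B.boStiff_iff`/`R61B.no_uniform_boStiff`; a Feshbach step may use `(1−ρ)⁻¹ ≍ L/2π` at fixed `L` only) — do not look
for slow-momentum gains in `hST`.  (ii) The model's
off-diagonal Hermite blocks VANISH, so the Mehler model says nothing about (B-OD)'s `b`: its size is R58's floor `β^{-s}` (slow-point dependence of the fibre ground state /
anharmonicity); when (γ) is filed CHECK that `b` is bounded from `out_sq_integral_le_of_sep` + a core anharmonic estimate, not read off `…MehlerTensorGap`.  (iii) The (β) currency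
floor ✓p729582 carries the full `EK² = e^{4β|E|}` with polynomial loss `β^{-K}` (vetted); against it `K_sep = EK·e^{−ℓ²/10⁶}` (✓ `hsep_record`) and `e_out =
e^{−g₀ℓ²/576}` (`out_sq_integral_le_of_sep` at `R₀ = r_F/12`) are superpolynomially small ONLY relative to `EK·β^{-K}`, from `β ≥ e^{10⁶K}` resp. `β ≥ e^{576K/g₀} ≈ e^{14.6KL²}` on —
harmless for S-BASE (fixed `L₁`, eventually in `β`) but doubly exponential against the femto window `β ≍ log L`: uniformity is CMP-2LOOP's burden (director's (a)) and this is its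
current price tag.
(as) (R62, cycle 50; Annex E §H1x) THE DOOR'S GAIN IS CAPPED BY THE FLAT RATE: for ANY comparison data `(Θ, w, D, J₀, S, c_J, C_ν)` fed to
`StiffDoor.form_le_of_quasimode_of_comparison`, `(1−δ)c_J ≤ (1+η)C_ν` (`R62.cJ_le_of_quasimode_of_comparison_at`), so `θ_door ≤ (1+η)(1−ρ)/(1−δ)` (`R62.doorGain_le_flatRate`).
(i) Do not look for a (B-ST) constant above `θ_S(L)` on the Poincaré route — it is the R60 ceiling again; (ii) the feeding must keep BOTH slacks below the gain: the quasimode slack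
`η(β)` (lane A: `O(β^{1/2−3s}ℓ^C)`, `s > 1/6`) and the killed flat mass `δ` (`J₀ := 0` where `Θ = 0`; `e^{−cℓ²}` for the `r_f`-ball) — and (P) is then the CENSORED flat Poincaré on
`{Θ > 0}`, a brick distinct from `mehler_poincare_normal`; (iii) `c_J`: the based-integral restriction radius must exceed the based Gaussian's bulk radius `≈ (0.38L³)^{1/2}β^{-1/2}`;
`β^{-1/2}ℓ^{1/3}` keeps the sandwich and the mass.  When lane A files (D3)/(P)/(C), CHECK these three prices, not the door.
(at) (R63, cycle 51; Annex E §H1y) THE DOOR'S (P) IS CENSORED — A THIRD SLACK: `(J)` forces `J₀ ≤ 0` off `{Θ>0}²`, so `hflat` is the censored flat Poincaré on `T = {Θ>0}`; it is NOT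
inherited from the global Mehler/tensor inequality with any constant (`R63.censored_poincare_not_inherited`); what IS inherited is `R63.killed_transfer(_door)`: censored (P) PLUS the
mass slack `P₀ε∫_S g²D`, `ε = sup_{x ∈ supp g} κ_T(x)/D(x)` (flat jump mass from `supp g` to `{Θ = 0}`; `∼ e^{−cℓ²}` for `supp g ⊆ r_f/2`-ball, `T = r_f`-ball, `r_f = β^{-1/2}ℓ`),
equivalently for `P₀ε < 1` (`R63.killed_transfer_meanForm`) the constant `P₀/(1−P₀ε)` plus the MEAN slack `(P₀ε/(1−P₀ε))·mean²/Z_S` (void at `P₀ε = 1`, `R63.path_meanSlack_fails`).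
When lane A files door v2 / (S3)/(S6): CHECK (i) which route carries the slack — constant-and-mean (hypothesis `P₀ε < 1` and the factor `1/(1−P₀ε)` typed; gain `θ_door(1−P₀ε)`) or
output coefficient via a reverse weight comparison `D ≤ C′_νΘ²w` on `supp g` (`C′_ν` where `Θ = frozenProfile` is bounded BELOW, inner ball; = lane A's ✓p738099
`form_le_of_quasimode_of_comparison_slack`, `δ = P₀ε`, gain `(c_J/(C_νP₀))(1 − C_νC′_νδ) − η`) — not a bare `P₀` (`R63.path_killed_eq`); the instance must supply `C′_ν` and `ε`;
(ii) that `ε(β) → 0` is booked against the `β`-free gain together with `η` and `δ` (regime (as)); (iii) the honest alternative is a genuine censored/Neumann Poincaré inequality on the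
ball (convex domain, Gaussian weight; reflecting OU) — no slack, but a NEW brick lane A has not filed.
(au) (cycle 51, vet of ⧗p738442 `…BOStiffTailFP`, (S6′)) THE POINTWISE GAUGE-FAR RATIO IS NOT SMALL AT THE SLOW EDGE: `l2_basedAvg_indicator_le` needs `∀ U, P₀(𝟙_Aχ)(U) ≤ κ·P₀χ(U)`;
for `χ = recordChi` (= `𝟙_{nearOne(ρ) ∩ {orbitDist<δ}}·e^{−gaugeCoordSq/δg²}`, `nearOne` and `gaugeCoordSq` NOT invariant) the orbits whose gauge-centred representative lies just
OUTSIDE `nearOne(ρ)` (slow edge `|u| ≈ ρ = MKβ^{-s}`, within `O(ℓδg)`) have their whole admissible window gauge-far, so `P₀(𝟙_Aχ) = P₀χ` there: NO `κ < 1` works pointwise.  `hST` is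
unaffected (FP–CS `‖P₀f‖² ≤ ‖f‖²_{N/χ}` holds for every `f`; slow-edge states are near-flat but their slow profile is priced by the PF bound `hkop`); it is lane A's (S6′) lemma that
must quantify `U` over orbits of the NEAR support only, or carry the slow-edge corner as a separate tail.  CHECK when (S6′) lands.
(av) (cycle 52; Annex E §H1z) (au) REFINED AFTER (S6′) LANDED: W1-2 `…BOStiffTailFarRecord` proves the pointwise ratio for `M ≥ M₀(L)` (two-width sandwich + (P) on the whole fat
tube) — (au)'s slow-edge orbits bite only for `M < M₀(L) ≈ C(L)` (then an orbit with `orbitDist < δ` meets `nearOne(Mδ)` only in an un-centred sliver with `gaugeCoordSq ∼ δ² ≫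
(ℓβ^{-1})²`); for `M ≥ M₀` they carry no support (`orbitDist < δ` ⇒ centred representative in `nearOne(C(L)δ)`).  Closed as a threat; keep as an `M`-threshold check on every
later pointwise window statement.
(aw) (R64, cycle 52; Annex E §H1z) BASED WINDOWS IN MASS FORM ONLY: the based orbit of a support point contains R29's winding copies (the winding function is BASED, `g(0) = 1`),
where `gaugeCoordSq = 0` and `χ = 0`, on a set of POSITIVE based-Haar mass (`R64.basedMeasure_bulk_off_support_eventually_pos`); so any statement of the shape «the Gaussian bulk
`{h : gaugeCoordSq(U^h) ≤ c}` of the based orbit lies in the fat tube / in `nearOne` / in the chart» is FALSE as an inclusion and false a.e.; what holds is a MASS floor on the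
honestly centred bulk ball.  CHECK for (L-1)/(S2-tail), (S3) defect windows, (S4b) `PiDensity` (local chart statements must be stated on the chart image, not on level sets of
`gaugeCoordSq`), and any `κ`-type pointwise ratio: inclusion ⇒ misstated; mass/average ⇒ fine; islands enter only absolute tails (`e^{2β|E|}e^{−cβ/L²}`-small per island link defect
`2(1−cos 2π/L)`).
(ax) (R65, cycle 53; Annex E §H1aa) THE (F) CURRENCY IS AN IDENTITY — NO NORMALISATION SLACK EITHER WAY: `btC·K₁(1,1) = fpZ·𝒦_β(1,1) − (FP tail cut)` exactly
(`R65.btC_mul_oneSite_add_tail`; FP `ε`-ball localisation is exact at `u = 1`, `R65.fpBOKernel_fpWeight_one_one`), so `Λ_rec ≤ κ₀·𝒦_β(1,1)/γ` (`R65.recordCurrency_le_boRayleigh`).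
CHECKS: (i) any (L-6)/(S3) landing that introduces a «matching constant» between the based and the FP-localised fibre averages other than the tail cut and the two-sided quasimode
accuracy is mis-booked (the based-vs-full average of a colour-blind `Θ` at `u = 1` is an identity); (ii) since `hST`'s constant is the sharp BO top, the PRODUCT of all
multiplicative losses in (C) (`e^{η}`, relative transport), (D) (door `1 − θ_door/2`), (E), (L-5′) (`1+ε` weight transport), (m) (`1+a`) must stay `≤ 1 − 4θ₀ = 1 − θ_door/4` —
read each remaining file's constants into this single budget (`…BOStiffCurrencyAlg.stiff_core_budget`: `X·(1 − θ₁ + e) ≤ 1 − 4θ₀`); an `L`-uniform `θ₀` remains excluded (R60).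
(ay) (R66, cycle 54; Annex E §H1ab) THE DOOR'S `hflat` IS A CONDUCTANCE FLOOR; `cS` IS GAUGE-WIDE: for every measurable `A ⊆ S`, `(c_JΛ/P₀)(D(A)(1−δ) − D(A)²/D(S)) ≤
∫_A∫_{Aᶜ}ΘMΘ` (`R66.conductance_floor`/`central_conductance_floor`), isolation across a cut ⇒ contradiction (`R66.door_false_of_isolated`); `cS L β ∋` pure-gauge points of every
radius `≤ r(β)` (`R66.exists_mem_cS_pureGauge`).  CHECKS: (i) (B4a) `cM_lower` / the final `J₀` must have FULL gauge reach on `cS×cS` (factor `e^{−β‖P_⊥Δ‖²}` only; based ball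
centred at the gauge peak `h₁`, never at `h = 1` with radius `< C_L·2r(β)`) — g22's HANDOFF §2 complies, re-check the landed statement; (ii) (B4b) `Λ_up` must be the Θ-integrated
pointwise upper twin of `cM_lower` (same gauge-flat Gaussian, amplitude `A(1+ε)`) so that `c_J = (1−ε)cΛ/Λ_up` is β-free — a cruder sup bound costs a β-power in `θ_* = c_J/(C_νP₀)`;
(iii) w3's FlatPoincare must keep the magnetic factors `e^{−(β/2)(S+S')}` INSIDE the jump kernel (ground-state transform) and prove the gauge block as a product/resampling kernel
(`Z_Y` cancels against `cΛ`, cf. ✓`variance_tensor_le_slack`); (iv) any `hΘlo` floor is `≤ e^{−βbtLog²β}` (`R66.floor_le_gauge_value`) — fine only because `θ₀` is `∃` inside `∀ᶠβ`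
and qualitative in `hgap_of_door`; a file using `θ₀` quantitatively is mis-booked.
(az) (R67/R68, cycle 55; Annex F §H1ac) THE PROFILE EXPONENT OF (A)/(Q±) IS RIGID: in the one-mode Mehler model `(Kf_c)/f_c = √(π/(a+b+c))·e^{κx²}`,
`κ = (c²−a²−2ab)/(a+b+c)`; (Q+)∧(Q−) on `[−R,R]` ⇒ `|κ|R² ≤ log((1+σ)/(1−σ))` (`R68.twoSided_pinch`), ∀σ ⇒ `c = c_*` (`R68.exponent_exact_of_twoSided`); too stiff fails at
the EDGE even when truncated (`R67.quasimode_fails_of_stiff_truncated`), too soft at the CENTRE vs the self-Rayleigh currency (`R67.selfRayleigh_fails_of_soft`).  CHECKS on the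
(A)/(Q±) proof (w1 W1-10c, lead (B4b)→(A)): (i) the harmonic replacement `e^{−(β/2)(S+S')} → e^{−⟨x̂,(β/2)Hx̂⟩−⟨x̂',(β/2)Hx̂'⟩}` must carry an ABSOLUTE `o(1)` sup bound on
`β|S(oT1x) − ⟨x̂,Hx̂⟩|` over the whole (inner) ball — a `(1±θ)β(…)` relative bound with fixed `θ` is FATAL (`e^{Θ(θℓ²)}` at the edge); (ii) the kinetic exponent must be EXACTLY
`β‖P_⊥Δ̂‖²` (✓`cM_lower`/`cM_upper` comply) and the profile EXACTLY `stiffGaussExp L (β/2) β` (per-mode `√(aᵢ²+2aᵢβ)`, `aᵢ ∈ spec((β/2)H)`) — any other `t, b` in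
`stiffGaussExp L t b` is mis-booked; (iii) amplitudes `(1±ε)A` and the weight's `(1±ε)` core-constancy enter `σ` only — fine; (iv) the `cM_upper` tail vs `σλΘw` on the inner ball is
an L-PRICE `β ≥ e^{Θ(L)}` — admissible ∀ᶠβ, never to be read as `L`-uniform; (v) (Q+) is asked on ALL of `cS` (edge included): truncation only LOWERS `MΘ` (fine), but any
smoothing/tapering of `cΘ` near `∂cS` introduced later changes `cΛ`, `cS` and (ring) — re-run R58/R63/R66/R67 on the modified profile.; (vi) in a FLAT mode (`a = c = 0`, `ρ = 1`) there is
no contraction — the edge keeps only `½` of `Kf` on a boundary layer: harmless for (Q+) and for (Q−) on `I`, FALSE for (Q−) at the edge by the factor `2`; exit lemmas over modes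
need `ρ_k ≤ ρ < 1` (w3's `0 < a_k` ✓) and the gauge block as resampling, not as a Mehler mode; (vii) ONE-LEVEL CHECK (`R68.ratio_pinch`): the atom's single `λ(β)` is pinned to
the true ratio `ρ = MΘ/(ΘW)` within `(1±σ)` from BOTH sides, so each half's level must be sharp to `1 ± o(1)` — no `haarReal_quatBall_ge`-type volume floor (`ρ³/10` vs `≤ ρ³`), no
two-sided-constant density, no restriction of the based-orbit integral to the inner core (loses `(60ℓ)^{−3(N−1)}`) may enter `λ`; the safe route is ONE two-sided computation from
✓`cM_lower`/`cM_upper` (one completed square, one `λ = A(π/β²)^{dim Γ/2}λ₀^{stiff}/N̄·(1±o(1))`).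
(ba) (R69, cycle 56; Annex F §H1ad) A FLAT TRANSVERSE MODE KILLS `hflat`; HODGE + COERCIVITY + GAUGE-RESAMPLING ARE LOAD-BEARING: the `a = 0` Mehler member (constant ground
state, contraction `1`) has censored Poincaré constant `≥ (1−δ)·e·b·R/3` on `[−R,R]` for every slack `δ < 1` (`R69.flat_poincare_fails`, `R69.no_windowUniform_flat_poincare`,
even `P₀ = P₀(δ)`: `R69.no_flat_poincare_of_slack`), while the resampling kernel has constant exactly `1` (`R69.resampling_poincare_eq`).  CHECKS on the `hflat` instantiation
(w3 ✓`flat_poincare` → chart; lead `…BOStiffFlatBridge` / `…BOStiffPenAssembly`): (i) the linear chart `T` with `Set.range T = balancedSet L` must be the eigenframe of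
`H|_{Bal ⊖ Γ}` ⊕ `Γ`, `σ = rank H|_{Bal}` — cite ✓`ker_covCurl_one_le`, never posit `σ`, `a` or `ρ`; (ii) every `a_k` fed to ✓`mehler_poincare_box` / ✓`product_exit_mass_le` /
✓`flat_poincare` is `(β/2)h_k` with `h_k ≥ g_L = 2−2cos(2π/L)` (✓`shell_exponent_ge_of_hodge`); in the normalisation `a_k²+2a_kb_k = π²`: `ρ_k = b_k/(a_k+b_k+π) ≤ ρ(L) < 1`;
(iii) `P₀ = 2/(1−ρ(L)) ≍ L/π` is β-free but L-dependent — fine for `∃P₀` at fixed `L`, mis-booked if ever read `L`-uniformly (R60/R61); (iv) the slack `δ` absorbs exit masses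
only (`P₀(ε_S+ε_R) → 0`), never contraction — a `δ`-for-`ρ` trade is FATAL (R69 §4 holds ∀δ<1); (v) gauge coordinates must enter `J₀` as `D_Z⊗D_Z/M_Z` (resampling): a kinetic
Gaussian in a gauge direction is a flat Mehler mode and sinks `hflat` — so `cJ0 ≥ c·J₀∘chart` must keep FULL gauge reach (R66 (i); ✓`cM_lower` complies).
-/

set_option autoImplicit false

noncomputable section

namespace Summit.QuantumFields.YangMills.Cruxes.TwistedTraceScaling.Disproof

open Summit.QuantumFields.YangMills.Theorems.FemtoTransferGap
open Summit.QuantumFields.YangMills.Theorems.FemtoTransferGap.TraceDoor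
open Summit.QuantumFields.YangMills.Theorems.FemtoTransferGap.TT
open Summit.QuantumFields.YangMills.Theorems.TwistedTraceScaling

/-- Sanity: the crux decl this work file is about (it must stay in sync with the route file). -/
example : Summit.QuantumFields.YangMills.Theses.LuscherReduction.TwistedTraceScaling =
    (∀ s : ℝ, 0 < s → ∀ ε : ℝ, 0 < ε → ∃ lam0 : ℝ, 0 < lam0 ∧ ∀ lam : ℝ, 0 < lam → lam ≤ lam0 → ∃ L0 : ℕ,
      ∀ (L : ℕ) [NeZero L], L0 ≤ L → ∀ β : ℝ, InFemtoWindow lam β L →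
        |physTrace L β (2 * ⌈s * L / luscherLambda β L⌉₊) / physTrace L β ⌈s * L / luscherLambda β L⌉₊ ^ 2 -
          physTrace 1 (oneSiteCoupling β L) (2 * ⌈s * L / luscherLambda β L⌉₊) /
            physTrace 1 (oneSiteCoupling β L) ⌈s * L / luscherLambda β L⌉₊ ^ 2| ≤ ε) := rfl

/-! ## (A) Load-bearing hypotheses -/

/-- The crux with `0 < ε` dropped. -/
def WithoutEpsPos : Prop :=
  ∀ s : ℝ, 0 < s → ∀ ε : ℝ, ∃ lam0 : ℝ, 0 < lam0 ∧ ∀ lam : ℝ, 0 < lam → lam ≤ lam0 → ∃ L0 : ℕ,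
    ∀ (L : ℕ) [NeZero L], L0 ≤ L → ∀ β : ℝ, InFemtoWindow lam β L →
      |physTrace L β (2 * ⌈s * L / luscherLambda β L⌉₊) / physTrace L β ⌈s * L / luscherLambda β L⌉₊ ^ 2 -
        physTrace 1 (oneSiteCoupling β L) (2 * ⌈s * L / luscherLambda β L⌉₊) /
          physTrace 1 (oneSiteCoupling β L) ⌈s * L / luscherLambda β L⌉₊ ^ 2| ≤ ε

/-- Any proof must use `0 < ε` (witness `ε = −1`; the window is inhabited). Landed: p528819. -/
theorem false_without_epsPos : ¬ WithoutEpsPos := Negative.twistedTraceScaling_false_without_epsPos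

/-- The crux with `1 ≤ β` removed from the window (and the lattice threshold removed, which is innocuous given the line). -/
def WithoutBetaGeOne : Prop :=
  ∀ s : ℝ, 0 < s → ∀ ε : ℝ, 0 < ε → ∃ lam0 : ℝ, 0 < lam0 ∧ ∀ lam : ℝ, 0 < lam → lam ≤ lam0 →
    ∀ (L : ℕ) [NeZero L] (β : ℝ), lam ≤ luscherLambda β L → luscherLambda β L ≤ 2 * lam →
      |physTrace L β (2 * ⌈s * L / luscherLambda β L⌉₊) / physTrace L β ⌈s * L / luscherLambda β L⌉₊ ^ 2 -
        physTrace 1 (oneSiteCoupling β L) (2 * ⌈s * L / luscherLambda β L⌉₊) /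
          physTrace 1 (oneSiteCoupling β L) ⌈s * L / luscherLambda β L⌉₊ ^ 2| ≤ ε

/-- Any proof must use `1 ≤ β`: the strong-coupling root of the window equation. Landed: `Negative/FalseWithoutBetaGeOne.lean`. -/
theorem false_without_betaGeOne : ¬ WithoutBetaGeOne := Negative.twistedTraceScaling_false_without_betaGeOne

/-- S-BASE with its threshold `∃ β₁, ∀ β ≥ β₁` replaced by `∀ β ≥ 0`. -/
def BaseWithoutThreshold : Prop :=
  ∀ (L1 : ℕ) [NeZero L1] (s : ℝ), 0 < s → ∀ ε : ℝ, 0 < ε → ∀ β : ℝ, 0 ≤ β →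
    |traceRatio L1 β (femtoSteps s β L1) - hTraceRatio s| ≤ ε

/-- Any proof of S-BASE must use largeness of `β` (witness `β = 0`, `L₁ = 1`, `s = 1`). Landed: p528819. -/
theorem base_false_without_threshold : ¬ BaseWithoutThreshold := Negative.fixedLatticeTraceLaw_false_without_threshold

/-! ## (B) Boundary facts (re-exported) -/

/-- The strong-coupling value of the ratio is `1`… -/
theorem traceRatio_at_beta_zero (L : ℕ) [NeZero L] (T : ℕ) : traceRatio L 0 T = 1 := Negative.traceRatio_beta_zero L T

/-- …while the target value is strictly below `1`. -/
theorem target_lt_one {s : ℝ} (hs : 0 < s) : hTraceRatio s < 1 := Negative.hTraceRatio_lt_one hs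

/-- The window is inhabited at every admissible depth and lattice size (non-vacuity of the crux). -/
theorem window_inhabited (L : ℕ) [NeZero L] {lam : ℝ} (h0 : 0 < lam) (h1 : lam ≤ 1) :
    ∃ β : ℝ, InFemtoWindow lam β L := (Negative.exists_inFemtoWindow L h0 h1).imp fun _ h => h.1

/-! ## (D) Targets: the line's stubs -/

/-- S-BASE verbatim (skeleton `Lines-twolattice.lean`, `Stmt.stub_fixedLatticeTraceLaw`). -/
def Base : Prop :=
  ∀ (L1 : ℕ) [NeZero L1] (s : ℝ), 0 < s → ∀ ε : ℝ, 0 < ε → ∃ β1 : ℝ, ∀ β : ℝ, β1 ≤ β →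
    |traceRatio L1 β (femtoSteps s β L1) - hTraceRatio s| ≤ ε

/-- S-TOWER (`Stmt.stub_twoLatticeUniversality`) with the binder `1 ≤ β₁ →` deleted. -/
def TowerWithoutBeta1GeOne : Prop :=
  ∀ s : ℝ, 0 < s → ∀ ε : ℝ, 0 < ε → ∃ L0 : ℕ, ∃ lam0 : ℝ, 0 < lam0 ∧ ∀ lam : ℝ, 0 < lam → lam ≤ lam0 →
    ∀ (L1 : ℕ) [NeZero L1], L0 ≤ L1 → ∀ (L : ℕ) [NeZero L], L1 ≤ L → ∀ β : ℝ, InFemtoWindow lam β L →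
      ∀ β₁ : ℝ, invRunningCoupling β₁ L1 = invRunningCoupling β L →
        |traceRatio L β (femtoSteps s β L) - traceRatio L1 β₁ (femtoSteps s β₁ L1)| ≤ ε

/-- Any proof of S-TOWER must use `1 ≤ β₁` (given S-BASE). Landed: p533390. -/
theorem tower_false_without_beta1GeOne_of_base (hB : Base) : ¬ TowerWithoutBeta1GeOne :=
  Negative.twoLatticeUniversality_false_without_beta1GeOne_of_base hB

/-! ## (D′) Targets rev 2 «E1 COVERAGE»: TOWER-E1 -/

/-- TOWER-E1 verbatim (skeleton rev 2 `Stmt.stub_towerE1` = hypothesis `hE1` of `Tower.twistedTraceScaling_of_towerE1_of_base`). -/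
def TowerE1 : Prop :=
  ∀ s : ℝ, 0 < s → ∀ ε : ℝ, 0 < ε → ∃ M : ℕ, 2 ≤ M ∧ ∃ lam0 : ℝ, 0 < lam0 ∧ ∀ lam : ℝ, 0 < lam → lam ≤ lam0 →
    ∀ (L : ℕ) [NeZero L], M ^ 2 ≤ L → ∀ β : ℝ, InFemtoWindow lam β L →
      ∀ (b k : ℕ) [NeZero b], M ≤ b → b < M ^ 2 → b * M ^ (k + 1) ≤ L → L < b * M ^ k * (M + 1) →
        ∀ β₁ : ℝ, 1 ≤ β₁ → invRunningCoupling β₁ b = invRunningCoupling β L →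
          |traceRatio L β (femtoSteps s β L) - traceRatio b β₁ (femtoSteps s β₁ b)| ≤ ε

/-- Sanity: TOWER-E1 + S-BASE ⇒ crux is the tree's kernel-checked composition (nothing to attack in `TwistedTraceScaling_of`). -/
example (hE1 : TowerE1) (hB : Base) : Summit.QuantumFields.YangMills.Theses.LuscherReduction.TwistedTraceScaling :=
  TwoLattice.Tower.twistedTraceScaling_of_towerE1_of_base hE1 hB

/-- TOWER-E1 with the binder `1 ≤ β₁ →` deleted. -/
def TowerE1WithoutBeta1GeOne : Prop :=
  ∀ s : ℝ, 0 < s → ∀ ε : ℝ, 0 < ε → ∃ M : ℕ, 2 ≤ M ∧ ∃ lam0 : ℝ, 0 < lam0 ∧ ∀ lam : ℝ, 0 < lam → lam ≤ lam0 →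
    ∀ (L : ℕ) [NeZero L], M ^ 2 ≤ L → ∀ β : ℝ, InFemtoWindow lam β L →
      ∀ (b k : ℕ) [NeZero b], M ≤ b → b < M ^ 2 → b * M ^ (k + 1) ≤ L → L < b * M ^ k * (M + 1) →
        ∀ β₁ : ℝ, invRunningCoupling β₁ b = invRunningCoupling β L →
          |traceRatio L β (femtoSteps s β L) - traceRatio b β₁ (femtoSteps s β₁ b)| ≤ ε

/-- Any proof of TOWER-E1 must use `1 ≤ β₁` (given S-BASE). Landed: p537181. -/
theorem towerE1_false_without_beta1GeOne_of_base (hB : Base) : ¬ TowerE1WithoutBeta1GeOne :=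
  Negative.towerE1_false_without_beta1GeOne_of_base hB

/-- TOWER-E1 with `InFemtoWindow lam β L` weakened to its two `Λ`-inequalities (the window's `1 ≤ β` deleted). -/
def TowerE1WithoutWindowBetaGeOne : Prop :=
  ∀ s : ℝ, 0 < s → ∀ ε : ℝ, 0 < ε → ∃ M : ℕ, 2 ≤ M ∧ ∃ lam0 : ℝ, 0 < lam0 ∧ ∀ lam : ℝ, 0 < lam → lam ≤ lam0 →
    ∀ (L : ℕ) [NeZero L], M ^ 2 ≤ L → ∀ β : ℝ, lam ≤ luscherLambda β L → luscherLambda β L ≤ 2 * lam →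
      ∀ (b k : ℕ) [NeZero b], M ≤ b → b < M ^ 2 → b * M ^ (k + 1) ≤ L → L < b * M ^ k * (M + 1) →
        ∀ β₁ : ℝ, 1 ≤ β₁ → invRunningCoupling β₁ b = invRunningCoupling β L →
          |traceRatio L β (femtoSteps s β L) - traceRatio b β₁ (femtoSteps s β₁ b)| ≤ ε

/-- Any proof of TOWER-E1 must use the window's `1 ≤ β` (given S-BASE). Landed: p537181. -/
theorem towerE1_false_without_windowBetaGeOne_of_base (hB : Base) : ¬ TowerE1WithoutWindowBetaGeOne :=
  Negative.towerE1_false_without_windowBetaGeOne_of_base hB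

/-- LogRatioMatch-E1 (`hLog` of `Tower.towerE1_of_logRatioMatchE1`) with the binder `1 ≤ β₁ →` deleted. -/
def LogRatioMatchE1WithoutBeta1GeOne : Prop :=
  ∀ s : ℝ, 0 < s → ∀ ε : ℝ, 0 < ε → ∃ M : ℕ, 2 ≤ M ∧ ∃ lam0 : ℝ, 0 < lam0 ∧ ∀ lam : ℝ, 0 < lam → lam ≤ lam0 →
    ∀ (L : ℕ) [NeZero L], M ^ 2 ≤ L → ∀ β : ℝ, InFemtoWindow lam β L →
      ∀ (b k : ℕ) [NeZero b], M ≤ b → b < M ^ 2 → b * M ^ (k + 1) ≤ L → L < b * M ^ k * (M + 1) →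
        ∀ β₁ : ℝ, invRunningCoupling β₁ b = invRunningCoupling β L →
          |Real.log (traceRatio L β (femtoSteps s β L)) - Real.log (traceRatio b β₁ (femtoSteps s β₁ b))| ≤ ε

/-- The logarithmic text also needs `1 ≤ β₁` (given S-BASE). Landed: p537181. -/
theorem logRatioMatchE1_false_without_beta1GeOne_of_base (hB : Base) : ¬ LogRatioMatchE1WithoutBeta1GeOne :=
  Negative.logRatioMatchE1_false_without_beta1GeOne_of_base hB

/-- LogRatioMatch-E1 with the window's `1 ≤ β` deleted. -/
def LogRatioMatchE1WithoutWindowBetaGeOne : Prop :=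
  ∀ s : ℝ, 0 < s → ∀ ε : ℝ, 0 < ε → ∃ M : ℕ, 2 ≤ M ∧ ∃ lam0 : ℝ, 0 < lam0 ∧ ∀ lam : ℝ, 0 < lam → lam ≤ lam0 →
    ∀ (L : ℕ) [NeZero L], M ^ 2 ≤ L → ∀ β : ℝ, lam ≤ luscherLambda β L → luscherLambda β L ≤ 2 * lam →
      ∀ (b k : ℕ) [NeZero b], M ≤ b → b < M ^ 2 → b * M ^ (k + 1) ≤ L → L < b * M ^ k * (M + 1) →
        ∀ β₁ : ℝ, 1 ≤ β₁ → invRunningCoupling β₁ b = invRunningCoupling β L →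
          |Real.log (traceRatio L β (femtoSteps s β L)) - Real.log (traceRatio b β₁ (femtoSteps s β₁ b))| ≤ ε

/-- The logarithmic text also needs the window's `1 ≤ β` (given S-BASE). Landed: p537181. -/
theorem logRatioMatchE1_false_without_windowBetaGeOne_of_base (hB : Base) : ¬ LogRatioMatchE1WithoutWindowBetaGeOne :=
  Negative.logRatioMatchE1_false_without_windowBetaGeOne_of_base hB

/-- TOWER-E1 with the guard `2 ≤ M ∧` deleted. -/
def TowerE1WithoutTwoLeM : Prop :=
  ∀ s : ℝ, 0 < s → ∀ ε : ℝ, 0 < ε → ∃ M : ℕ, ∃ lam0 : ℝ, 0 < lam0 ∧ ∀ lam : ℝ, 0 < lam → lam ≤ lam0 →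
    ∀ (L : ℕ) [NeZero L], M ^ 2 ≤ L → ∀ β : ℝ, InFemtoWindow lam β L →
      ∀ (b k : ℕ) [NeZero b], M ≤ b → b < M ^ 2 → b * M ^ (k + 1) ≤ L → L < b * M ^ k * (M + 1) →
        ∀ β₁ : ℝ, 1 ≤ β₁ → invRunningCoupling β₁ b = invRunningCoupling β L →
          |traceRatio L β (femtoSteps s β L) - traceRatio b β₁ (femtoSteps s β₁ b)| ≤ ε

/-- ANTI-VACUITY: without `2 ≤ M` the text is provable (`M := 1`, empty base range). Landed: p537181. -/
theorem towerE1_without_twoLeM : TowerE1WithoutTwoLeM := Negative.towerE1_without_twoLeM_trivial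

/-- TOWER-E1 with `∃ M, 2 ≤ M ∧` moved AFTER `∀ lam` (the `lam`-uniformity of the base scale dropped; all other binders verbatim). -/
def TowerE1NonUniform : Prop :=
  ∀ s : ℝ, 0 < s → ∀ ε : ℝ, 0 < ε → ∃ lam0 : ℝ, 0 < lam0 ∧ ∀ lam : ℝ, 0 < lam → lam ≤ lam0 → ∃ M : ℕ, 2 ≤ M ∧
    ∀ (L : ℕ) [NeZero L], M ^ 2 ≤ L → ∀ β : ℝ, InFemtoWindow lam β L →
      ∀ (b k : ℕ) [NeZero b], M ≤ b → b < M ^ 2 → b * M ^ (k + 1) ≤ L → L < b * M ^ k * (M + 1) →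
        ∀ β₁ : ℝ, 1 ≤ β₁ → invRunningCoupling β₁ b = invRunningCoupling β L →
          |traceRatio L β (femtoSteps s β L) - traceRatio b β₁ (femtoSteps s β₁ b)| ≤ ε

/-- DESIGN FACT: the de-uniformised TOWER-E1 is implied by the CRUX (so `lam`-uniformity is the stub's only excess over the crux, and it
is what the descent with S-BASE consumes). Landed: p538077 (+ tree `Tower.femtoTraceLaw_of_twistedTraceScaling`). -/
theorem towerE1NonUniform_of_crux (h : Summit.QuantumFields.YangMills.Theses.LuscherReduction.TwistedTraceScaling) :
    TowerE1NonUniform := by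
  -- same proof as the landed `Negative.towerE1NonUniform_of_femtoTraceLaw` (p538077), inlined to keep this work file's imports built
  have hFTL := TwoLattice.Tower.femtoTraceLaw_of_twistedTraceScaling h
  intro s hs ε hε
  obtain ⟨lam0, hlam0, h⟩ := hFTL s hs (ε / 2) (by positivity)
  refine ⟨lam0, hlam0, fun lam hlam hle => ?_⟩
  obtain ⟨L0, hL0⟩ := h lam hlam hle
  refine ⟨L0 + 2, by omega, ?_⟩
  intro L _ hL β hW b k _ hMb _ _ _ β₁ hβ₁ hmatch
  have hW₁ : InFemtoWindow lam β₁ b := TwoLattice.Tower.window_of_matched hW hβ₁ hmatch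
  have h1 := hL0 L (by nlinarith) β hW
  have h2 := hL0 b (by omega) β₁ hW₁
  rw [abs_le] at h1 h2 ⊢
  constructor <;> linarith

/-- … and the uniform femto trace law UFTL gives the registered TOWER-E1 text. Landed: p538077. -/
theorem towerE1_of_uniformFemtoTraceLaw
    (hU : ∀ s : ℝ, 0 < s → ∀ ε : ℝ, 0 < ε → ∃ L0 : ℕ, ∃ lam0 : ℝ, 0 < lam0 ∧ ∀ lam : ℝ, 0 < lam → lam ≤ lam0 →
      ∀ (L : ℕ) [NeZero L], L0 ≤ L → ∀ β : ℝ, InFemtoWindow lam β L →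
        |traceRatio L β (femtoSteps s β L) - hTraceRatio s| ≤ ε) : TowerE1 := by
  -- same proof as the landed `Negative.towerE1_of_uniformFemtoTraceLaw` (p538077)
  intro s hs ε hε
  obtain ⟨L0, lam0, hlam0, h⟩ := hU s hs (ε / 2) (by positivity)
  refine ⟨L0 + 2, by omega, lam0, hlam0, fun lam hlam hle => ?_⟩
  intro L _ hL β hW b k _ hMb _ _ _ β₁ hβ₁ hmatch
  have hW₁ : InFemtoWindow lam β₁ b := TwoLattice.Tower.window_of_matched hW hβ₁ hmatch
  have h1 := h lam hlam hle L (by nlinarith) β hW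
  have h2 := h lam hlam hle b (by omega) β₁ hW₁
  rw [abs_le] at h1 h2 ⊢
  constructor <;> linarith

/-- REDUNDANCY (information for provers): the binder `M ^ 2 ≤ L` of TOWER-E1 follows from the pair constraints. -/
theorem towerE1_binder_MSq_le_of_pair {M b k L : ℕ} (hMb : M ≤ b) (hbL : b * M ^ (k + 1) ≤ L) : M ^ 2 ≤ L := by
  rcases Nat.eq_zero_or_pos M with h0 | hpos
  · subst h0; simp
  · calc M ^ 2 = M * M := sq M
      _ ≤ b * M := Nat.mul_le_mul_right M hMb
      _ ≤ b * M ^ (k + 1) := Nat.mul_le_mul_left b (Nat.le_self_pow (Nat.succ_ne_zero k) M)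
      _ ≤ L := hbL

/-! ## (F) Clock rigidity and robustness (cycle 3; re-exported from `Negative.TraceRatioMonotone` / `.ClockRigidity` / `.ClockRobustness`) -/

/-- More Euclidean time never resurrects states: `r(L, β, ·)` is non-decreasing on `T ≥ 2` (`β ≥ 1`). Landed p543459. -/
theorem ratio_mono (L : ℕ) [NeZero L] {β : ℝ} (hβ : 1 ≤ β) {T T' : ℕ} (hT : 2 ≤ T) (hTT' : T ≤ T') :
    traceRatio L β T ≤ traceRatio L β T' :=
  Negative.traceRatio_mono L hβ hT hTT'

/-- The target tends to `0` at `0⁺` (quantitatively) … -/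
theorem target_small {c : ℝ} (hc : 0 < c) : ∃ s₀ : ℝ, 0 < s₀ ∧ ∀ s : ℝ, 0 < s → s ≤ s₀ → hTraceRatio s < c :=
  Negative.hTraceRatio_lt_of_small hc

/-- … and has no multiplicative period. -/
theorem target_scale_rigid {θ : ℝ} (hθ : 0 < θ) (h : ∀ s : ℝ, 0 < s → hTraceRatio (θ * s) = hTraceRatio s) : θ = 1 :=
  Negative.hTraceRatio_scale_rigid hθ h

/-- ★ The crux refutes every constant misclock of the steps (clock `Λ/θ`, i.e. `T = ⌈θsL/Λ⌉`, `θ ≠ 1`). Landed p544382. -/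
theorem crux_refutes_misclockedSteps (hC : Summit.QuantumFields.YangMills.Theses.LuscherReduction.TwistedTraceScaling)
    {θ : ℝ} (hθ : 0 < θ) (hθ1 : θ ≠ 1) :
    ¬ (∀ s : ℝ, 0 < s → ∀ ε : ℝ, 0 < ε → ∃ lam0 : ℝ, 0 < lam0 ∧ ∀ lam : ℝ, 0 < lam → lam ≤ lam0 →
        ∃ L0 : ℕ, ∀ (L : ℕ) [NeZero L], L0 ≤ L → ∀ β : ℝ, InFemtoWindow lam β L →
          |traceRatio L β (femtoSteps (θ * s) β L) - hTraceRatio s| ≤ ε) :=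
  fun h => hθ1 (Negative.misclockSteps_eq_one hθ (TwoLattice.Tower.femtoTraceLaw_of_twistedTraceScaling hC) h)

/-- ★ The crux refutes every constant misclock of the target (`r_𝔥(θs)` at the crux's clock, `θ ≠ 1`). Landed p544382. -/
theorem crux_refutes_misclockedTarget (hC : Summit.QuantumFields.YangMills.Theses.LuscherReduction.TwistedTraceScaling)
    {θ : ℝ} (hθ : 0 < θ) (hθ1 : θ ≠ 1) :
    ¬ (∀ s : ℝ, 0 < s → ∀ ε : ℝ, 0 < ε → ∃ lam0 : ℝ, 0 < lam0 ∧ ∀ lam : ℝ, 0 < lam → lam ≤ lam0 →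
        ∃ L0 : ℕ, ∀ (L : ℕ) [NeZero L], L0 ≤ L → ∀ β : ℝ, InFemtoWindow lam β L →
          |traceRatio L β (femtoSteps s β L) - hTraceRatio (θ * s)| ≤ ε) :=
  fun h => hθ1 (Negative.misclock_eq_one hθ (TwoLattice.Tower.femtoTraceLaw_of_twistedTraceScaling hC) h)

/-- ★★ The crux refutes every under-corrected running clock `A_c = β/2 − 2b₀ log L − c log(β/(2b₀))`, `c < b₁/b₀`
(`c = b₁/b₀` is the crux's own clock, `Negative.clockLambda_two_loop_eq`). Landed p544382. -/
theorem crux_refutes_underCorrectedClock (hC : Summit.QuantumFields.YangMills.Theses.LuscherReduction.TwistedTraceScaling)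
    {c : ℝ} (hc : c < b1 / b0) :
    ¬ (∀ s : ℝ, 0 < s → ∀ ε : ℝ, 0 < ε → ∃ lam0 : ℝ, 0 < lam0 ∧ ∀ lam : ℝ, 0 < lam → lam ≤ lam0 →
        ∃ L0 : ℕ, ∀ (L : ℕ) [NeZero L], L0 ≤ L → ∀ β : ℝ, InFemtoWindow lam β L →
          |traceRatio L β ⌈s * L / (max (β / 2 - 2 * b0 * Real.log L - c * Real.log (β / (2 * b0))) 0) ^ (-(1 : ℝ) / 3)⌉₊ -
            hTraceRatio s| ≤ ε) :=
  Negative.not_clockTraceLaw_of_femtoTraceLaw hc (TwoLattice.Tower.femtoTraceLaw_of_twistedTraceScaling hC)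

/-- ★★ In particular the crux refutes ONE-LOOP running (`c = 0`). Landed p544382. -/
theorem crux_refutes_oneLoopClock (hC : Summit.QuantumFields.YangMills.Theses.LuscherReduction.TwistedTraceScaling) :
    ¬ (∀ s : ℝ, 0 < s → ∀ ε : ℝ, 0 < ε → ∃ lam0 : ℝ, 0 < lam0 ∧ ∀ lam : ℝ, 0 < lam → lam ≤ lam0 →
        ∃ L0 : ℕ, ∀ (L : ℕ) [NeZero L], L0 ≤ L → ∀ β : ℝ, InFemtoWindow lam β L →
          |traceRatio L β ⌈s * L / (max (β / 2 - 2 * b0 * Real.log L) 0) ^ (-(1 : ℝ) / 3)⌉₊ - hTraceRatio s| ≤ ε) :=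
  Negative.not_oneLoopTraceLaw_of_femtoTraceLaw (TwoLattice.Tower.femtoTraceLaw_of_twistedTraceScaling hC)

/-- ★★ … while an absolutely bounded error `|R| ≤ D` in the matched number `1/ḡ²` is invisible. Landed p545183. -/
theorem crux_tolerates_boundedLabelError (hC : Summit.QuantumFields.YangMills.Theses.LuscherReduction.TwistedTraceScaling)
    {R : ℝ → ℕ → ℝ} {D : ℝ} (hR : ∀ (β : ℝ) (L : ℕ), |R β L| ≤ D) :
    ∀ s : ℝ, 0 < s → ∀ ε : ℝ, 0 < ε → ∃ lam0 : ℝ, 0 < lam0 ∧ ∀ lam : ℝ, 0 < lam → lam ≤ lam0 →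
      ∃ L0 : ℕ, ∀ (L : ℕ) [NeZero L], L0 ≤ L → ∀ β : ℝ, InFemtoWindow lam β L →
        |traceRatio L β ⌈s * L / (max (invRunningCoupling β L + R β L) 0) ^ (-(1 : ℝ) / 3)⌉₊ - hTraceRatio s| ≤ ε :=
  Negative.traceLaw_of_boundedLabelError (TwoLattice.Tower.femtoTraceLaw_of_twistedTraceScaling hC) hR

/-! ## (G) Targets rev 3 «TWO-LOOP CALIBRATION»: guards and quantifier order of TRACK / CMP-2LOOP (cycle 4)
Landed module `Negative/TwoLoopCalibrationGuards.lean` (p548842, commit 863b1b85d5a1) — IMPORTED since rev 6 (revs 4–5 carried an inlined copy while the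
farm snapshot lagged); its theorems (namespace `…TwistedTraceScaling.Negative.R3`) are re-exported into `…Disproof.R3`: the kicked Markov calibrator obeys the
two-loop law (`twoLoopLawH_kicked`, `exists_kicked_two`, junk one-step run `calibrator_one_eq_zero`); TRACK's base guard `1 ≤ β₁` and window guard `1 ≤ β`
are load-bearing (`labelTracking_false_without_beta1GeOne`, `labelTracking_false_without_windowBetaGeOne`), its depth must depend on the calibrator
(`labelTracking_false_uniformLam1`); CMP-2LOOP's base guard is removable (`cmpTwoLoop_iff_withoutBeta1GeOne`). -/

namespace R3

export Summit.QuantumFields.YangMills.Theorems.TwistedTraceScaling.Negative.R3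
  (twoLoopLawH_kicked calibrator_one_eq_zero four_b0_lt_stepBal_two_two steps_two_pos exists_kicked_two sixteen_le_of_quarter
    labelTracking_false_without_beta1GeOne labelTracking_false_without_windowBetaGeOne labelTracking_false_uniformLam1
    one_le_beta1_of_calibrated cmpTwoLoop_iff_withoutBeta1GeOne)

end R3

/-! ## (H) Cycle 5: CMP-2LOOP ⟺ UFTL ⟺ TOWER-E1 ⟺ S-TOWER modulo S-BASE; one calibrator suffices (TRACK landed)
Landed module `Negative/CmpTwoLoopIffUniformOfBase.lean` (p551232, commit 73660bb43a4e) — IMPORTED since rev 6, re-exported into `…Disproof.R3` likewise: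
`exists_twoLoopLawH`, `towerE1_of_cmpTwoLoop` (no S-BASE), `uniform_of_cmpTwoLoop_of_base`, the femto-time sandwich `time_sandwich` / `steps_sandwich`,
★ `cmpTwoLoop_of_uniform_of_base`, `cmpTwoLoop_iff_uniform_of_base`, `cmpTwoLoop_iff_towerE1_of_base`, `cmpTwoLoop_iff_twoLatticeUniversality_of_base`,
`cmpTwoLoop_of_cmpSome_of_base`. -/

namespace R3

export Summit.QuantumFields.YangMills.Theorems.TwistedTraceScaling.Negative.R3
  (steps_pos twoLoopLawH_markov exists_twoLoopLawH towerE1_of_cmpTwoLoop uniform_of_cmpTwoLoop_of_base time_sandwich steps_sandwich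
    beta1_ge_of_calibrated cmpTwoLoop_of_uniform_of_base cmpTwoLoop_iff_uniform_of_base cmpTwoLoop_iff_towerE1_of_base
    cmpTwoLoop_iff_twoLatticeUniversality_of_base cmpTwoLoop_of_cmpSome_of_base)

end R3

/-- Re-export check (§H): modulo S-BASE, CMP-2LOOP ⟺ UFTL — the alias resolves to the landed theorem. -/
example (hBASE : ∀ (L1 : ℕ) [NeZero L1] (s : ℝ), 0 < s → ∀ ε : ℝ, 0 < ε → ∃ β1 : ℝ, ∀ β : ℝ, β1 ≤ β →
      |traceRatio L1 β (femtoSteps s β L1) - hTraceRatio s| ≤ ε) :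
    TwoLattice.Stmt.stub_cmpTwoLoop ↔
    (∀ s : ℝ, 0 < s → ∀ ε : ℝ, 0 < ε → ∃ L0 : ℕ, ∃ lam0 : ℝ, 0 < lam0 ∧ ∀ lam : ℝ, 0 < lam → lam ≤ lam0 →
      ∀ (L : ℕ) [NeZero L], L0 ≤ L → ∀ β : ℝ, InFemtoWindow lam β L →
        |traceRatio L β (femtoSteps s β L) - hTraceRatio s| ≤ ε) :=
  R3.cmpTwoLoop_iff_uniform_of_base hBASE

/-! ## (I) Cycle 6: guards on S-BASE's typed sub-targets C3 / C4 and companions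
Landed module `Negative/InnerValleyTargetsGuards.lean` (p554343, commit 7ab24d708cba; rc 0, 0 sorry, standard axioms; namespace `…Negative.R6`) —
IMPORTED; re-exported into `…Disproof.R6`. -/

namespace R6

export Summit.QuantumFields.YangMills.Theorems.TwistedTraceScaling.Negative.R6
  (ae_eq_zero_of_not_integral_mul_self_pos integral_integral_eq_zero_of_ae_eq_zero integral_mul_self_eq_zero_of_ae_eq_zero
    le_levelValue_of_family valleyGain_false_without_support valleyRowBound_false_without_region
    innerNoIntruderAt_iff_dropGram comb_measurable_bounded innerNoIntruderOneOrbitAt_iff_dropGram innerNoIntruderAxialAt_iff_dropGram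
    boUpper_level_zero innerNoIntruder_level_zero boUpperAt_one innerNoIntruderAt_one
    innerNoIntruderAt_anti innerNoIntruderOneOrbitAt_anti innerNoIntruderAxialAt_anti valleyGainAt_mono)

end R6

/-- Re-export check (§I): `I(1)` holds at every scale — the alias resolves to the landed theorem. -/
example (δ : ℝ → ℝ) : InnerNoIntruderAt 1 δ := R6.innerNoIntruderAt_one δ

-- `section CycleSixChecks` (re-export checks of cycle 6 (§I: `I(1)`, `BO_up(1)` aliases) moved VERBATIM to Annex D §P11l at rev 63; compiled through rev 62, last at crux write 8c9c8f49afd8).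

/-! ## (J) Cycle 7: guards of the round-2 re-cuts (TowerCauchyE1 q ∧ PolyDeepTraceLaw p; CMP-SW)
Landed modules `Negative/AnchoredCompositionGuards.lean` (p559277) and `Negative/CmpSandwichGuards.lean` (p559663) (rc 0, 0 sorry, standard axioms;
namespace `…Negative.R7`) — IMPORTED; re-exported into `…Disproof.R7`. -/

namespace R7

export Summit.QuantumFields.YangMills.Theorems.TwistedTraceScaling.Negative.R7
  (cells_le strong_side_ge_growing anchor_threshold anchor_geometry polyDeep_false_without_floor
    towerCauchyE1_false_without_beta1GeOne_of_polyDeep towerCauchyE1_false_without_windowBetaGeOne_of_polyDeep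
    cmpSandwich_iff_withoutBeta1GeOne cmpSandwich_antecedents_inhabited)

end R7

/-- Re-export check (§J, V4): PolyDeepTraceLaw with its floor deleted is false — the alias resolves to the landed theorem. -/
example : ¬ (∀ s : ℝ, 0 < s → ∀ ε : ℝ, 0 < ε → ∃ Λstar : ℝ, 0 < Λstar ∧
    ∀ (L : ℕ) [NeZero L], ∀ β : ℝ, 0 < invRunningCoupling β L → luscherLambda β L ≤ Λstar →
      |traceRatio L β (femtoSteps s β L) - hTraceRatio s| ≤ ε) :=
  R7.polyDeep_false_without_floor

/-- Re-export check (§J, V5): modulo PolyDeepTraceLaw p (`0 ≤ q`, `0 ≤ p`, `pq < 3`), TowerCauchyE1 q without `1 ≤ β₁` is false. -/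
example {q p : ℝ} (hq : 0 ≤ q) (hp : 0 ≤ p) (hpq : p * q < 3)
    (hPD : ∀ s : ℝ, 0 < s → ∀ ε : ℝ, 0 < ε → ∃ Λstar : ℝ, 0 < Λstar ∧
      ∀ (L : ℕ) [NeZero L], ∀ β : ℝ, (L : ℝ) ^ p ≤ β → 0 < invRunningCoupling β L → luscherLambda β L ≤ Λstar →
        |traceRatio L β (femtoSteps s β L) - hTraceRatio s| ≤ ε) :
    ¬ (∀ s : ℝ, 0 < s → ∀ ε : ℝ, 0 < ε → ∃ M : ℕ, 2 ≤ M ∧ ∃ lam0 : ℝ, 0 < lam0 ∧ ∀ lam : ℝ, 0 < lam → lam ≤ lam0 →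
        ∀ (L : ℕ) [NeZero L], M ^ 2 ≤ L → ∀ β : ℝ, InFemtoWindow lam β L →
          ∀ (b k j : ℕ) [NeZero b], M ≤ b → b < M ^ 2 → b * M ^ (k + 1) ≤ L → L < b * M ^ k * (M + 1) → j ≤ k →
            ∀ (L₁ : ℕ) [NeZero L₁], L₁ = b * M ^ j → lam ^ (-q) ≤ (L₁ : ℝ) →
              ∀ β₁ : ℝ, invRunningCoupling β₁ L₁ = invRunningCoupling β L →
                |traceRatio L β (femtoSteps s β L) - traceRatio L₁ β₁ (femtoSteps s β₁ L₁)| ≤ ε) :=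
  R7.towerCauchyE1_false_without_beta1GeOne_of_polyDeep hq hp hpq hPD

/-! ## (K) Cycle 8: the `√σ` flat-proximity brick c5/C3c is false at every fixed `L` — and so is every modulus `S^α`, `α > 1/4`
Landed modules `Negative/FlatProximityQuartic.lean` (p566835) and `Negative/FlatProximityExponent.lean` (p569326) (rc 0, 0 sorry, standard axioms; namespace
`…Negative.R8`) — IMPORTED; re-exported into `…Disproof.R8`. -/

namespace R8

export Summit.QuantumFields.YangMills.Theorems.TwistedTraceScaling.Negative.R8
  (lineHolonomy_comm_of_flat frobNorm_lineHolonomy_sub_le su2Quat_pow_axisI su2Quat_pow_axisJ sq_le_of_commute_near_axes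
    wilsonAction_twoLinkCfg_le flatProximity_sqrt_false flatProximity_sqrt_false' flatProximity_rpow_false flatProximity_rpow_false')

end R8

-- `section CycleEightChecks` (re-export checks of cycle 8 (§K: brick c5/C3c false on `(ℤ/L)³`) moved VERBATIM to Annex D §P11m at rev 63; compiled through rev 62, last at crux write 8c9c8f49afd8).

/-! ## (L) Cycle 9: near-CONSTANT `S^α`-proximity (`α > 1/4`, incl. `√σ`) is false at every EVEN `L` — centre-twisted valleys
Landed modules `Negative/ConstProximityKit.lean` (p574515), `Negative/ConstProximityCentreTwist.lean` (p575243), `Negative/ToronCellGap.lean` (p576764) and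
`Negative/TwistGaugeOddL.lean` (p578597) (rc 0, 0 sorry, standard axioms; namespace `…Negative.R9`) — IMPORTED; re-exported into `…Disproof.R9`. -/

namespace R9

export Summit.QuantumFields.YangMills.Theorems.TwistedTraceScaling.Negative.R9
  (lineHolonomy_twist_twoLinkCfg_two plaquetteHolonomy_twist_twoLinkCfg_two lineHolonomy_gaugeTransform_period even_power_rigidity
    cross_sq_le_of_comm_near_one exists_commuting_shadow comm_of_parallel sin_sq_le_of_near_const constProximity_rpow_false constProximity_sqrt_false
    lap3_halfTwist_eq_zero exists_fast_zero_mode not_uniform_gap restZPE_term_eq_zero cell_gap_le_lap3 cell_gap_pos modeZPE_cell_gap_le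
    exists_gauge_twist_negOne_of_odd twist_twoLinkCfg_gauge_const_of_odd twist_twoLinkCfg_constProximity_of_odd)

end R9

-- `section CycleNineChecks` (re-export checks of R9 (cycle 9, §L) moved VERBATIM to Annex D §P11g at rev 61; compiled through rev 60b, last at crux write b08014fe748a).

/-! ## (M) Cycle 10: no uniform `√η`-proximity to the constants (even `L`) / to FLAT (every `L`) on lane A's valley set, for any scales `δ, η → 0`
Landed modules `Negative/ValleyConstProximityKit.lean` (p583007), `Negative/ValleyConstProximity.lean` (p583751) (rc 0, 0 sorry, standard axioms; namespace
`…Negative.R10`) — IMPORTED; re-exported into `…Disproof.R10`. -/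

namespace R10

export Summit.QuantumFields.YangMills.Theorems.TwistedTraceScaling.Negative.R10
  (min_le_of_commute_near_axes wilsonAction_twoLinkCfg_le₂ lineProd_twoLinkCfg_zero orbitDist_twist3_twoLinkCfg_ge twoLinkCfg_mem_valleySet
    twist_twoLinkCfg_mem_valleySet min_sin_le_of_near_const min_sin_le_of_near_flat witness_scheme valleyConstProximity_sqrt_false
    valleyFlatProximity_sqrt_false tendsto_powScale valleyConstProximity_pow_false valleyFlatProximity_pow_false)

end R10

-- `section CycleTenChecks` (re-export checks of cycle 10 (§M: valley-set C3c refutations) moved VERBATIM to Annex D §P11i at rev 62; compiled through rev 61, last at crux write d8653dffa738).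

/-! ## (N) Cycle 10b: `ValleyGeomAt L δ η` is false whenever `δ⁴ ≲ η` frequently — the exponent line `q > 4p` is necessary (`L ≥ 2`)
Landed module `Negative/ValleyGeomExponent.lean` (p585796) (rc 0, 0 sorry, standard axioms; namespace `…Negative.R11`) — IMPORTED; re-exported into
`…Disproof.R11`. -/

namespace R11

export Summit.QuantumFields.YangMills.Theorems.TwistedTraceScaling.Negative.R11
  (sum_adRot_sub_sq_eq frobNorm_sub_le_or_of_adRot shift_ne_self covCurl_single abs_adRot_sub_le_of_covCurl exists_sign_lineHolonomy_sub_le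
    lineHolonomy_abelianCfg commute_diagSU2 min_sin_le_of_near_toron valleyGeom_false valleyGeom_pow_false)

end R11

-- `section CycleTenBChecks` (re-export checks of cycle 10B (§N: GEOM sub-target false for `q ≤ 4p`) moved VERBATIM to Annex D §P11n at rev 63; compiled through rev 62, last at crux write 8c9c8f49afd8).

/-! ## (O) Cycle 11: `ValleyLinkProxAt` below the line at every `L ≥ 1`, the `O(δ)` texts for `δ⁴ = o(η)`, and the exact thresholds `4p < q`
Landed modules `Negative/ValleyLinkProxExponent.lean` (p587833), `Negative/ValleyProximityBigO.lean` (p588210), `Negative/ValleyProximityThreshold.lean`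
(p588435) (rc 0, 0 sorry, standard axioms; namespace `…Negative.R12`) — IMPORTED; re-exported into `…Disproof.R12`. -/

namespace R12

export Summit.QuantumFields.YangMills.Theorems.TwistedTraceScaling.Negative.R12
  (dom_scheme frobNorm_step_link_sub_le valleyLinkProx_false valleyLinkProx_pow_false exists_scale powScale_dom valleyLinkProxBigO_false
    valleyGeomBigO_false valleyLinkProxBigO_pow_false valleyGeomBigO_pow_false valleyLinkProxAt_pow_iff valleyGeomAt_pow_iff)

end R12

-- `section CycleElevenChecks` (re-export checks of R12 (cycle 11, §O) moved VERBATIM to Annex D §P11h at rev 61; compiled through rev 60b, last at crux write b08014fe748a).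

/-! ## (P) Cycle 12: FLOOR(N_B) = `ValleyFloorAt L (β^{−p}) (1/2) N_B` is false for `3r < 1 + 3m` (every `L`) and at `L = 1` unless `m > 2p ∧ 3r > 1 + 3m + p`
Landed modules `Negative/ValleyFloorLedger.lean` (p591007), `Negative/VacuumFloorLedger.lean` (p591655) (rc 0, 0 sorry, standard axioms; namespace
`…Negative.R13`) — IMPORTED; re-exported into `…Disproof.R13`. -/

namespace R13

export Summit.QuantumFields.YangMills.Theorems.TwistedTraceScaling.Negative.R13
  (levelValue_zero_le_gauss trialErr_ge riccatiN_ge modeZPE_ge toronZPE_one toronZPE_one_zero one_le_cards rpow_ledger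
    loaded_exponents_le_of_floor valleyFloorAt_riccatiN_false valleyFloorAt_riccatiN_one_false floor_ledger_window
    vacuumFloorAt_levelValue vacuumFloor_comparison_false no_vacuumFloor_comparison vacuumFloor_comparison_one_false
    no_vacuumFloor_comparison_one trueVacuum_comparison_false)

end R13

-- `section CycleTwelveChecks` (re-export checks of R13, cycle 12) moved VERBATIM to Annex D §P11e at rev 61 (compiled rev 12–60b, last at crux write b08014fe748a).

/-! ## (Q) Cycle 13: with lane A's IDEAL normalisation `Λ_id = N_free·e^{−6Z₀}` the F7 comparison needs the FULL ledger at every `L` (window `p < 2/51`)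
Landed module `Negative/IdealFloorLedger.lean` (p593188; §4 window p593600) (rc 0, 0 sorry, standard axioms; namespace `…Negative.R14`) — IMPORTED;
re-exported into `…Disproof.R14`. -/

namespace R14

export Summit.QuantumFields.YangMills.Theorems.TwistedTraceScaling.Negative.R14
  (loaded_exponents_le_of_comparison comparison_false_near_ideal idealFloor_comparison_false no_idealFloor_handover
    ledger_of_idealFloor_comparison ideal_ledger_examples idealFloor_handover_window idealFloor_handover_window_of_comparison
    idealFloor_comparison_false_corner)

end R14

-- `section CycleThirteenChecks` (5.7 kB: six `example`s re-checking `R14.*` at lane A's floor-route hypotheses, compiled rev 13–50) moved VERBATIM to Annex C §P6.6 at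
-- rev 51 (SIZE NOTE: examples-only sections go to the annex oldest first; the floor route is retired since cycle 17; `R14.*` stays exported above, and the landed module keeps
-- its own `ideal_ledger_examples`).

/-! ## (R) Cycle 14: the exponent ceiling of lane A's floor route — the F4 multiplier / F5 floor is below `Λ_id·e^{−β^{−c}}` for every `c ≥ 1/6` (log design),
`c ≥ 17/150` (polynomial scales)
Landed modules `Negative/FloorRouteCeiling.lean` (p595644) and `Negative/FloorRouteCeilingPow.lean` (p596093) (rc 0, 0 sorry, standard axioms; namespace `…Negative.R15`)
— IMPORTED; re-exported into `…Disproof.R15`. -/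

namespace R15

export Summit.QuantumFields.YangMills.Theorems.TwistedTraceScaling.Negative.R15
  (stepRem_ge stepErrUp_ge tubeSigma_nonneg tubeSigma_ge floorCK_le floorCK_mul_gauss_le stepLoss_ge
    multiplier_lt_idealFloor_target multiplier_lt_idealFloor_target_design
    floorDefect_nonneg' floorF5_le floorF5_lt_idealFloor_target floorF5_lt_idealFloor_target_scales)

end R15

-- `section CycleFourteenChecks` (6.7 kB: six `example`s re-checking `R15.*` — lane B's floor-route prefactors — compiled rev 14–51) moved VERBATIM to Annex C §P7.1 at
-- rev 52 (examples-only policy, oldest first; the floor route is retired since cycle 17; `R15.*` stays exported above; the landed module keeps its own checks).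

/-! ## (S) Cycle 15: F7 `riccatiN_idealCmp_pow` is sharp in its ledger; the ★★★★★ door `coarseNoIntruderAt_of_inner_pow` is live exactly on `0 < p < 2/51`
Landed module `Negative/InnerPowWindow.lean` (p598621; rc 0, 0 sorry, standard axioms; namespace `…Negative.R16`) — IMPORTED; re-exported into `…Disproof.R16`;
lane A's `…FloorNormalisation` (p597574) is imported for the open side of the two-sided picture. -/

namespace R16

export Summit.QuantumFields.YangMills.Theorems.TwistedTraceScaling.Negative.R16
  (idealFloorLevel_eq riccatiN_idealCmp_false_off_ledger ledger_of_riccatiN_idealCmp riccatiN_idealCmp_false_at_edge_m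
    riccatiN_idealCmp_false_at_edge_r innerPow_hypotheses_window innerPow_door_shut_above innerPow_window_nonempty_iff
    coarseUpper_of_inner_pow coarseUpper_of_inner_le)

end R16

-- `section CycleFifteenChecks` (7.2 kB: `example`s re-checking `R16.*` — the inner-pow window / F7 ledger of the retired floor route — compiled rev 15–52) moved
-- VERBATIM to Annex C §P7.2 at rev 53 (examples-only policy, oldest first; `R16.*` stays exported above; the landed module keeps its own checks).

/-! ## (S5) Cycle 15b: the zero-point KINK — COARSE-DESIGN §20.3's second-order bound is false for the tree's `zpeSum`
Landed module `Negative/ZpeKink.lean` (p600017; rc 0, 0 sorry, standard axioms; namespace `…Negative.R17`) — IMPORTED; re-exported into `…Disproof.R17`.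
[cite: VanbaalKoller1987, §4 eq. (4.4), p. 314] -/

namespace R17

export Summit.QuantumFields.YangMills.Theorems.TwistedTraceScaling.Negative.R17
  (zpeSum_abelianCfg_sub_vacuum zpeSum_abelianCfg_sub_vacuum_nonneg zpeSum_abelianCfg_sub_vacuum_ge_norm norm_addCircle_eq_abs
    zpeSum_abelianCfg_sub_vacuum_ge zpeSum_constLift_diag_sub_vacuum_ge not_zpeSum_secondOrder_at_vacuum not_zpeSum_secondOrder_constLift
    zpeSum_excess_firstOrder)

end R17

-- `section CycleFifteenBChecks` (1.8 kB: `example`s re-checking `R17.*` — the zero-point kink, cycle 15b — compiled rev 15–54) moved VERBATIM to Annex C §P7.4 at rev 55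
-- (examples-only policy, oldest first; `R17.*` stays exported above; the landed module keeps its own checks).

/-! ## (T) Cycle 16: lane A's PACKAGE `InnerBOPackageAt` (COARSE-DESIGN §21) is INNER in a costume — the trivial split
Landed module `Negative/InnerBOPackageIffInner.lean` (p602801; rc 0, 0 sorry, standard axioms; namespace `…Negative.R18`) — IMPORTED; re-exported into `…Disproof.R18`.
[cite: Luscher1983, §3] -/

namespace R18

export Summit.QuantumFields.YangMills.Theorems.TwistedTraceScaling.Negative.R18
  (l2_zero_fun qform_zero_fun innerBOPackageAt_of_inner innerBOPackageAt_iff innerBOPackageAt_anti coarseUpper_of_package_pow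
    coarseUpper_of_package_le package_pow_hypotheses_window)

end R18

namespace R19

export Summit.QuantumFields.YangMills.Theorems.TwistedTraceScaling.Negative.R19
  (eta_nonneg_of_kernel_near ratio_bounds_of_kernel_near ratio_osc_of_kernel_near eta_ge_of_ratio_osc eta_ge_third_of_ratio_osc)

end R19

namespace R20

export Summit.QuantumFields.YangMills.Theorems.TwistedTraceScaling.Negative.R20
  (exp_le_one_add_add_sq exp_three_mul_sub_exp_le feshbach_endgame_false_without_b_small)

end R20

-- `section CycleSixteenChecks` (4.1 kB: `example`s re-checking `R18.*` — the BO package `InnerBOPackageAt` ≡ INNER bricks of cycle 16 — compiled rev 16–53) moved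
-- VERBATIM to Annex C §P7.3 at rev 54 (examples-only policy, oldest first; `R18.*` stays exported above; the landed module keeps its own checks).

/-! ## (U) Cycle 17: brick O′'s global `hnear` is rigid; box-uniform first/second-order constants violate the package budgets for `p < 1/6` (sharp)
Landed modules `Negative/ModelPerturbedNearRigidity.lean` (p606732) and `Negative/ModelPerturbedNearRegional.lean` (p607587; the regional floor / achievability)
(rc 0, 0 sorry, standard axioms; namespace `…Negative.R21`) — IMPORTED; re-exported into `…Disproof.R21`.
[cite: Luscher1983, §3] [cite: Helffer2013, Lemma 7.1] -/

namespace R21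

export Summit.QuantumFields.YangMills.Theorems.TwistedTraceScaling.Negative.R21
  (eq_zero_of_mul_sq_bounded ratio_bounds_of_near mehlerKernel_div_mehlerKernel logRatio_single_single logRatio_single_zero
    logRatio_bounds_of_near stiffData_eq_of_near not_near_of_stiffData_ne not_near_of_unbounded_weight powScale_sq
    lambda_mul_lt_first_order_sq offDiag_budget_false_of_first_order diag_budget_false_of_second_order
    offDiag_budget_false_on_door_window diag_budget_false_on_door_window offDiag_budget_at_one_sixth
    exp_logRatio_bounds_of_near_on div_one_add_le_of_exp_bounds width_floor_of_near_on widthSum_floor_of_near_on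
    width_change_le_of_near_on abs_logRatio_le_on_box near_on_box_of_stiffData_close)

end R21

-- `section CycleSeventeenChecks` (4777 B: `example`s re-checking `R21.*` — O′'s global/regional `hnear`, the door window `p < 2/51`, the `p = 1/6` endpoint with
-- CONSTANT κ (cycle 17) — compiled rev 17–55) moved VERBATIM to Annex D §P8.3 at rev 56 (examples-only policy, oldest first; `R21.*` stays exported above; the landed module
-- keeps its own checks; cycle 42's R53 is the log-growing-κ sequel of `R21.offDiag_budget_at_one_sixth`).

/-! ## (V) Cycle 18: lane A's TWO ZONES — SHELL(small) ≡ `V(L)` at the core radius; the geometry line `4s = q`; the core window `(1/6, 1/3)` two-sided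
Landed module `Negative/ShellIsValleyBelowLine.lean` (p609922; rc 0, 0 sorry, standard axioms; namespace `…Negative.R22`) — IMPORTED; re-exported into `…Disproof.R22`.
[cite: Luscher1983, §3] [cite: LuscherMunster1984, §2] -/

namespace R22

export Summit.QuantumFields.YangMills.Theorems.TwistedTraceScaling.Negative.R22
  (innerShellGainSmallAt_of_valleyGainAt innerShellGainSmallAt_iff_valleyGainAt innerShellGainSmallAt_pow_iff shellSmall_record_iff
    valleyGainAt_pow_of_bo shellSmall_of_bo reduction_window red_floor_chain_cap valleyGeomAt_core_record_iff valleyLinkProxAt_core_record_iff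
    not_valleyGeom_linkProx_record_quarter valleyGeom_linkProx_record_fifth shellSmall_record_of_bo offDiag_budget_of_one_sixth_lt
    diag_budget_of_one_sixth_lt ims_delta_term_le_onionErr not_scalesAdmissible_powScale_of_third_le not_bareLambda_dominated_of_third_le
    core_window_record powScale_one shell_threshold_hyp_false_pow shell_threshold_eventually_iff shell_threshold_shut_on_window)

end R22

-- `section CycleEighteenChecks` (4494 B: `example`s re-checking `R22.*` — SHELL(small) ≡ `V(L)` at the core radius, the line `4s = q`, the core window
-- `(1/6, 1/3)`, the shell threshold on the window (cycle 18) — compiled rev 18–56) moved VERBATIM to Annex D §P9 at rev 57 (examples-only policy, oldest first; `R22.*` stays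
-- exported above; the landed module keeps its own checks).

/-! ## (V5–V7) Cycle 18b: the exponent window of the ONE-SITE shell gain `t^{3/2}` and of the §22.6 cells — `1/6 < s < 2/9`; equal exponents `1/5` at `L ≤ 3`
Landed module `Negative/OneSiteGainWindow.lean` (p610756; rc 0, 0 sorry, standard axioms; namespace `…Negative.R23`) — IMPORTED; re-exported into `…Disproof.R23`.
[cite: Luscher1983, §3] -/

namespace R23

export Summit.QuantumFields.YangMills.Theorems.TwistedTraceScaling.Negative.R23
  (powScale_add' gain_at_core_eq sample_cell_radius_eq kinetic_length_eq mul_powScale_le_eventually not_mul_powScale_le_eventually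
    oneSite_gain_dominates_iff linear_gain_dominates_iff window_record sample_cell_first_order_of_lt_sixth
    sample_cell_first_order_fails_of_sixth_lt sample_cell_first_order_fails_record repaired_cell_ims_of_lt repaired_cell_ims_fails_of_lt
    repaired_cell_ims_cost_eq quarter_line_of_lt quarter_line_fails_of_lt record_radius_lt_oneSite_threshold
    record_radius_lt_oneSite_threshold_two_three oneSite_threshold_le_radius_eventually)

end R23

-- `section CycleEighteenBChecks` (re-export checks of cycle 18B (§V5: one-site gain vs λ_b window lines) moved VERBATIM to Annex D §P11j at rev 62; compiled through rev 61, last at crux write d8653dffa738).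

/-! ## (W) Cycle 19: the Polyakov-line floor, `orbitDist(V_θ) ≍ L³Σ|θ_k|`, the shell witness below the one-site threshold at the record pair for every `L ≥ 2`,
and the stiff-layer line `s < (4q − 2)/9` of a pointwise cell comparison
Landed modules `Negative/ValleyOrbitDistPolyakovFloor.lean` (p613597) and `Negative/ShellWitnessBelowThreshold.lean` (p614140) (rc 0, 0 sorry, standard axioms;
namespace `…Negative.R24`) — IMPORTED; re-exported into `…Disproof.R24`. [cite: Luscher1983, §2] -/

namespace R24

export Summit.QuantumFields.YangMills.Theorems.TwistedTraceScaling.Negative.R24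
  (frobNorm_lineProd_sub_one_le_sum frobNorm_lineProd_gaugeTransform_sub_one sum_translate sum_frobNorm_lineProd_sub_one_le
    sum_frobNorm_lineProd_sub_one_le_mul_orbitDist abelianCfg_apply lineProd_abelianCfg frobNorm_diagSU2_sub_one_eq card_site
    orbitDist_abelianCfg_ge orbitDist_abelianCfg_ge_linear orbitDist_abelianCfg_two_sided
    sum_abs_axis axisAngle_pos axisAngle_le orbitDist_witness_bounds wilsonAction_witness_lt record_shell_witness_mem_region
    frobNorm_witness_link_le norm_zmCoord_oneSite_image norm_zmCoord_oneSite_image_le axis_const_lt_threshold_const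
    witness_radius_lt_threshold witness_oneSite_radius_lt_threshold witness_radius_lt_threshold_record_two
    threshold_le_witness_radius_eventually threshold_le_iff_const forall_mul_powScale_le_eventually_iff cell_costs_eq
    cell_pointwise_exponents_iff cell_costs_eventually_iff cell_window_record_layers cell_window_meets_core_iff
    cell_window_at_record_core_iff)

end R24

-- `section CycleNineteenChecks` (5 re-export `example`s of R24, §W1–§W2; 44 lines) moved VERBATIM to `DisproofAnnexD.md` §P10 at rev 58 (size cap); the theorems stay
-- exported in `namespace R24` above.

/-! ## (X) Cycle 20: the exponent window of the one-site route — BUDGET ∧ UNITS ∧ GAIN ∧ CUT ↔ `1/6 < s < min(a, 2/9)`; `s = 1/6` out by `∀κ`, the record `s = 1/5` out at `a = 1/5`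
Landed module `Negative/OneSiteRouteWindow.lean` (p617366; rc 0, 0 sorry, standard axioms; namespace `…Negative.R25`) — IMPORTED; re-exported into `…Disproof.R25`.
Lane A g12's `…GaugeSlice` (p616442) vetted: exact, `K̃ = S K_β S*`, no target (VERDICT 20). [cite: Luscher1983, §3] -/

namespace R25

export Summit.QuantumFields.YangMills.Theorems.TwistedTraceScaling.Negative.R25
  (two_div_cube_rpow_third_le_two offDiag_budget_one_sixth_iff offDiag_budget_forall_iff axis_const_lt_threshold_const_of_le
    axis_radius_lt_threshold threshold_le_axis_radius_eventually threshold_units_iff equal_exponent_const_iff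
    threshold_units_equal_exponent_iff oneSiteRoute_window_iff oneSiteRoute_window_typed_iff oneSiteRoute_window_quarter_iff
    record_fifth_not_in_window three_sixteenths_in_window record_fifth_fails sixth_fails_budget cell_layer_exists_iff cell_layer_iff
    cell_layer_records)

end R25

-- `section CycleTwentyChecks` (re-export `example`s of R25, §X; 37 lines) moved VERBATIM to `DisproofAnnexD.md` §P10 at rev 58 (size cap); the theorems stay
-- exported in `namespace R25` above.

/-! ## (Y) Cycle 21: the ORTHO chart's kinetic exponent has a slow–stiff CORIOLIS cross term — `tc(Ψ(u,v),Ψ(u',v'))` is not `F(u,u';|v|,|v'|) + G(c;v,v')`; lines `s + q' > 4/3`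
(pointwise on `T×T`, dead) and `q' > 5/6` (kinetic-typical, record 17/20 passes)
Landed module `Negative/OrthoTubeKineticCross.lean` (p621171; rc 0, 0 sorry, standard axioms; namespace `…Negative.R26`) — IMPORTED; re-exported into `…Disproof.R26`.
Lane A g12's `…SlowDisintegration` (p618326) and `…ConstTubeOrtho` (p618521) vetted: exact (VERDICT 21). [cite: Luscher1983, §3] -/

namespace R26

export Summit.QuantumFields.YangMills.Theorems.TwistedTraceScaling.Negative.R26
  (timeCoupling_orthoTube_eq vecPart_relStep_chart kineticCross_eq sum_dot_slow_eq_zero_of_balanced kineticCross_eq_of_balanced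
    kineticCross_orthoTube_eq_of_balanced sum_single_sq single_one_eq single_two_eq scalarPart_link_AB scalarPart_link_AA scalarPart_link_AB'
    scalarPart_link_AA' cross_witness not_separable_frozen_right not_separable_frozen_left not_separable beta_mul_powScale coriolis_sizes_eq
    coriolis_core_line_iff coriolis_core_line_fails coriolis_vs_etaK_iff coriolis_typical_line_iff coriolis_record_lines)

end R26

-- `section CycleTwentyOneChecks` (re-export `example`s of R26, §Y; 25 lines) moved VERBATIM to `DisproofAnnexD.md` §P10 at rev 58 (size cap); the theorems stay
-- exported in `namespace R26` above.

/-! ## (Z) Cycle 22: lane A's typed C4-CORE tube interfaces are INNER one-orbit in a costume — `tubeForm f = qform (gaugeAvg f)`, `‖gaugeAvg f‖² ≤ tubeNormSq`, INNER ⇒ soft tube,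
the trivial split; the gauge width `t` is content-free
Landed module `Negative/SoftTubeIffInner.lean` (pp624387; rc 0, 0 sorry, standard axioms; namespace `…Negative.R27`) — IMPORTED; re-exported into `…Disproof.R27`; `Negative/TubePackageIffInner.lean` (pp625993; namespace `…Negative.R27b`) — IMPORTED; re-exported into `…Disproof.R27b`.
Lane A g12's p620160/p620637/p621021/p621471/p621963/p622264 vetted: exact (VERDICT 22). [cite: Luscher1983, §3] [cite: SeilerLNP1982, §2–3] -/

namespace R27

export Summit.QuantumFields.YangMills.Theorems.TwistedTraceScaling.Negative.R27
  (abs_sq_div_le sq_integral_le_mul_integral_sq_div gaugeAvg_combination gaugeAvg_eq_zero_of_forall tubeForm_eq_qform_gaugeAvg l2_gaugeAvg_le_tubeNormSq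
    softTubeNoIntruderAt_of_inner softTubeNoIntruderAt_iff_inner recordWeight_nonneg mem_fatTube_of_recordWeight_ne_zero recordWeight_ge_of_ne_zero
    orbitDist_lt_of_recordWeight_ne_zero softTube_recordWeight_iff_inner softTube_recordWeight_pow_iff softTube_recordWeight_width_irrel softTube_recordWeight_pow_width_irrel)

end R27

namespace R27b

export Summit.QuantumFields.YangMills.Theorems.TwistedTraceScaling.Negative.R27b
  (tubeNormSq_zero_fun tubeForm_zero_fun tubeNormSq_combination_zero softTubeBOPackageAt_of_softTubeNoIntruderAt softTubeBOPackageAt_iff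
    softTubeBOPackage_recordWeight_iff_inner softTubeBOPackage_recordWeight_iff_innerBOPackage softTubeBOPackage_recordWeight_pow_iff indicator_one_ne_zero_iff
    sq_mul_tubeWeight_eq tubeNoIntruderAt_iff_soft tubeNoIntruderAt_iff_inner)

end R27b

-- `section CycleTwentyTwoChecks` (re-export `example`s of R27/R27b, §Z; 24 lines) moved VERBATIM to `DisproofAnnexD.md` §P10 at rev 58 (size cap); the theorems stay
-- exported in `namespace R27`/`R27b` above.

/-! ## (AA) Cycle 23: frames for the Coriolis term — the HALF-ANGLE (spinorial) colour frame is exact on the abelian × axis-transverse family; frozen frames and every frame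
through the adjoint images `(Ad(u_k))_k` (lane A's `colourRotate (u_k)_k`) are refuted there
Landed module `Negative/OrthoTubePolarFrame.lean` (p628736; rc 0, 0 sorry, standard axioms; namespace `…Negative.R28`) — IMPORTED; re-exported into `…Disproof.R28`.
Landed module `Negative/SliceWindingCopies.lean` (p630777; rc 0, 0 sorry, standard axioms; namespace `…Negative.R29`) — IMPORTED; re-exported into `…Disproof.R29`: the `nearOne(2δ)`
factor of the fat tube is load-bearing for the single-slice evaluation (N2).
Landed module `Negative/OrthoTubeAxialDefect.lean` (p631602; rc 0, 0 sorry, standard axioms; namespace `…Negative.R30`) — IMPORTED; re-exported into `…Disproof.R30`: the transversality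
hypothesis of R28's exact framed product form is necessary (axial stiff data: no product form for any axial-fixing frame, in particular the half-angle frame).
Landed module `Negative/TubePackageRhoIffInner.lean` (p633201; rc 0, 0 sorry, standard axioms; namespace `…Negative.R31`) — IMPORTED; re-exported into `…Disproof.R31`: the §23.9 target
of record with free fat radius is INNER one-orbit (`M`, `t` decorative).
Lane A g12's COARSE-DESIGN §23.7/§23.8 (+ §23.9, addendum 23c) and p625418/p625895/p626270/`…SliceEquiv`/p624686 vetted: sound (VERDICT 23). [cite: Luscher1983, §3] [cite: BrockerTomDieck1985, I (1.10)] -/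

namespace R28

export Summit.QuantumFields.YangMills.Theorems.TwistedTraceScaling.Negative.R28
  (scalarPart_chart_chart_inv scalarPart_chart_diagSU2_chart_inv chargedRot_mulVec_dot adRot_diagSU2_half frame_eq_of_parts colourRotate_halfAngle_apply
    chart_diag_mul_inv timeCoupling_abelian_transverse path_zero witness_defect not_separable_of_frame_period not_separable_abelian_transverse adRot_diagSU2_pi
    adjointImages_pi_eq_zero not_separable_adjointFrame not_separable_colourRotate_slowLink)

end R28

namespace R29

export Summit.QuantumFields.YangMills.Theorems.TwistedTraceScaling.Negative.R29
  (diagSU2_two_pi diagSU2_nat_mul_two_pi diagSU2_step winding_apply winding_eq_constLift orbitDist_copy orbitDist_conj_copy gaugeCoordSq_constLift gaugeCoordSq_conj_copy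
    sliceWeight_without_nearOne_conj_copy frobNorm_copyLink one_sub_cos_pos conj_copy_not_mem_nearOne recordWeight_conj_copy_eq_zero recordWeight_pow_conj_copy_eventually_zero
    conj_copy_ne_one)

end R29

namespace R30

export Summit.QuantumFields.YangMills.Theorems.TwistedTraceScaling.Negative.R30
  (single_zero_eq chargedRot_mulVec_single_zero scalarPart_link_axial scalarPart_link_axial_same scalarPart_link_axial_opp scalarPart_link_axial_opp' neg_mem_capBalancedSet
    axial_witness not_separable_of_frames_fix_axial halfAngleFrame_fixes_axial not_separable_halfAngleFrame not_separable_unframed_axial)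

end R30

namespace R31

export Summit.QuantumFields.YangMills.Theorems.TwistedTraceScaling.Negative.R31
  (recordWeightRho_nonneg mem_fatTubeRho_of_recordWeightRho_ne_zero recordWeightRho_ge_of_ne_zero orbitDist_lt_of_recordWeightRho_ne_zero softTube_recordWeightRho_iff_inner
    softTubeBOPackage_recordWeightRho_iff_inner softTubeBOPackage_recordWeightRho_pow_iff softTubeBOPackage_recordWeightRho_pow_iff_recordWeight
    softTubeBOPackage_recordWeightRho_pow_iff_innerBOPackage)

end R31

-- `section CycleTwentyThreeChecks` (re-export `example`s of R28–R31, §AA; 72 lines) moved VERBATIM to `DisproofAnnexD.md` §P11 at rev 59 (size cap); the theorems stay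
-- exported in `namespace R28`–`R31` above.

/-! ## (AB) Cycle 24: lane A g12's (N2) assembly (COARSE-DESIGN §23.10; p632276 `…LaplaceSandwich`, p632921 `…SliceTaylorBased`, p634162 `…SliceCoerciveBased`, p634368 `…FPWeightChart`)
vetted SOUND; the exponent lines it touches, in the `powScale` currency of R23–R26 (def-free, this file only; NO new module this cycle)
(1) `second_order_line_iff`: a relative error `C·β^{−2σ}` — (N3)'s second order in the slow variable, and §23.10's Haar-density factor when bounded on the SUPPORT radius
`R₁ ≍ L·β^{−σ}` — is inside the `o(λ_b) = o(β^{−1/3})` budget for every constant iff `σ > 1/6` (R25's line again); bounded on the Gaussian core `r = β^{−1}log β` the density factor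
costs `β^{−2}polylog`, inside the budget unconditionally (`density_core_line`, any exponent `a > 1/3`).
(2) the constant-gauge-mode (`g₀`) residual coupling of `avgKernel` between slice points after the `g₀`-Gaussian, `exp(O(β|J|²/(L³ι(c′))))`, `J = Σ_e w′_e × w_e` (paper, VERDICT 24 (v)):
relative `β^{1+2s−4q′}` on the `S`-cut `|w| ≤ β^{−q′}` — line `colourFrame_cut_line_iff : q′ > 1/3 + s/2` — and `β^{2s−1}` on kinetic-typical data — line `colourFrame_typical_line_iff :
s < 1/3`; `colourFrame_record_lines`: the record pairs `(1/5, 17/20)`, `(3/16, 17/20)` and the kinetic-typical layer at `s = 1/5` pass.  [cite: Luscher1983, §3] -/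

-- `section CycleTwentyFourChecks` (examples of cycle 24 (§AB: the second-order line σ > 1/6) moved VERBATIM to Annex D §P11k at rev 62; compiled through rev 61, last at crux write d8653dffa738).

/-! ## (AC) Cycle 25: lane A g12's (N2) SPLIT `…FPWeightIntegrand` (p635715) / `…FPWeightLaplace` (p636367) vetted SOUND; the LAB one-site slow factor of COARSE-DESIGN §23.2 (3) /
## §23.5 (d) is NOT a pointwise factor of `K̃_β = avgKernel β` on the core — file `Negative/AvgKernelNoLabSlowFactor.lean` (p637692), namespace `…Negative.R32`
On constant data `K̃_β(constLift u, constLift u′)` is invariant under INDEPENDENT one-site gauge transformations of the two slots; the diagonal Weyl flip `u_θ ↦ u_{−θ} = Ad_W u_θ` leaves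
`K̃_β` at its diagonal value and costs the LAB kernel `e^{−β|E|(2−2cos 2θ)}` exactly; at `θ = β^{−s}/(8L³)` the pair is inside the core and `βθ² → ∞` for `s < 1/2`: no pointwise sandwich of
`K̃_β` by `𝒩_β·a_β(u)a_β(u′)·K_β(constLift u, constLift u′)` (positive `Ad`-invariant `a_β`) exists; the slow factor of `K̃_β` is the `Ad`-averaged one-site kernel. [cite: Luscher1983, §3] -/

namespace R32

export Summit.QuantumFields.YangMills.Theorems.TwistedTraceScaling.Negative.R32
  (avgKernel_constLift_conj_left avgKernel_constLift_conj_right avgKernel_constLift_gaugeTransform exists_weylFlip re_trace_diagSU2 timeCoupling_self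
    timeCoupling_constDiag_flip constLift_diag_neg_eq_gaugeTransform oneSite_diag_neg_eq_gaugeTransform avgKernel_constDiag_flip transferKernel_constDiag_flip
    sq_le_two_sub_two_cos_two_mul constLift_constDiag_eq_abelianCfg orbitDist_constDiag_le exists_flip_pair not_lab_oneSite_sandwich not_lab_oneSite_sandwich_const)

end R32

namespace R32b

export Summit.QuantumFields.YangMills.Theorems.TwistedTraceScaling.Negative.R32b
  (frobNorm_diagSU2_sub_diagSU2_neg_le exists_kinetic_flip_pair not_lab_oneSite_sandwich_kinetic not_lab_oneSite_sandwich_kinetic_const)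

end R32b

-- `section CycleTwentyFiveChecks` (re-export `example`s of R32/R32b, §AC; 42 lines) moved VERBATIM to `DisproofAnnexD.md` §P11b at rev 59 (size cap); the theorems stay
-- exported in `namespace R32`/`R32b` above.

/-! ## (AD) Cycle 26: lane A's (P)-chain p638140 / p638588 / p638863 / p640044 / p641240 vetted SOUND; the STIFF FLIP — `K̃_β = avgKernel β` has NO pointwise «slow factor ×
## untwisted stiff factor» model on the tube core — files `Negative/AvgKernelStiffFlip.lean` (p641489, `…Negative.R33`), `Negative/AvgKernelNoUntwistedStiffFactor.lean` (p641924, `…Negative.R33b`)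
The tube is stable under the constant gauge group and `K̃_β` is constant along its orbits in each slot; at abelian slow data `u_θ` the half-turn `diagSU2 (π/2)` fixes `u_θ` and flips transverse
stiff data, so `K̃_β(U, orthoTube u_θ (−v)) = K̃_β(U, orthoTube u_θ v)` while `K_β(orthoTube u_θ v, orthoTube u_θ (−v)) = e^{−4βΣ|v_e|²}K_β(diag)` exactly; the flip pair with `θ = β^{−s}/(8|E|)`
and amplitude `a ≤ β^{−s}/16` is in the core, so no positive model with kinetic decay `e^{−cβΣ|v_e|²}` across the flip is a `(1 ∓ η)𝒩_β`-sandwich of `K̃_β` (`η < 1`; `η_β → 0` on the kinetic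
core); the surviving model is the twisted product `∫dg K₁(u, Ad_g u′)G_st(w, R_g w′)`. [cite: Luscher1983, §3] -/

namespace R33

export Summit.QuantumFields.YangMills.Theorems.TwistedTraceScaling.Negative.R33
  (gaugeTransform_const_orthoTube diagSU2_conj_diagSU2 gaugeTransform_const_diag adRot_halfTurn_mulVec_of_transverse colourRotate_halfTurn_of_transverse
    gaugeTransform_halfTurn_orthoTube avgKernel_orthoTube_diag_neg_right avgKernel_orthoTube_diag_neg_left gaugeTransform_const_oneSite_one avgKernel_orthoTube_one_colourRotate
    sum_sq_neg_apply timeCoupling_orthoTube_neg transferKernel_orthoTube_diag_neg frobNorm_chartSU2_sub_one_le_two_sqrt frobNorm_orthoTube_sub_one_le orbitDist_orthoTube_le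
    neg_mem_capBalancedSet exists_stiff_witness exists_stiff_flip_pair)

end R33

namespace R33b

export Summit.QuantumFields.YangMills.Theorems.TwistedTraceScaling.Negative.R33b
  (kinetic_tolerance_aux not_flipDecaying_sandwich not_flipDecaying_sandwich_kinetic slowTimesLab_flipDecay not_slowTimesLab_sandwich not_slowTimesLab_sandwich_kinetic)

end R33b

namespace R33c

export Summit.QuantumFields.YangMills.Theorems.TwistedTraceScaling.Negative.R33c
  (inner_vacGrad_linkEmbed exists_loop_witness relLinkVec_orthoTube_chart gaugeCoordSq_orthoTube_chart_eq_zero diagSU2_eq_chartSU2 exists_slice_flip_pair)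

end R33c

namespace R33d

export Summit.QuantumFields.YangMills.Theorems.TwistedTraceScaling.Negative.R33d
  (not_flipDecaying_sandwich_slice not_flipDecaying_sandwich_slice_kinetic not_slowTimesLab_sandwich_slice not_slowTimesLab_sandwich_slice_kinetic)

end R33d

-- `section CycleTwentySixChecks` (re-export `example`s of R33/R33b, §AD: the stiff flip; 79 lines) moved VERBATIM to `DisproofAnnexD.md` §P11c at rev 59c (size cap); the theorems stay
-- exported in `namespace R33`/`R33b` above.

/-! ## (AE) Cycle 27: lane A g13's COARSE-DESIGN §24 bricks (OS) p642257 / (CA2) p644359 / (OS0) p643780–p644571 / (R) p644888 / (FL) p645288 / p645301 vetted SOUND; the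
## SUPPORT-SEPARATED targets `SoftTubeNoIntruderOn L χ S` / `SoftTubeBOPackageOn L χ S` of record are INNER one-orbit at the test radius — file `Negative/SoftTubeOnIffInner.lean` (p645766, `…Negative.R34`)
INNER one-orbit at `δ` gives the separated tube statement for every measurable bounded weight `χ ≥ 0` bounded below on its support and every region with `supp χ ∩ S ⊆ {orbitDist < δ}`
eventually (R27's Gram-operator proof); the package is the statement by the trivial split (R27b); at `χ_big = recordWeightRho (3β^{−s}) (Mβ^{−s}) (β^{−t})`, `S = {orbitDist < β^{−s}}`,
`M ≥ 6` the target is `↔ InnerNoIntruderOneOrbitAt L (powScale s)` for every `t`, `M`, and ≡ the R18 / R27b / R31 targets. [cite: Luscher1983, §3] -/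

namespace R34

export Summit.QuantumFields.YangMills.Theorems.TwistedTraceScaling.Negative.R34
  (softTubeNoIntruderOn_of_inner softTubeNoIntruderOn_orbitDist_of_inner softTubeNoIntruderOn_iff_inner softTubeBOPackageOn_of_softTubeNoIntruderOn
    softTubeBOPackageOn_iff softTubeBOPackageOn_iff_inner softTubeOn_bigRecordWeightRho_iff_inner softTubeBOPackageOn_bigRecordWeightRho_iff_inner softTubeBOPackageOn_pow_iff
    softTubeBOPackageOn_pow_iff_three softTubeBOPackageOn_pow_iff_packageAt_recordWeightRho softTubeBOPackageOn_pow_iff_packageAt_recordWeight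
    softTubeBOPackageOn_pow_iff_innerBOPackage softTubeBOPackageOn_pow_params_irrel)

end R34

-- `section CycleTwentySevenChecks` (re-export checks of cycle 27 (§AE: support-separated C4-CORE of record ≡ INNER one-orbit) moved VERBATIM to Annex D §P11o at rev 63; compiled through rev 62, last at crux write 8c9c8f49afd8).

/-! ## (AF) Cycle 28: lane A g13's (G)-assembly p646539 `…BOProjection` / p646936 `…BOAssemblyPrelim` / p647299 `…BOAssemblySlow` / p647445 `…BOAssemblyFloor` vetted SOUND ((F) typed
## ADDITIVE two-sided); ONE-SIDED pointwise domination by the gapped twisted model transfers neither (ST) nor (OD) — file `Negative/StiffGapNotFromDomination.lean` (p648068, `…Negative.R35`)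
`Fin 2` witnesses (`η₀ = 0`) against the one-sided reading of §24.4 (ST)/(OD); entrywise order is not form order; two-sided `|K̃ − M| ≤ η₀M` gives the gap with loss `η₀μ₀(M)`,
attained — see VERDICT 28. [cite: Helffer2013, Lemma 7.1] [cite: Luscher1983, §3] -/

namespace R35

export Summit.QuantumFields.YangMills.Theorems.TwistedTraceScaling.Negative.R35
  (domination_witness not_gap_of_oneSided_domination not_offdiag_of_oneSided_domination not_operator_le_of_entrywise_le form_le_of_twoSided_near
    form_le_gap_add_of_twoSided_near twoSided_loss_attained)

end R35

-- `section CycleTwentyEightChecks` (re-export checks of cycle 28 (§AF: one-sided domination does not transfer a gap) moved VERBATIM to Annex D §P11p at rev 63; compiled through rev 62, last at crux write 8c9c8f49afd8).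

/-! ## (AG) Cycle 28b: lane A g13's p648532 `…BOAssembly` / p648902 `…FibreMassBrick` / p649470 `…BOSupportGeometry` vetted SOUND; the offered discharge of `BOBricks.hbo`
## (`boFun_support_record`, crude `orbitDist_orthoTube_le`) is VACUOUS at the record fat radius `3δ` — file `Negative/SupportRecordRadiusThree.lean` (p650479, `…Negative.R36`)
`hshadow ∧ h𝒰δ₁` force `|Edge 3 L|·δ₁ ≥ 3δ` (constant diagonal lifts, IVT); hence `|Edge 3 L|·(4r + δ₁) < 3δ` fails for every `r ≥ 0`; repair `orbitDist (orthoTube u v) ≤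
(|Edge|/3)·orbitDist₁ u + 4Σ‖v_e‖` with a nonempty window — see ADDENDUM 28b. [cite: Luscher1983, §2] -/

namespace R36

export Summit.QuantumFields.YangMills.Theorems.TwistedTraceScaling.Negative.R36
  (frobNorm_diagSU2_sub_one_eq_sqrt exists_frobNorm_diagSU2_eq card_edge_eq three_le_card_edge orbitDist_constDiag₁ slowMean_constLift orbitDist_constLift_le_sum
    orbitDist_constLift_constDiag₁_le three_mul_le_card_mul_delta1 not_support_record_hyp not_eventually_support_record_hyp not_eventually_support_record_hyp_pow
    sum_edge_dir orbitDist_one_site_eq_sum_dir orbitDist_orthoTube_le_sharp orbitDist_orthoTube_le_sharp' sharp_window_nonempty)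

end R36

-- `section CycleTwentyEightBChecks` (re-export checks of cycle 28B (§AG: record `BOBricks` fields exclude the sharp window) moved VERBATIM to Annex D §P11q at rev 63; compiled through rev 62, last at crux write 8c9c8f49afd8).

/-! ## (AH) Cycle 28c: lane A's `…RecordBricks` / `…SlowShadow` / `…RecordShadow` vetted SOUND (fat radius free, `K > 42`); `RecordBOInput L s K M` is EMPTY for `1 ≤ K ≤ 3`
## — file `Negative/RecordInputFatRadius.lean` (p651669, `…Negative.R36b`); `hshadow` ⇒ `|Edge|δ₁ ≥ 3β^{−s}` (R36), `hradii` ⇒ `K > 3` — see ADDENDUM 28c. [cite: Luscher1983, §3] -/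

namespace R36b

export Summit.QuantumFields.YangMills.Theorems.TwistedTraceScaling.Negative.R36b
  (three_mul_powScale_le_of_recordInput three_lt_of_recordInput isEmpty_recordInput_of_le_three)

end R36b

-- `section CycleTwentyEightCChecks` (re-export check of cycle 28C (§AH: record input forces fat-radius factor `K > 3`) moved VERBATIM to Annex D §P11r at rev 63; compiled through rev 62, last at crux write 8c9c8f49afd8).

/-! ## (AI) Cycle 29: lane A g13's p651738 `…BOKernel` / p652155 `…RecordInequalities` / p652422 `…RecordAnalytic` (THE HAND-OFF OBJECT `RecordAnalyticInput L s M`) / p652629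
## `…TubeFormGaugeAvg` / p652927 `…AvgKernelColourBased` vetted SOUND; the RATE fields force `s > 1/6`, the RADIUS fields `s ≤ 1/5` — file `Negative/RecordInputExponentWindow.lean` (p653556, `…Negative.R37`)
`C(Kβ^{−s})² ≤ κ ≤ aλ_b(L³β) ≤ 2aβ^{−1/3}` for every `C`, `a > 0` ⇒ `2s > 1/3`; `13(L³β)^{−1/5} < δ₁`, `|Edge|(4r+δ₁) < Kβ^{−s}` ⇒ `β^{s−1/5}` bounded on `[1,∞)` ⇒ `s ≤ 1/5` — see VERDICT 29
(Annex B §V1f). [cite: Luscher1983, §3] -/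

namespace R37

export Summit.QuantumFields.YangMills.Theorems.TwistedTraceScaling.Negative.R37
  (one_le_cube bareLambda_cube_mul_le sixth_lt_of_rate_window sixth_lt_of_recordInput sixth_lt_of_recordAnalyticInput isEmpty_recordInput_of_le_sixth
    isEmpty_recordAnalyticInput_of_le_sixth radius_ineq_at le_fifth_of_recordInput inv_le_cube_rpow sq_lt_of_recordInput_of_fifth_le lt_fifth_of_recordInput
    window_of_recordInput isEmpty_recordInput_of_not_window window_of_recordAnalyticInput)

end R37

-- `section CycleTwentyNineChecks` (re-export checks of cycle 29 (§AI: the record rate fields force `s > 1/6`) moved VERBATIM to Annex D §P11s at rev 63; compiled through rev 62, last at crux write 8c9c8f49afd8).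

/-! ## (AJ) Cycle 30: lane A g14's (B-T) pen p654332 / p655712 / p656084 + COARSE-DESIGN §25 vetted SOUND; the FP weight must PIN the colour frame — `hpt` of `hT_of_fp` is
## unsatisfiable for every left-colour-invariant `W` (`W ≡ 1`: `fpBOKernel = 𝒦`) — file `Negative/FPWeightMustPinColour.lean` (p657434, `…Negative.R38`); ADDENDUM 30b: nor through the
## locality door `hT_of_fp_add` (p657326) — `Negative/FPWeightMustPinColourTail.lean` (p658875, `….R38b`); Annex B §V1g. [cite: SeilerLNP1982, §3] -/

namespace R38

export Summit.QuantumFields.YangMills.Theorems.TwistedTraceScaling.Negative.R38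
  (gaugeIntegral_colourMul fpBOKernel_conj_left boKernel_eq_fpBOKernel_one orbitDist_uDiag_le exists_uDiag_neg_eq_conj transferKernel_uDiag_flip
    transferKernel_uDiag_flip_le flip_constraint_of_hpt not_hpt_of_colourInvariant not_hpt_trivial_weight)

end R38

namespace R38b

export Summit.QuantumFields.YangMills.Theorems.TwistedTraceScaling.Negative.R38b
  (transferKernel_diag_self levelValue_one_zero_le flip_constraint_of_hptAdd not_hptAdd_of_colourInvariant not_hptAdd_trivial_weight)

end R38b

-- `section CycleThirtyChecks` (re-export checks of cycle 30 (§AJ: the FP weight must pin the colour frame, R38/R38b) moved VERBATIM to Annex E §P12a at rev 64; compiled through rev 63, last at crux write ddcd78c4bba7).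

/-! ## (AK) Cycle 31: lane A g14's (L3) diagonal averaging engine (p658374 `…BTColourAveraging` … `…BTProductForm`) vetted SOUND; the colour average is exact to FIRST order
## only — second moment `δ_ij(a·a')/3`, `|∫exp X₁ − 1 − (1/6)·ΣΣ(a_k·a_l)(Y_k·Y_l)| ≤ (2/9)ε₁³`, two sharpenings refuted (`κ ≥ cγβ^{-2s}` necessary) — file
## `Negative/ColourAverageSecondOrder.lean` (p661139, `…Negative.R39`); Annex B §V1h. [folklore] -/

namespace R39

export Summit.QuantumFields.YangMills.Theorems.TwistedTraceScaling.Negative.R39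
  (adRot_cyc_mulVec adRot_mulVec_dotProduct moment_eq integral_dot_mul_dot integral_sq_sum_dot abs_integral_exp_sub_second_order
    haar_integral_exp_linear_second_order haar_integral_exp_dot_second_order average_exp_e0_ge not_average_exp_cubic_close not_sandwich_upper_seventh)

end R39

-- `section CycleThirtyOneChecks` (re-export checks of cycle 31 (§AK: colour average exact to first order only, R39) moved VERBATIM to Annex E §P12b at rev 64; compiled through rev 63, last at crux write ddcd78c4bba7).

/-! ## (AL) Cycle 33: STIFF CAPTURE NECESSITY — (B-T)+(B-ST)+(B-OD) force `θ₀‖h − P_Ω h‖²_w ≤ (2κ+η+2b)‖h‖²_w` on near-top states; the BO capture is bounded by the mass on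
## `supp Ω` per fibre; lane A's flat log-free `btOmega` (p668960) captures `≈ 10⁻⁴` of the Mehler state — file `Negative/StiffCaptureNecessity.lean` (p671914, `…Negative.R40`);
## Annex B §V1l. [folklore] -/

namespace R40

export Summit.QuantumFields.YangMills.Theorems.TwistedTraceScaling.Negative.R40
  (two_mul_sqrt_mul_sqrt_le stiff_capture stiff_gap_le_of_uncaptured stiff_gap_nonpos_of_tendsto no_stiff_gap_of_uncaptured sq_integral_mul_le_of_support
    fibreInner_sq_le fibre_capture_le fibre_capture_le_ball record_capture_le_ball btOmega_capture_le_ball)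

end R40

-- `section CycleThirtyThreeChecks` (re-export check of cycle 33 (§AL: stiff capture necessity, R40) moved VERBATIM to Annex E §P12c at rev 64; compiled through rev 63, last at crux write ddcd78c4bba7).

/-! ## (AM) Cycle 34: SLOW-FACTOR / PROFILE DOMINANCE NECESSITY — (B-ST)`(Ω, σ, θ₀)` forces `σ ≥ (1 − o(1))σ'/(1 − θ₀)` over every certified profile off `supp Ω`; with lane A's
## `profileB_hT` as certificate, one admissible competitor with `σ_B ≥ σ` refutes (B-ST) ∀θ₀ ∀M — files `Negative/StiffGapSlowDominance.lean` (p674851, `…Negative.R41`),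
## `Negative/StiffGapProfileDominance.lean` (p676081, `…Negative.R42`); Annex B §V1o. [folklore] -/

namespace R41

export Summit.QuantumFields.YangMills.Theorems.TwistedTraceScaling.Negative.R41
  (slow_ratio_le slow_ratio_clean no_gap_of_dominance hT_lower_of_twoSided fibreInner_boFun_eq_zero_of_disjoint fibreMass_nonneg fibreMass_le_of_gaugeAvg_le
    fatTubeRho_recordChi_mono recordChi_mono gaugeAvg_recordChi_le fibreMass_recordChi_le tubeNormSq_boFun_le btSlow_dominates_of_stiff_gap btStiffGap_false_of_competitor
    btStiffGap_false_of_dominant_competitor)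

end R41

namespace R42

export Summit.QuantumFields.YangMills.Theorems.TwistedTraceScaling.Negative.R42
  (profile_dominates_of_stiff_gap stiffGap_false_of_competitor stiffGap_false_of_dominant_competitor stiffGap_false_of_admissible_competitor
    btStiffGap_false_of_admissible_competitor profileStiffGap_false_of_admissible_competitor)

end R42

-- `section CycleThirtyFourChecks` (re-export checks of cycle 34 (§AM: slow-factor / profile dominance necessity, R41/R42) moved VERBATIM to Annex E §P12d at rev 64; compiled through rev 63, last at crux write ddcd78c4bba7).

/-! ## (AN) Cycle 35: THE (B-OD) DOOR IS VACUOUS AS TYPED — the relative pointwise quasimode hypothesis `hQ` of p677591 `…BODoor` / p677925 `…BODoorPack` is unsatisfiable for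
## every truncated profile `Ω ≥ 0` unless `φ ≡ 0` (`hQ ↔ φ ≡ 0`); instances: every `frozenProfile`, the frozen stiff Gaussian `Ω_G` for every `(t, b, β)`, every `RecordAnalyticInput`
## with `Ω ≥ 0` — file `Negative/QuasimodeDoorVacuous.lean` (p678818, `…Negative.R43`); Annex C §V2b. [folklore] -/

namespace R43

export Summit.QuantumFields.YangMills.Theorems.TwistedTraceScaling.Negative.R43
  (support_pos_of_ball support_pos_of_recordGamma_pos transferredProfile_pos exists_norm_linkEmbed_gt door_quasimode_false door_quasimode_iff_eq_zero
    door_quasimode_false_frozenProfile door_quasimode_false_stiffGauss door_quasimode_false_record door_quasimode_iff_eq_zero_record)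

end R43

-- `section CycleThirtyFiveChecks` (re-export checks of cycle 35 (§AN: the pointwise (B-OD) door is vacuous, R43) moved VERBATIM to Annex E §P12e at rev 64; compiled through rev 63, last at crux write ddcd78c4bba7).

/-! ## (AO) Cycle 36: THE `L²(w)` (B-OD) DOOR (p679261) IS AN EQUIVALENCE AND THE LEAK TEST — `hOD` forces every fibrewise-orthogonal quasimode defect `E` to satisfy
## `∫E²w ≤ (bΛ)²‖boFun φ Ω‖²_w`, and `∫_S K̃(boFun φ Ω)²/w ≤ (bΛ)²‖boFun φ Ω‖²_w` on every measurable `S ⊆ {χ≠0} ∩ {Ω∘relLinkVec = 0} ∩ {w ≥ w₀}` (the transfer of the BO state may not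
## leak out of the profile's support ball); record forms for every `RecordAnalyticInput` — file `Negative/DefectDoorTight.lean` (p681327, `…Negative.R44`); Annex C §V2c. [folklore] -/

namespace R44

export Summit.QuantumFields.YangMills.Theorems.TwistedTraceScaling.Negative.R44
  (le_sq_mul_of_le_mul_sqrt tubeCross_eq_tubeNormSq_of_defect defect_sq_le_of_hOD_pair leak_admissible leak_sq_le_of_hOD_pair defect_sq_le_of_hOD leak_sq_le_of_hOD
    record_defect_sq_le record_leak_sq_le record_profile_zero_of_lt_norm)

end R44

-- `section CycleThirtySixChecks` (re-export checks of cycle 36 (§AO: the `L²(w)` (B-OD) door is an equivalence; the leak test, R44) moved VERBATIM to Annex E §P12f at rev 64; compiled through rev 63, last at crux write ddcd78c4bba7).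

/-! ## (AP) Cycle 37: CO-SUPPORT forced by the POINTWISE (C1c) of the central glue (p682134) — the `W`-smeared BO function vanishes at the in-tube two-link points
## `orthoTube u₀ (a·e₀⊗(δ_{(x₁,k)}−δ_{(x₂,k)}))`, `5T < |a| ≤ 1/2`; `hC1c` forces `{G = 0} = {A = 0}`; file `Negative/CentralGlueCoSupport.lean` (p684279, `…Negative.R45`). [folklore] -/

namespace R45

export Summit.QuantumFields.YangMills.Theorems.TwistedTraceScaling.Negative.R45
  (norm_su2Quat_dressed_quot_sub_one_le norm_chartQuat_sub_one_le_of_abs_le norm_chartQuat_sub_chartQuat_neg_sq norm_su2Quat_chart_quot_sub_one twoLink_mem_capBalancedSet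
    norm_su2Quat_twoLink_quot smearedBO_twoLink_eq_zero smearedBO_twoLink_eq_zero_glue G_nonpos_of_hC1c_at G_eq_zero_iff_of_hC1c_at not_hC1c_of_slowMean_shape)

end R45

-- `section CycleThirtySevenChecks` (re-export checks of cycle 37 (§AP: co-support forced by the pointwise (C1c), R45) moved VERBATIM to Annex E §P12g at rev 64; compiled through rev 63, last at crux write ddcd78c4bba7).

/-! ## (AQ) Cycle 38: the RADIUS WINDOW of the central Gaussian comparison (C1c′)/(C1d) (lane A g17 `…BOCentralGaussian/Chart/Tube`, p684724…p686369) — vacuity radius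
## `margin²β > 9L³log 2 + 98βR²`; `hAlo` false beyond the two-link radius `8.165T`; files `Negative/CentralGaussianRadiusWindow.lean` (p687371, `…Negative.R46`),
## `Negative/CentralGaussianRadiusWindowLocal.lean` (p688075, `…Negative.R46L`). [folklore] -/

namespace R46

export Summit.QuantumFields.YangMills.Theorems.TwistedTraceScaling.Negative.R46
  (card_linkIndex stiffGaussTop_le_pow top_mul_exp_le_tail central_gaussian_lower_nonpos central_gaussian_lower_local_nonpos central_gaussian_tube_lower_nonpos
    twoLink_chart_mem_ball twoLink_chart_norm_le orthoTube_twoLink_eq_chart not_localGaussLower_of_twoLink not_hAlo_of_sq_lt not_hGlo window)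

export Summit.QuantumFields.YangMills.Theorems.TwistedTraceScaling.Negative.R46L
  (central_gaussian_tube_lower_local_nonpos not_hAloAt_of_sq_lt not_hAloLocal_glue window_local)

end R46

-- `section CycleThirtyEightChecks` (re-export checks of cycle 38 (§AQ: radius window of the central Gaussian comparison, R46/R46L/R47) moved VERBATIM to Annex E §P12h at rev 64; compiled through rev 63, last at crux write ddcd78c4bba7).

/-! ## (AR) Cycle 39: the EUCLIDEAN (plaquette) radius of the central Gaussian comparison — `A_W(χ₀⊗Ω)(P(b·e₀⊗δ)) = 0` beyond `(8/7)(6R+2(3T₁+2T₂)²)`; the landed one-radius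
## (C1) glue has constants `≥ e^{600L⁶}` apart whenever `hAlo(gm>0)` ∧ informative; files `Negative/CentralEuclideanRadius.lean` (✓p690699, `…Negative.R47`),
## `Negative/CentralEuclideanRadiusWindow.lean` (✓p691609, `…Negative.R47W`). [folklore] -/

namespace R47

export Summit.QuantumFields.YangMills.Theorems.TwistedTraceScaling.Negative.R47
  (norm_su2Quat_plaquette_sub_one_le norm_su2Quat_gnoPoint_sub_one_ge norm_su2Quat_gnoPoint_single_sub_one_ge singleLink_chart_apply norm_chartVec_singleLink
    hol_gaugeTransform smearedBO_singleLink_eq_zero)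

export Summit.QuantumFields.YangMills.Theorems.TwistedTraceScaling.Negative.R47W
  (not_hAloAt_singleLink not_hAloLocal_glue_euclid window_euclid coreEps2_ge coreEta_add_coreEps1_nonneg glue_rate_gt glue_rate_gt_of_hAlo)

end R47

-- `section CycleThirtyNineChecks` (re-export checks of cycle 39 (§AR: the Euclidean radius of the central Gaussian comparison, R47) moved VERBATIM to Annex E §P12i at rev 64; compiled through rev 63, last at crux write ddcd78c4bba7).

/-! ## (AS) Cycle 40: the (4′) chart→slice TRANSFER exponent `ε_tr ≥ 10584L³βρ³` on the one-radius glue's window — `> 4000·L^{21/4}β^{1/4}` (diverges);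
## `→ 0` on the decoupled schedule; file `Negative/ChartTransferWindow.lean` (✓p695870, `…Negative.R48`). [folklore] -/

namespace R48

export Summit.QuantumFields.YangMills.Theorems.TwistedTraceScaling.Negative.R48
  (chartTransferEps_eq chartTransferEps_le_full chartTransferEps_pow_four_gt chartTransferEps_gt chartTransfer_wide_of_window chartTransfer_wide_of_hAlo
    chartTransferEps_le_of_schedule)

end R48

-- `section CycleFortyChecks` (re-export checks of cycle 40 (§AS: the chart→slice transfer exponent window, R48) moved VERBATIM to Annex E §P12j at rev 64; compiled through rev 63, last at crux write ddcd78c4bba7).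

/-! ## (AT) Cycle 41: the window of the DECOUPLED (C1) glue p696042 — `R₀ > 9.8R_in`, `R₀²β, ρ²β > 9L³log 2`, `(48R+400T²)²β > 351L³log 2`;
## covering ⇒ `R_in < r_f/10.8`, `r_f > 2.5L^{3/2}β^{-1/2}`; file `Negative/InnerGlueWindow.lean` (p697247, `…Negative.R49`). [folklore] -/

namespace R49

export Summit.QuantumFields.YangMills.Theorems.TwistedTraceScaling.Negative.R49
  (not_hAloInner_glue_euclid window_inner window_inner_of_hAlo window_inner_covering)

end R49

-- `section CycleFortyOneChecks` (re-export checks of cycle 41 (§AT: the decoupled (C4) window in arithmetic form, R49) moved VERBATIM to Annex E §P13a at rev 65; compiled through rev 64, last at crux write 07707b30b5bf).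

/-! ## (AU) Cycle 41b: the (C1a) smearing WINDOWS are first-order costs — `η₀ ≥ 192|E|βT²δu`, `η₀ ≥ 1728N_PβT²√σ`; with `βT² ≥ 1`, `δu = β^{-s/2}` or `σ = β^{-s}`
## (`s < 1/3`) the OFF-DIAG budget is dead (R21 at `p = s/2`); file `Negative/SmearingWindowCost.lean` (p698364, `…Negative.R50`). [folklore] -/

namespace R50

export Summit.QuantumFields.YangMills.Theorems.TwistedTraceScaling.Negative.R50
  (coreEta_ge_window coreEta_ge_sqrtAction sqrt_powScale coreEta_ge_of_window_schedule coreEta_ge_of_action_schedule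
    smearing_offDiag_budget_false_of_window smearing_offDiag_budget_false_of_action)

end R50

-- `section CycleFortyOneBChecks` (re-export checks of cycle 41b (§AU: the smearing off-diagonal budget window, R50) moved VERBATIM to Annex E §P13b at rev 65; compiled through rev 64, last at crux write 07707b30b5bf).

/-! ## (AV) Cycle 41c: TIGHTNESS of (AU) — polylog·`β^{-s}` windows are affordable iff `s > 1/6`; the REPAIRED (C1a) windows `δu = 5MK·powScale s β`,
## `σ = 12L³(5MK·powScale s β)⁴` pass the OFF-DIAG budget on `βT² ≤ 225L²(log β)⁴`; file `Negative/SmearingWindowBand.lean` (p699374, `…Negative.R50T`). [folklore] -/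

namespace R50T

export Summit.QuantumFields.YangMills.Theorems.TwistedTraceScaling.Negative.R50T
  (logpow_mul_powScale_le polylog_window_affordable window_floor_affordable sqrt_repaired_action action_floor_affordable)

end R50T

-- `section CycleFortyOneCChecks` (re-export checks of cycle 41c (§AV: the repaired window floor is affordable, R51) moved VERBATIM to Annex E §P13c at rev 65; compiled through rev 64, last at crux write 07707b30b5bf).

/-! ## (AW) Cycle 41d: the landed (C1) theorem's support inclusion `hbo` and CRUDE window floor `hχlo` force `χ_lo = 0` (`lo = 0`); a floor radius `a ≥ MK·powScale s β`
## is vacuous; file `Negative/CentralChartFloorVacuous.lean` (p700227, `…Negative.R51`). [folklore] -/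

namespace R51

export Summit.QuantumFields.YangMills.Theorems.TwistedTraceScaling.Negative.R51
  (norm_su2Quat_diagSU2_sub_one_sq norm_su2Quat_diagSU2_arcsin mem_nearOne_of_recordChi_ne_zero chilo_nonpos_of_floor_window chilo_eq_zero_of_crude_floor
    lower_constant_vanishes)

end R51

-- `section CycleFortyOneDChecks` (re-export checks of cycle 41d (§AW: `χ_lo = 0` forced by the crude floor, R52) moved VERBATIM to Annex E §P13d at rev 65; compiled through rev 64, last at crux write 07707b30b5bf).

/-! ## (AX) Cycle 41e: R50/R50T on the LANDED schedule B — `2025 ≤ βT² ≤ (45L+1)²ℓ⁴`, the smearing-window exponent band `1/6 < s' < 1/2`;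
## file `Negative/SmearingWindowSchedule.lean` (p701056, `…Negative.R52`). [folklore] -/

namespace R52

export Summit.QuantumFields.YangMills.Theorems.TwistedTraceScaling.Negative.R52
  (schedT_nonneg one_le_beta_schedT_sq beta_schedT_sq_le sched_window_budget_false sched_window_term_affordable)

end R52

-- `section CycleFortyOneEChecks` (re-export checks of cycle 41e (§AX: the schedule window kills the smeared budget for `s' < 1/6`, R53) moved VERBATIM to Annex E §P13e at rev 65; compiled through rev 64, last at crux write 07707b30b5bf).

/-! ## (AY) Cycle 42: the ACTION window of lane A's draft (C1) record on schedule B — `σ = powScale (1/3) β` is the excluded endpoint (`η₀ ≥ A·ℓ⁴·β^{-1/6}`, `hb_small` dead);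
## the action exponent band is exactly `q > 1/3`; file `Negative/ActionWindowSchedule.lean` (p702639, `…Negative.R53`). [folklore] -/

namespace R53

export Summit.QuantumFields.YangMills.Theorems.TwistedTraceScaling.Negative.R53
  (log_le_btLog logpow_le_beta_schedT_sq logpow_le_beta_schedT_sq' coreEta_ge_action_third thirdCoeff_pos bareLambda_cube_eq_powScale
    sched_action_budget_false_at_third not_hb_small_of_action_third sched_action_budget_false_le_third sched_action_term_affordable)

end R53

-- `section CycleFortyTwoChecks` (re-export checks of cycle 42 (§AY: the action ceiling `σ = β^{-1/3}` kills the (OD) budget, R54) moved VERBATIM to Annex E §P13f at rev 65; compiled through rev 64, last at crux write 07707b30b5bf).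

/-! ## (AZ) Cycle 42b: the record LANDED verbatim (p703178, `σ = powScale (1/3) β`) — its whole exponent `η₀` and the (C4) core-defect constant `ε ≥ η` inherit R53's floor
## (`hb_small` dead for every `b ≥ η₀`, every `b ≥ c·ε`); the repaired `σ = powScale (1/2) β` exponent is `≤ (45L+1)⁴ℓ⁸β^{-1/4}(750|E|+5140N₃+2193291N_P)` and meets
## `hb_small`; files `Negative/ActionWindowRecord.lean` (p703997, `…Negative.R53R`), `Negative/ActionWindowCoreDefect.lean` (p704343, `…Negative.R53S`). [folklore] -/

namespace R53R

export Summit.QuantumFields.YangMills.Theorems.TwistedTraceScaling.Negative.R53R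
  (coreEta_le_recordExponent recordExponent_nonneg record_budget_false not_hb_small_of_recordExponent not_hb_small_of_exp_recordExponent
    not_hb_small_recordExponent_self scale_facts exponent_poly_bound repaired_recordExponent_le repaired_recordExponent_affordable repaired_recordExponent_hb_small)

end R53R

namespace R53S

export Summit.QuantumFields.YangMills.Theorems.TwistedTraceScaling.Negative.R53S
  (coreEta_zero_le exponent_ge_coreEta_zero le_defectConst etac_le_defectConst not_hb_small_of_scaled_exponent not_hb_small_of_coreDefect_third core_defect_budget_false)

end R53S

-- `section CycleFortyTwoBChecks` (re-export checks of cycle 42b (§AZ: the repaired record exponent meets `hb_small`, R54B–D) moved VERBATIM to Annex E §P13g at rev 65; compiled through rev 64, last at crux write 07707b30b5bf).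

/-! ## (BA) Cycle 43: the complete (C4) window ledger — `hb_small(η)` iff `s, p > 1/6`, `q > 1/3`; `hcore` forces `p ≤ 1/5` (binding, affordable); the record's input window
## `powScale (1/3) β` cannot host `BOBricks.𝒰`; files `Negative/CoreWindowLedger.lean` (p706452, `…Negative.R54`), `Negative/CoreWindowBand.lean` (p707895, `…Negative.R54B`), `Negative/CoreTransferRecordDefect.lean` (p708594, `…Negative.R54C`), `Negative/CoreDefectRecordRate.lean` (p709578, `…Negative.R54D`). [folklore] -/

namespace R54

export Summit.QuantumFields.YangMills.Theorems.TwistedTraceScaling.Negative.R54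
  (norm_su2Quat_diagSU2_sub_one_sq sq_half_le_norm_su2Quat_diagSU2_sub_one_sq orbitDist_oneLink_le window_radius_of_core coreRadius_eq coreRadius_le coreRadius_pos
    tendsto_coreRadius input_radius_of_hcore exponent_normal_form exponent_le_radius alphaTerm_le_exponent coreDefect_floor_of_hcore hcore_floor_hb_small
    not_hb_small_of_powScale_floor not_hb_small_of_output_radius not_hb_small_of_input_radius)

end R54

namespace R54B

export Summit.QuantumFields.YangMills.Theorems.TwistedTraceScaling.Negative.R54B
  (windows_exponent_le windows_hb_small hcore_windows_hb_small record_inputWindow_not_core announcedWindows_exponent_not_hb_small repairedWindows_exponent_hb_small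
    defectConst_le_three defectConst_hb_small)

end R54B

namespace R54C

export Summit.QuantumFields.YangMills.Theorems.TwistedTraceScaling.Negative.R54C
  (tendsto_bareLambda_cube constant_defect_not_hb_small coreTransferRecord_defect_not_hb_small)

end R54C

namespace R54D

export Summit.QuantumFields.YangMills.Theorems.TwistedTraceScaling.Negative.R54D
  (constant_rate_not_hb_small coreDefectRecord_rate_not_hb_small core_not_subset_recordSupport)

end R54D

-- `section CycleFortyThreeChecks` (re-export `example`s of R54/R54B/R54C/R54D — the (C4) window ledger, cycle 43, §BA — compiled rev 58–59c, last at crux write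
-- 2f4e1b86c4b7) moved VERBATIM to `DisproofAnnexD.md` §P11d at rev 60 (size cap; examples-only policy, oldest-large first); the `namespace R54…R54D` re-exports stay above.

/-! ## (BB) Cycle 44: `hcore` puts an ACTION FLOOR under the slow window — the core contains the one-site cross configuration `(a_φ, b_φ, 1)` (`orbitDist < R`, `S ≥ R⁴/64`);
## any action ceiling of `𝒰_β` is `≥ L³(13(L³β)^{-1/5})⁴/64` (and `12·13⁴L³(L³β)^{-4/5}` suffices, (vii)), the magnetic exponent `(L³β/2)S` is unbounded on the core, band `1/3 < q ≤ 4/5`;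
## file `Negative/CoreWindowActionFloor.lean` (p710969, `…Negative.R55`). [folklore] -/

namespace R55

export Summit.QuantumFields.YangMills.Theorems.TwistedTraceScaling.Negative.R55
  (scalarPart_of_su2Quat_eq twoLinkCfg_apply frobNorm_sub_one_le_of_scalarPart orbitDist_twoLinkCfg_le plaqTerm_twoLinkCfg_eq plaqTerm_nonneg
    four_mul_sin_pow_le_wilsonAction_twoLinkCfg three_quarters_mul_le_sin core_witness exists_core_config action_floor_of_hcore magnetic_exponent_identity
    core_magnetic_exponent_ge core_magnetic_exponent_unbounded coreRadius_pow_four floorConst_pos action_exponent_le_of_hcore floor_le_of_exponent_lt)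

end R55

/-! ## (BB') Cycle 44 (cont.): the converse — exponent windows `p < 1/5`, `q < 4/5` CONTAIN the core (`BOBricks.hcore` discharged for lane A's design `p = s ∈ (1/6,1/5)`, `q = 2s`),
## `hcore` caps the input exponent at `1/5`, and the core's action scale is two-sided `L³R⁴/64 ≤ sup L³S ≤ 12L³R⁴`; the (C4) box is an IFF: `1/6 < p ≤ 1/5`, `1/3 < q ≤ 4/5`;
## file `Negative/CoreWindowSufficiency.lean` (p713177, `…Negative.R55B`). [folklore] -/

namespace R55B

export Summit.QuantumFields.YangMills.Theorems.TwistedTraceScaling.Negative.R55B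
  (window_of_orbitDist_lt coreRadius_eventually_pos_le_three core_action_two_sided coreRadius_le_of_exponent_lt coreActionCeiling_le_of_exponent_lt
    hcore_of_exponents hcore_of_exponents_crit input_exponent_le_of_hcore)

end R55B

-- `section CycleFortyFourChecksB` + `section CycleFortyFourChecks` (re-export checks of R55/R55B, cycle 44, §BB) moved VERBATIM to Annex D §P11f at rev 61 (compiled rev 59–60b, last at crux write b08014fe748a).

/-! ## (BC) Cycle 45: STIFF SEPARATION is TRUE — the `[u_k − 1, ξ]` cross term is a constant mode (killed by `P_s`, `P_Γ`) plus an `O(τ)` leak against its OWN gauge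
## component; linearised separation `(1−κ)‖P_s y‖² − (4κ/3)‖P_Γ y‖² ≤ ‖y + w‖²` (file `Negative/StiffSeparationLeak.lean`, p718648, `…Negative.R56`); the L = 2 pure-gauge
## witnesses of zero defect force slack `≥ c‖x'‖⁴/8192` — (d) gauge-near only (`Negative/StiffSeparationPureGauge.lean`, p718930, `…Negative.R56B`); lane A's
## `core_defect_currency`: window OPEN `(1/6,1/5)` with the record `K = 43`, `b_core ≥ √8·max(η_c, κ_P, E)` (`Negative/ShadowWindowCurrencyFloor.lean`, p719499, `…Negative.R57`). [folklore] -/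

namespace R56

export Summit.QuantumFields.YangMills.Theorems.TwistedTraceScaling.Negative.R56
  (norm_covCurl_one_sq_le_stiffProj stiffProj_ne_zero_of_covCurl_ne_zero covGradL_const_mem_constModes stiffProj_covGradL_const gaugeProj_covGradL_const
   stiffProj_covGradL_eq norm_stiffProj_covGradL_le norm_stiffProj_covGradL_le_gaugeProj norm_sq_ge_stiffProj_add_gaugeProj norm_add_sq_ge_young
   linearised_stiff_separation)

end R56

namespace R56B

export Summit.QuantumFields.YangMills.Theorems.TwistedTraceScaling.Negative.R56B
  (kinDefect_gaugeTransform_self pureGauge_mem_balancedSet_two witness_mem_capBalancedSet witness_orthoTube_eq witness_kinDefect_eq_zero witness_wilsonAction_eq_zero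
   witness_norm_sq witness_curl_component witness_stiffProj_sq_ge not_slackFree_stiffSeparation_two slack_ge_of_stiffSeparation_two exists_pureGauge_witness_two)

end R56B

namespace R57

export Summit.QuantumFields.YangMills.Theorems.TwistedTraceScaling.Negative.R57
  (fortythree_lt_coreConst record_K_gt_of_hcore_fifth record_no_shadowWindow_fifth shadowWindow_not_hcore_fifth shadowWindow_hcore_of_lt_fifth
   actionWindow_of_radius_without_div currency_ge_rate currency_ge_kappaP currency_ge_exponent currency_not_hb_small_of_rate_le_sixth currency_rate_fifth_affordable
   currency_not_hb_small_of_input_radius)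

end R57

-- `section CycleFortyFiveChecks` (re-export checks of cycle 45 (§BC: stiff separation is true, R56/R56B) moved VERBATIM to Annex E §P13h at rev 66; compiled through rev 65, last at crux write f29c925d1729).

/-! ## (BD) Cycle 46: the FROZEN record profile has an INTRINSIC (B-OD) floor — two-level algebra `K Ω ν' = cos θ sin θ (Λν − Λ₀)`, Gaussian tilt FIRST ORDER in the width change,
## dispersion shift `2 sin p` (`L = 2`: none; `L ≥ 3`: first order) ⇒ `b ≳ powScale s β`, `hb_small ⟺ s > 1/6` from (B-OD) alone (file `Negative/FrozenProfileOffDiagFloor.lean`,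
## p721474, `…Negative.R58`); lane A g20's (C5) pieces (`…BODefectSplit/ShellB/TailPiece`, `…BOBtCPolyFloor`, `…BODefectCoreRecord/CoreCurrency`) vetted TRUE. [folklore] -/

namespace R58

export Summit.QuantumFields.YangMills.Theorems.TwistedTraceScaling.Negative.R58
  (twoLevel_offDiag_eq twoLevel_offDiag_abs_ge rotated_pair_orthonormal offDiag_floor_of_bound sqrt_deficit_le_tilt offDiag_floor_of_deficit integral_gaussian_mul
   integral_gaussian_sq sqrt_pi_div_mul gaussian_cosSq_eq cosSq_aux one_sub_gaussian_cosSq_bounds prod_le_factor one_sub_prod_ge dispersion_hasDerivAt firstOrder_shift_L2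
   firstOrder_shift_L3 firstOrder_shift_pos frozenProfile_offDiag_floor_eventually frozenProfile_not_hb_small firstOrder_floor_affordable)

end R58

-- `section CycleFortySixChecks` (re-export checks of cycle 46 (§BD: the frozen profile's intrinsic (B-OD) floor, R58) moved VERBATIM to Annex E §P13i at rev 66; compiled through rev 65, last at crux write f29c925d1729).

/-! ## (BE) Cycle 47: lane A's last (C5) hypothesis `hsep` (outer piece `I_out`) is discharged by the MAGNETIC factor — `K̃_β(U,V) ≤ e^{2β|E|}e^{−(β/2)S(U)}` for every `V`,
## `S(orthoTube u x) ≥ (gap/16)‖linkEmbed x‖²` on the outer gauge-near tube, `K_sep = e^{2β|E|}exp(−(β/2)(gap/16)R₀²)` for EVERY `s > 0` (file `Negative/OutPieceMagneticBound.lean`,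
## p723950, `…Negative.R59`); the kinetic (SEP) card S1–S9 is true but not load-bearing; lane A g20's `…BODefectTailSchedule/OutSchur/OutPiece/StiffSep*` vetted TRUE. [folklore] -/

namespace R59

export Summit.QuantumFields.YangMills.Theorems.TwistedTraceScaling.Negative.R59
  (avgKernel_le_magnetic avgKernel_le_of_wilsonAction_ge abs_entry_le_norm_linkEmbed sqrt_gap_mul_le_norm_covCurl_one norm_linkEmbed_le_of_entry_le wilsonAction_orthoTube_ge_sq
   hsep_of_magnetic sqrt_powScale_two_mul abs_entry_le_of_links eventually_hsep_magnetic)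

end R59

-- `section CycleFortySevenChecks` (re-export checks of cycle 47 (§BE: `hsep` discharged by the magnetic factor, R59) moved VERBATIM to Annex E §P13j at rev 66; compiled through rev 65, last at crux write f29c925d1729).

/-! ## (BF) Cycle 48: the stiff constant of (B-ST) has a CEILING — lane A's Mehler gap is SHARP at `ρ = max_k r_k` (`R60.mehlerGap_iff`), so `θ₀ ≤ 1 − mehlerRatio g₀(L) ≤
## 2π/L + (2π/L)²` (`R60.stiffGap_le_vacuum`); NO `L`-uniform stiff constant (`R60.no_uniform_stiffGap`), `θ₀ = 1/2` fails for `L ≥ 9` (file `Negative/StiffGapCeiling.lean`, p727486,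
## `…Negative.R60`); (B-ST) as designed (fixed `L`, `θ_S < 1 − r(g₀(L))`) passes the gauge-sector, stiff-sector and slow-point probes — no kill; lane A g20's `…BOStiffSepRecord`,
## `…BODefectTailSchedule` vetted TRUE. [folklore] -/

namespace R60

export Summit.QuantumFields.YangMills.Theorems.TwistedTraceScaling.Negative.R60
  (prod_pow_single single_one_ne_zero hermCoeff_hR_single_zero integral_hR_sq mehlerForm_hR_single data_pos mehlerGap_fails_below mehlerGap_orth_fails_below
   mehlerGap_iff stiffGap_le stiffGap_le_one_sub_mehlerRatio one_sub_mehlerRatio_le vacuumStiff_le vacuumStiff_nonneg one_sub_mehlerRatio_vacuum_le stiffGap_le_vacuum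
   threshold_lt no_uniform_stiffGap mehlerRatio_gt_half vacuumStiff_lt_half stiffGap_half_fails)

end R60

-- `section CycleFortyEightChecks` (re-export checks of cycle 48 (§BF: the stiff constant's ceiling, R60) moved VERBATIM to Annex E §P13k at rev 66; compiled through rev 65, last at crux write f29c925d1729).

/-! ## (BG) Cycle 49: lane A's TENSOR gap (`…MehlerTensorGap.abs_tensorForm_sub_slow_le`, the model of (B-T)+(B-ST)+(B-OD)) is SHARP, ATTAINED and Hermite block-diagonal
## (blocks `λ_α·k`, `R61.tensorForm_hermiteBlock`; `R61.tensorGap_attained`); its admissible constants are the fibre's (`R61.tensorGap_iff`, `R61.tensorStiff_iff`), so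
## `θ₀ ≤ 2π/L + (2π/L)²`, no `L`-uniform tensor stiff constant, `θ₀ = 1/2` dead for `L ≥ 9` (file `Negative/TensorGapCeiling.lean`, p729832, `…Negative.R61`); the model is
## silent on (B-OD)'s `b` (off-diagonal blocks vanish); lane A g20's `…BOStiffSepConditions/Eventually/Hsep` (p728073/p728688/p729052) vetted TRUE, ✓p729582/p729638 `…BOCurrencyFloor`/
## `…BODefectRates` vetted TRUE (`EK²` with polynomial loss) — no kill; R61B (p734904, `Negative/BOStiffBlockCeiling.lean`) = the same ceiling in lane A's BO currency
## (`boStiff_iff`, `no_uniform_boStiff`). [folklore] -/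

namespace R61

export Summit.QuantumFields.YangMills.Theorems.TwistedTraceScaling.Negative.R61
  (slowCoeff_tensor fibreSq_tensor orthSq_tensor mehlerForm_tensor slowCoeff_exc fibreSq_exc orthSq_exc integral_tensor_sq integral_exc_sq
   integral_sq_eq_integral_fibreSq tensorForm_tensor tensorForm_hermiteBlock tensorForm_groundBlock tensorForm_excBlock tensorGap_necessary tensorGap_fails_below
   tensorGap_iff tensorGap_attained fibreStiff_of_tensorStiff tensorStiff_le tensorStiff_of_le tensorStiff_iff tensorStiff_le_vacuum no_uniform_tensorStiff
   tensorStiff_half_fails)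

end R61

namespace R61B

export Summit.QuantumFields.YangMills.Theorems.TwistedTraceScaling.Negative.R61B
  (boProj_eq_zero boOrth_eq_self tensorStiff_of_boStiff boStiff_le boStiff_of_le boStiff_iff boStiff_ge_vacuum no_uniform_boStiff boStiff_half_fails)

end R61B

-- `section CycleFortyNineChecks` (re-export checks of cycle 49 (§BG: the tensor gap is sharp and attained, R61/R61B) moved VERBATIM to Annex E §P13l at rev 66; compiled through rev 65, last at crux write f29c925d1729).

/-! ## (BH) Cycle 50: the (B-ST) DOOR of lane A's Poincaré route (`…BOStiffDoor.form_le_of_quasimode_of_comparison`, ✓p735077) has a GAIN CEILING — its comparison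
## constants are linked, `(1−δ)c_J ≤ (1+η)C_ν` (`R62.cJ_le_of_quasimode_of_comparison_at`), so `θ_door = c_J/(C_νP₀) ≤ (1+η)(1−ρ)/(1−δ)` (`R62.doorGain_le_flatRate`) and the
## door certifies at best the second stiff level `ρΛ` (`R62.doorCoefficient_ge`): the R60/R61/R61B ceiling from the METHOD side, model-free (file `Negative/BOStiffDoorGainCeiling.lean`,
## p736323, `…Negative.R62`); lane A's (OD) pen (✓p732447/p733326/p733626: `hdef_fixed`, `hOD_record`, `recordAnalyticInput_of_hST`) and (B-ST) files ✓p735077/p735536/p735712/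
## p735832 (door, colour Cauchy–Schwarz, Mehler Poincaré, PF-lite slow top) vetted SOUND — no kill. [folklore] -/

namespace R62

export Summit.QuantumFields.YangMills.Theorems.TwistedTraceScaling.Negative.R62
  (cJ_le_of_quasimode_of_comparison_at doorGain_le doorGain_le_flatRate doorCoefficient_ge doorGain_le_one_add doorGain_le_flatRate_of_comparison)

end R62

-- `section CycleFiftyChecks` (re-export checks of cycle 50 (§BH: the door's gain ceiling, R62) moved VERBATIM to Annex E §P13m at rev 67; compiled through rev 66b, last at crux write 6ecbc92f0a39).

/-! ## (BI) Cycle 51: the (B-ST) door's flat brick (P) is a CENSORED Poincaré inequality (`(J)` forces `J₀ ≤ 0` off `{Θ>0}²`) — NOT inherited from the global Mehler/tensor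
## inequality with any constant (`R63.censored_poincare_not_inherited`: three-point path); what is inherited is the KILLED TRANSFER `Var_S ≤ P₀(½E_T + ∫_S g²κ_T)`
## (`R63.jumpForm_eq_censored_add_killing`, `R63.killed_transfer`, door-v2 shape `R63.killed_transfer_door`: `+ P₀ε∫_S g²D`, a mass term that cannot be absorbed into `P₀` —
## `R63.path_killed_eq`; for `P₀ε < 1` ≡ constant `P₀/(1−P₀ε)` + mean slack, `R63.killed_transfer_meanForm`; void at `P₀ε = 1`, `R63.path_meanSlack_fails`), i.e. a THIRD
## slack `ε ∼ e^{−cℓ²}` next to `η`, `δ` of R62 (file `Negative/CensoredPoincareKilling.lean`, p737762/p738091/✓p738248, `…Negative.R63`); lane A g21's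
## ✓p736996/p736179/p736399 (fibre bilinear bound, tensor Poincaré, fibre PSD) vetted SOUND — no kill. [folklore] -/

namespace R63

export Summit.QuantumFields.YangMills.Theorems.TwistedTraceScaling.Negative.R63
  (jumpIntegrand_bdd killingDensity_bdd jumpForm_eq_censored_add_killing censoredForm_eq setVariance_le_variance killed_transfer killed_transfer_door
   killed_transfer_meanForm setIntegral_ends setIntegral_ends_compl path_poincare path_censored_fails path_killed_eq path_meanSlack_fails censored_poincare_not_inherited)

end R63

-- `section CycleFiftyOneChecks` (re-export checks of cycle 51 (§BI: (P) is censored; the killed transfer, R63) moved VERBATIM to Annex E §P13n at rev 67; compiled through rev 66b, last at crux write 6ecbc92f0a39).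

/-! ## (BJ) Cycle 52: the based WINDOW LEMMA of the (B-ST) pen's gauge-far recipe ((S6′), HANDOFF-g21 UPDATE 19:05Z) is FALSE AS AN INCLUSION — the winding function is a
## BASED gauge transformation (`R64.basedExt_winding`), so the based orbit of the vacuum (a support point, `recordChi 1̄ = 1`) contains R29's pure-gauge copy
## `constLift(diagSU2(−2π/L),1,1)` with `gaugeCoordSq = 0` OUTSIDE `nearOne ρ`, `ρ ≤ 2√(1−cos 2π/L)` (`R64.based_window_not_subset`, `R64.based_window_containment_eventually_fails`),
## on a set of POSITIVE based-Haar mass (`R64.basedMeasure_window_diff_nearOne_pos`, `R64.basedMeasure_bulk_off_support_eventually_pos`, via the continuous majorant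
## `R64.gaugeCoordSq_le_defect`); based windows hold in MASS form only (file `Negative/BasedWindowIslands.lean`, p740399, `…Negative.R64`); lane A's ✓p739431 Assembly, ✓p739461
## TailCurrency, W1-1/W1-2 (two-width sandwich — does not use the inclusion), ✓p739749 BasedForm vetted SOUND — no kill. [folklore] -/

namespace R64

export Summit.QuantumFields.YangMills.Theorems.TwistedTraceScaling.Negative.R64
  (basedExt_winding vacuum_basedCopy gaugeCoordSq_vacuum_basedCopy vacuum_basedCopy_not_mem_nearOne gaugeCoordSq_one one_mem_nearOne recordChi_one
   based_window_not_subset based_window_containment_eventually_fails gaugeCoordSq_le_sum one_sub_sq_le gaugeCoordSq_le_defect continuous_norm_dirQuat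
   norm_dirQuat_constLift continuous_based_vacuum isOpen_island winding_mem_island basedMeasure_island_pos basedMeasure_window_diff_nearOne_pos
   basedMeasure_bulk_off_support_eventually_pos)

end R64

-- `section CycleFiftyTwoChecks` (re-export checks of cycle 52 (§BJ: based windows in mass form only, R64) moved VERBATIM to Annex E §P13o at rev 68; compiled through rev 67, last at crux write e3e853734212).

/-! ## (BK) Cycle 53: the (F) CURRENCY of the (B-ST) pen carries NO normalisation slack — at the vacuum slow datum the Faddeev–Popov localisation is EXACT
## (`R65.fpBOKernel_fpWeight_one_one`: `fpBOKernel β Ω (fpWeight ε) 1 1 = fpZ ε·boKernel β Ω 1 1`, every `ε`), `btC·K₁(1,1) + fpBOKernel(tailWeight)(1,1) = fpZ·boKernel(1,1)`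
## (`R65.btC_mul_oneSite_add_tail`), `btC/fpZ ≤ boKernel(1,1)/K₁(1,1)` (`R65.btC_div_fpZ_le`, deficit = the FP tail cut exactly, `R65.boRayleigh_sub_btC_div_fpZ`), and for the literal
## `hST` data `Λ_rec ≤ (boKernel β Ω_c 1 1/K₁(1,1)/γ)·λ₀(L³β)` (`R65.recordCurrency_le_boRayleigh`): the target constant is the sharp `u = 1` BO Rayleigh numerator — every `θ₀` must be a
## true fibre gap (file `Negative/RecordCurrencyNoSlack.lean`, p742106, `…Negative.R65`); lane A's ✓p741268 CoreCoeff, ✓CurrencyAlg, ✓MassRatioSharp, ✓FarPairs vetted SOUND — no kill.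
## [cite: Luscher1983, §3] -/

namespace R65

export Summit.QuantumFields.YangMills.Theorems.TwistedTraceScaling.Negative.R65
  (fpBOKernel_fpWeight_one_one btC_mul_oneSite_add_tail btC_mul_oneSite_le btC_div_fpZ_le boRayleigh_sub_btC_div_fpZ recordCurrency_le_boRayleigh)

end R65

-- `section CycleFiftyThreeChecks` (re-export checks of cycle 53 (§BK: the (F) currency carries no normalisation slack, R65) moved VERBATIM to Annex E §P13p at rev 69; compiled through rev 68, last at crux write f958a8950f28).

/-! ## (BL) Cycle 54: the door's `hflat` is a CONDUCTANCE FLOOR and the central support `cS` is GAUGE-WIDE — the (B4) jump kernel `J₀` must reach every gauge offset of `cS`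
## (`R66.conductance_floor`: `(c_JΛ/P₀)(D(A)(1−δ) − D(A)²/D(S)) ≤ ½∫∫(𝟙_A x − 𝟙_A y)²ΘMΘ`, `R66.half_jump_indicator_eq`: `= ∫_A∫_{Aᶜ}ΘMΘ`; `R66.door_false_of_isolated`: `J₀ ≤ 0` across a
## cut carrying `D`-mass `< (1−δ)D(S)` ⇒ the door hypotheses are contradictory; `R66.exists_mem_cS_pureGauge`: `cS L β ∋` pure-gauge points of every radius `≤ r(β)`, `cΘ = e^{−R²/β^{-2}}`
## there; `R66.floor_le_gauge_value`; `R66.central_conductance_floor` for the literal `cS, cΘ, cM, cΛ`) — file `Negative/DoorConductanceFloor.lean`, p746016, `…Negative.R66`; lane A's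
## 14 landings (Defs … CentralDensity) and lead g22's (B4) DESIGN (based ball centred at the gauge peak: full gauge reach — it MEETS R66) vetted SOUND — no kill. [cite: Luscher1983, §3] -/

namespace R66

export Summit.QuantumFields.YangMills.Theorems.TwistedTraceScaling.Negative.R66
  (flat_indicator door_false_of_isolated conductance_floor half_jump_indicator_eq stiffGaussExp_eq_zero_of_mem_gaugeModes exists_mem_cS_pureGauge
    cΘ_gauge_floor_attained floor_le_gauge_value central_conductance_floor)

end R66

-- `section CycleFiftyFourChecks` (re-export checks of cycle 54 (§BL: the door's `hflat` is a conductance floor, `cS` is gauge-wide, R66) moved VERBATIM to Annex F §P13q at rev 70; compiled through rev 69, last at crux write c784a1186ffc).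

/-! ## (BM) Cycle 55: QUASIMODE PROFILE RIGIDITY — (A)'s pointwise `hup ∀η` / w1's model atom (Q±) ∀σ pin the Gaussian exponent of the profile EXACTLY
## (one-mode Mehler model `k = e^{−ax²}e^{−b(x−y)²}e^{−ay²}`, `f_c = e^{−cy²}`: `R67.mehler_gaussian_action_ratio` — `(Kf_c)(x) = √(π/(a+b+c))·e^{κx²}f_c(x)`,
## `κ = (c²−a²−2ab)/(a+b+c)`; `R67.quasimode_fails_of_stiff(_truncated)` — too stiff ⇒ no constant works, also at the EDGE of a truncated support ball;
## `R67.selfRayleigh_fails_of_soft` — too soft ⇒ fails at the centre vs the self-Rayleigh currency; `R68.twoSided_pinch` — (Q+)∧(Q−) on `[−R,R]` ⇒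
## `|κ|R² ≤ log((1+σ)/(1−σ))`; `R68.exponent_exact_of_twoSided` — ∀σ ⇒ `c² = a²+2ab`; `R67.mehler_gaussian_exact`/`R68.twoSided_of_exact` — the converse) — files
## `Negative/QuasimodeProfileRigidity.lean` (p747692, `…Negative.R67`) and `Negative/TwoSidedQuasimodePinch.lean` (p747918, `…Negative.R68`); the lead's `stiffGaussExp L (β/2) β`
## IS `c_*` mode by mode (rigidity met by design); lane A's twins `cM_lower`/`cM_upper`, Core/HST bookkeeping, w1's QuasimodeFrame/Ring vetted SOUND — no kill. [cite: Wipf2021, §8.5.2] -/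

namespace R67

export Summit.QuantumFields.YangMills.Theorems.TwistedTraceScaling.Negative.R67
  (integral_gaussian_shift mehler_gaussian_action mehler_gaussian_action_ratio mehler_gaussian_exact quasimode_fails_of_stiff gaussian_tail_one
    truncated_action_edge_lower quasimode_fails_of_stiff_truncated selfRayleigh_fails_of_soft mehlerRatio_eq_inv_denominator)

end R67

namespace R68

export Summit.QuantumFields.YangMills.Theorems.TwistedTraceScaling.Negative.R68
  (ratio_pinch twoSided_pinch exponent_exact_of_twoSided twoSided_of_exact)

end R68

-- `section CycleFiftyFiveChecks` (re-export checks of cycle 55 (§BM: the profile exponent of (A)/(Q±) is rigid, R67/R68) moved VERBATIM to Annex F §P13r at rev 72; compiled through rev 71, last at crux write c24f31e4a125).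

/-! ## (BN) Cycle 56: A FLAT TRANSVERSE MODE KILLS `hflat` — Hodge (`ker d ⊆ const ⊔ gauge`) + coercivity and the gauge block as RESAMPLING are LOAD-BEARING for the one
## remaining hypothesis of ✓`spec_gap_inputs_of_hflat` (the `a = 0` Mehler member — constant ground state `R69.flat_groundState_const`, contraction `1` — has censored Poincaré
## constant `≥ (1−δ)·e·b·R/3` on the window `[−R,R]` for EVERY slack `δ < 1`: `R69.poincare_constant_ge_of_flat`, `R69.flat_poincare_fails`,
## `R69.flat_poincare_eventually_fails`; no window-uniform constant in the `hflat` currency, not even `P₀ = P₀(δ)`: `R69.no_windowUniform_flat_poincare`,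
## `R69.no_flat_poincare_of_slack`; CONTRAST `R69.resampling_poincare_eq` — the resampling kernel `D⊗D/∫D` has jump form EQUAL to the variance, constant `1`, no slack) — file
## `Negative/FlatModePoincareFailure.lean` (p749380, `…Negative.R69`); w3's ✓`flat_poincare` carries `∀k, 0 < a_k`, `ρ < 1` as hypotheses — their discharge on `balancedSet` IS
## ✓`…VacuumHodge.ker_covCurl_one_le` + `(2−2cos(2π/L))`-coercivity; lane A's GapInputs/FlatTensor/BoxBallExit/PiTransport(+Kernel)/SmearEstimate/FlatPoincare vetted SOUND —
## no kill. [cite: FukushimaOshimaTakeda2011, §4.4] -/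

namespace R69

export Summit.QuantumFields.YangMills.Theorems.TwistedTraceScaling.Negative.R69
  (flat_groundState_const flat_contraction_eq_one integral_Icc_const integral_Icc_id integral_Icc_sq sq_mul_exp_neg_le jumpRow_flat_le jumpForm_flat_le
    poincare_constant_ge_of_flat flat_poincare_fails flat_poincare_eventually_fails no_flat_poincare_of_slack no_windowUniform_flat_poincare
    integrable_of_abs_le resampling_poincare_eq resampling_poincare_le)

end R69

section CycleFiftySixChecks
open MeasureTheory Set Filter

/-- §BN (i) ★ (`R69.flat_groundState_const`): in a flat transverse direction (`a = c_* = 0`) the constant IS the exact ground state of the kinetic kernel, level `√(π/b)`. -/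
example {b : ℝ} (hb : 0 < b) (x : ℝ) : ∫ y, Real.exp (-(b * (x - y) ^ 2)) = Real.sqrt (Real.pi / b) :=
  R69.flat_groundState_const hb x

/-- §BN (ii) ★★ (`R69.jumpForm_flat_le`): the censored jump form of the linear test function is `O(R²)` — `u²e^{−bu²} ≤ 1/(e b)` however far the jump. -/
example {b c R : ℝ} (hb : 0 < b) (hc : 0 ≤ c) (hR : 0 ≤ R) :
    ∫ x in Icc (-R) R, ∫ y in Icc (-R) R, (x - y) ^ 2 * (c * Real.exp (-(b * (x - y) ^ 2))) ≤ (2 * R) ^ 2 * (c * (Real.exp (-1) / b)) :=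
  R69.jumpForm_flat_le hb hc hR

/-- §BN (iii) ★★★ (`R69.poincare_constant_ge_of_flat`): the `hflat`-shaped censored inequality for a flat mode (constant weight `d`, jump `c·e^{−b(x−y)²}`, ANY slack `δ`)
forces `(1−δ)·d·e·b·R ≤ 3c·P₀` — the constant grows with the window. -/
example {b d c P₀ δ R : ℝ} (hb : 0 < b) (hc : 0 < c) (hP : 0 ≤ P₀) (hR : 0 < R)
    (h : (∫ x in Icc (-R) R, x ^ 2 * d) - (∫ x in Icc (-R) R, x * d) ^ 2 / (∫ _x in Icc (-R) R, d) ≤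
        P₀ * ((1 / 2) * ∫ x in Icc (-R) R, ∫ y in Icc (-R) R, (x - y) ^ 2 * (c * Real.exp (-(b * (x - y) ^ 2)))) +
          δ * ∫ x in Icc (-R) R, x ^ 2 * d) :
    (1 - δ) * d * (Real.exp 1 * b) * R ≤ 3 * c * P₀ :=
  R69.poincare_constant_ge_of_flat hb hc hP hR h

/-- §BN (iv) ★★ (`R69.flat_poincare_eventually_fails`): for every slack `δ < 1` and every `P₀ ≥ 0` the flat inequality FAILS on all large windows (`R ≍ btLog β → ∞` on `cS`). -/
example {b d c P₀ δ : ℝ} (hb : 0 < b) (hd : 0 < d) (hc : 0 < c) (hP : 0 ≤ P₀) (hδ : δ < 1) :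
    ∀ᶠ R : ℝ in atTop, ¬ ((∫ x in Icc (-R) R, x ^ 2 * d) - (∫ x in Icc (-R) R, x * d) ^ 2 / (∫ _x in Icc (-R) R, d) ≤
        P₀ * ((1 / 2) * ∫ x in Icc (-R) R, ∫ y in Icc (-R) R, (x - y) ^ 2 * (c * Real.exp (-(b * (x - y) ^ 2)))) +
          δ * ∫ x in Icc (-R) R, x ^ 2 * d) :=
  R69.flat_poincare_eventually_fails hb hd hc hP hδ

/-- §BN (v) ★★ (`R69.no_windowUniform_flat_poincare`): in the `hflat` currency `∃P₀ ∀δ>0 ∀ᶠ(window)` a flat mode admits NO constant. -/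
example {b d c : ℝ} (hb : 0 < b) (hd : 0 < d) (hc : 0 < c) :
    ¬ ∃ P₀ : ℝ, 0 < P₀ ∧ ∀ δ : ℝ, 0 < δ → ∀ᶠ R : ℝ in atTop,
      (∫ x in Icc (-R) R, x ^ 2 * d) - (∫ x in Icc (-R) R, x * d) ^ 2 / (∫ _x in Icc (-R) R, d) ≤
        P₀ * ((1 / 2) * ∫ x in Icc (-R) R, ∫ y in Icc (-R) R, (x - y) ^ 2 * (c * Real.exp (-(b * (x - y) ^ 2)))) +
          δ * ∫ x in Icc (-R) R, x ^ 2 * d :=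
  R69.no_windowUniform_flat_poincare hb hd hc

/-- §BN (vi) ★ (`R69.resampling_poincare_eq`): CONTRAST — the resampling kernel `D⊗D/∫D` (the gauge block of `cJ0`) has jump form EQUAL to the variance: constant `1`, no slack. -/
example {X : Type*} [MeasurableSpace X] {μ : Measure X} [IsFiniteMeasure μ] {g D : X → ℝ} {Cg CD : ℝ} (hg : Measurable g) (hgb : ∀ x, |g x| ≤ Cg)
    (hD : Measurable D) (hDb : ∀ x, |D x| ≤ CD) (hM : ∫ z, D z ∂μ ≠ 0) :
    (1 / 2) * ∫ x, ∫ y, (g x - g y) ^ 2 * (D x * D y / ∫ z, D z ∂μ) ∂μ ∂μ =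
      (∫ x, g x ^ 2 * D x ∂μ) - (∫ x, g x * D x ∂μ) ^ 2 / ∫ z, D z ∂μ :=
  R69.resampling_poincare_eq hg hgb hD hDb hM

end CycleFiftySixChecks

/-! ## (BO) Cycle 57: the POINTWISE-CELL route to the C4-SHELL gain needs a LINEAR one-site gain on the inner annulus `β^{−s}/2 ≤ t ≤ β^{−7/45}` of the record shell —
## a frozen-Gaussian cell of radius `β^{−ρ}` on the layer `S < 2β^{−q}` beats a gain `β^{−g}` for some `ρ` iff `g < (2q−1)/3` (`R70.cell_exponents_gain_iff`); with the tree's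
## `t√t/40` (`g = 3s'/2`) the record layer `q = 17/20` covers only `s' < 7/45` (`R70.threeHalves_cells_fail_inner_annulus`; no admissible `q < 8/9` beyond `14/81`,
## `R70.no_layer_rescues_threeHalves`), with a LINEAR gain `s' < 7/30 ⊃ (1/40, 1/5]` (`R70.linear_cells_cover_record_shell`) — file `Negative/ShellCellLinearGainWindow.lean`
## (p755300, `…Negative.R70`); ✓`…C4CoreRecord` (four currencies) and w1's LOCATE memo vetted SOUND; g23's thin-shell rule is `g(a) < 2b` — no kill.
## [cite: Luscher1983, §3] [cite: VanbaalKoller1987, §4] -/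

namespace R70

export Summit.QuantumFields.YangMills.Theorems.TwistedTraceScaling.Negative.R70
  (cell_exponents_gain_iff cell_rho_window_iff cell_costs_eventually_gain_iff cell_exponents_linear_iff threeHalves_gain_le_linear record_windows
    linear_cells_cover_record_shell linear_record_rho_window_iff linear_record_core_fifth threeHalves_cells_cover_outer threeHalves_cells_fail_inner_annulus
    threeHalves_inner_annulus_eventually_fails linear_record_eventually inner_annulus_width threeHalves_cap_iff linear_cap_iff exponent_chain
    no_layer_rescues_threeHalves layer_rescues_threeHalves_iff every_layer_admits_linear razor_tuple_admissible razor_window hybrid_ledger)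

end R70

-- `section CycleFiftySevenChecks` (re-export `example`s of cycle 57) moved VERBATIM to Annex G §P13s at rev 78; compiled through rev 77b, last at crux write a25ce8372810.

/-! ## (BO2) Cycle 57b: lane A's THIN-SHELL design (card `Lines-shell-gain.md`; ✓`…ShellOneOrbit`, ✓`…OneSiteAnnulusGain`, ✓`…ShellAssemblyFixed`) vetted SOUND at the exponent
## level — per-shell DOMINATION window `3a/2 < min(2b, 2/5)` ∧ `a < 1/5` (`R71.domination_window_iff`; the cap `4/15` from the central quasimode's fixed rate `β^{−1/5}`, automatic
## below the one-site threshold), chain arithmetic (`R71.chain_lower_bound`, `(4/3)⁷/40 = 2048/10935`, the card's 8-chain certified `R71.record_chain_certificate`); the `1/6 < s`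
## census of the record cone (leaves: Feshbach smallness + kinetic SEP only) ⇒ hand H1 unnecessary (R59 `eventually_hsep_magnetic`, every `s > 0`) — file
## `Negative/ShellDominationWindow.lean` (p756385, `…Negative.R71`); no kill. [cite: Luscher1983, §3] [cite: VanbaalKoller1987, §4] -/

namespace R71

export Summit.QuantumFields.YangMills.Theorems.TwistedTraceScaling.Negative.R71
  (domination_scales_iff thin_shell_rule_iff quasimode_cap_iff domination_window_iff domination_sum_iff quasimode_cap_of_lt_fifth oneSite_threshold_iff
    linear_rate_rule_iff chain_lower_bound seven_chain_threshold no_seven_chain no_seven_chain_record record_chain_certificate record_chain_exists seven_chain_example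
    shell_ledger)

end R71

-- `section CycleFiftySevenBChecks` (re-export `example`s of cycle 57b) moved VERBATIM to Annex G §P13t at rev 78; compiled through rev 77b, last at crux write a25ce8372810.

/-! ## (BP) Cycle 58: lead g23's NEW 9-shell chain `19/100 → 17/100 → 13/100 → 1/10 → 77/1000 → 59/1000 → 45/1000 → 34/1000 → 26/1000 → 1/40` (fleet INBOX 02:41Z) certified in
## R71's exponent currency — ratios `< 4/3`, domination margins `2b − 3a/2 > 0`, exponents in `(0, 1/5)`, outer exponents `< 1/3`; lane A's ✓`…ShellAssembly`/✓`…RecordSmallProfile`/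
## ✓`…ShellRecordInner` and w1's H3/H2-part-1–2 files vetted SOUND; no module, no kill. [cite: Luscher1983, §3] [cite: VanbaalKoller1987, §4] -/

-- `section CycleFiftyEightChecks` (prose + `norm_num` `example`s of cycle 58) moved VERBATIM to Annex G §P13u at rev 79; compiled through rev 78b, last at crux write 28d9eda20431.

/-! ## (BQ) Cycle 59: guards on the WINDOW FLOOR W(L₁) of S-BASE(L₁) — `g 0 = 0` forced, the COUNTING form `N_β(E) ≤ #{k : g_k < E} ≤ e^{tE}Σ'e^{−tg}` (`E ≤ c₁ log β`), the
## trial-state form (R6), the squeeze `g_k ≤ Δ_k + ε` against COARSE-LOWER, and: the `∀ A, ∃ β0` gain texts carry no rate — file `Negative/WindowFloorGuards.lean` (p758672,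
## `…Negative.R72`); lane A's COARSE-UPPER(L) endgame (✓`…ShellChain`, ✓`…ShellRecordLow`, w1 ✓`…BODefectHODLow`) vetted SOUND, the eight `record_low` instances certified; no kill.
## [cite: ReedSimonIV1978, Thm. XIII.1] -/

namespace R72

export Summit.QuantumFields.YangMills.Theorems.TwistedTraceScaling.Negative.R72
  (lt_of_windowShape card_le_exp_mul_tsum windowFloor_g_zero windowFloor_lt_of_level windowFloor_count windowFloor_caps_families
    windowFloor_g_le_of_lower windowFloor_text_count forallExponent_shape_carries_no_rate)

end R72

-- `section CycleFiftyNineChecks` (re-export `example`s of cycle 59, R72) moved VERBATIM to Annex G §P13v at rev 79; compiled through rev 78b, last at crux write 28d9eda20431.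

/-! ## (BR) Cycle 60: ★ the §E near-miss CLOSED — `1 ≤ β` is load-bearing EVEN WITH the lattice threshold kept; the operator bridge `K_β ↔ 𝕎` (`c_{β,L}λ₊ ≤ λ₀`,
## `c_{β,L}𝕎 = A` on the physical subspace, `P_L ≤ c^T Z^{cyc}_L`) and the `L`-UNIFORM strong-coupling trace-ratio bound `r_L(β,T) ≥ 1 − 24L³Te^{−⌊T/2⌋}` — files
## `Negative/StrongCouplingKernelBridge.lean` (p760584), `Negative/StrongCouplingTraceBridge.lean` (p760746) (`…Negative.StrongRoot`), `Negative/FalseWithoutBetaGeOneKeepingThreshold.lean`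
## (p761024); lane A ✓`…CoarseUpperOfHOD` (`ConstTube.coarseUpper (2 ≤ L)` = `hUp` verbatim) vetted SOUND; no kill of the crux. [cite: MontvayMunster1994, §3.2.6] [cite: KoteckyPreiss1986, (1)] -/

namespace R73

export Summit.QuantumFields.YangMills.Theorems.TwistedTraceScaling.Negative.StrongRoot
  (integral_transferKernel_gaugeTransform sliceConst_mul_inner_le norm_le_levelValue_zero sliceConst_mul_transferSpectralRadius_le
    sliceConst_smul_wilsonTorusTransferMatrix_eq exists_physEigenseq_wilsonTorusTransferMatrix physTraceSucc_le_pow_mul_cyclicPartition physTrace_pos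
    one_sub_le_traceRatio_of_strongCoupling)

export Summit.QuantumFields.YangMills.Theorems.TwistedTraceScaling.Negative (twistedTraceScaling_false_without_betaGeOne_keeping_threshold)

end R73

-- `section CycleSixtyChecks` (re-export `example`s + budget check of cycle 60, R73) moved VERBATIM to Annex G §P13w at rev 80; compiled through rev 79b, last at crux write 2e4e0b008d48.

/-! ## (BS) Cycle 61: ★★★ S-BASE CLOSED BY NAME by lane A (✓`TwoLattice.stub_fixedLatticeTraceLaw`, p763201; W1–W8, R1–R5) — vetted SOUND; the disprover's mutation pass on
## W(L): W(L) ⇔ the capped `β`-uniform sub-exponential LEVEL COUNT (profile `∃ g` eliminable) ⇒ ★ COUNT(L) unconditional at `L ≥ 2`; W(L) insensitive to FIXED slack;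
## W(L) ⟸ UBO-CAP(L) ∕ the lead's (★) BO-WINDOW(L) typed abstractly — files `Negative/WindowFloorTransfer.lean` (p761977, `…R74`), `Negative/WindowFloorOfCount.lean`
## (p762066, `…R74b`), `Negative/WindowFloorOfBOWindow.lean` (p763547, `…R74c`), `Negative/LevelCountOfWindowFloor.lean` (p763591, `…R74d`); the crux now rests on
## `stub_cmpTwoLoop` alone (✓`…CruxOfCmpTwoLoop`); no kill. [cite: ReedSimonIV1978, Thm. XIII.1] [cite: Luscher1983, §3] -/

namespace R74

export Summit.QuantumFields.YangMills.Theorems.TwistedTraceScaling.Negative.R74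
  (summable_exp_neg_mul_shift le_windowShape_of_slack windowFloor_text_of_slack windowFloor_text_of_reference_transfer windowFloor_text_of_uboCap)

export Summit.QuantumFields.YangMills.Theorems.TwistedTraceScaling.Negative.R74b
  (le_windowShape_of_le_logRatio lt_of_logRatio_lt profile_of_count windowFloor_text_of_count windowFloor_text_iff_count)

export Summit.QuantumFields.YangMills.Theorems.TwistedTraceScaling.Negative.R74c
  (max_add_le_exp_mul_max eventually_cap_mul_bareLambda_le_log_two windowFloor_text_of_boWindow windowFloor_text_of_boWindow_forall base_stmt_of_boWindow)

export Summit.QuantumFields.YangMills.Theorems.TwistedTraceScaling.Negative.R74d (windowFloor_two_le levelCount_two_le)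

end R74

-- `section CycleSixtyOneChecks` (re-export `example`s of cycle 61, R74; incl. (i) `example : TwoLattice.Stmt.stub_fixedLatticeTraceLaw := TwoLattice.stub_fixedLatticeTraceLaw`) moved VERBATIM to Annex G §P13x at rev 81; compiled through rev 80b, last at crux write 6eec968406c8.

/-! ## (BT) Cycle 62: the open stub CMP-2LOOP in its SMALLEST CURRENCY — ★★★ `Stmt.stub_cmpTwoLoop ⟺ LIM`, the window-free, threshold-free label limit
## `∀ s ε, ∃ Λ0 > 0, ∀ L ≥ 1, ∀ β, 1 ≤ β → 0 < Λ(β,L) → Λ(β,L) ≤ Λ0 → |r_L(β,⌈sL/Λ⌉) − r_𝔥(s)| ≤ ε` (no `M, b, k, φ, δ, T, β₁, L0, lam`);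
## ★ LIM with `Λ0` depending on `L` is a THEOREM (S-BASE), so the stub is EXACTLY ONE QUANTIFIER SWAP (`∃ Λ0 ∀ L` open vs `∀ L ∃ Λ0` proved);
## both guards `1 ≤ β` (strong root, every `L`) and `0 < Λ` (junk `Λ(1,L) = 0` past the Landau root, `L ≥ ⌈e^{1/(4b₀)}⌉`) load-bearing, also behind a
## size threshold — files `Negative/UniformAllSizes.lean` (p764256, `…R75`), `Negative/LabelLimitGuards.lean` (p764418, `…R75b`), `Negative/LabelLimitPointwise.lean`
## (p764531, `…R75c`); no new CMP-2LOOP text this cycle; no kill. [cite: Luscher1983, §3] [cite: LuscherMunster1984, §2] -/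

namespace R75

export Summit.QuantumFields.YangMills.Theorems.TwistedTraceScaling.Negative.R75
  (uniformFrom_pred uniformAllSizes_of_uniformFrom uniform_iff_uniformAllSizes uniformAllSizes_iff_labelLimit
    cmpTwoLoop_iff_uniformAllSizes cmpTwoLoop_iff_labelLimit femtoTraceLaw_of_labelLimit)

export Summit.QuantumFields.YangMills.Theorems.TwistedTraceScaling.Negative.R75b
  (invRunningCoupling_nonpos_of_log_ge luscherLambda_eq_zero_of_invRunningCoupling_nonpos femtoSteps_eq_zero_of_luscherLambda_eq_zero
    luscherLambda_one_ceil_exp_eq_zero labelLimit_false_without_lambdaPos labelLimit_false_without_betaGeOne labelLimit_guards_load_bearing)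

export Summit.QuantumFields.YangMills.Theorems.TwistedTraceScaling.Negative.R75c
  (labelLimit_pointwise labelLimit_pointwise_of_uniform strongRoot_violates labelLimit_false_without_betaGeOne_keeping_threshold
    luscherLambda_one_eq_zero_of_ge labelLimit_false_without_lambdaPos_keeping_threshold)

end R75

-- `section CycleSixtyTwoChecks` (re-export `example`s of cycle 62, R75/R75b/R75c; incl. (i) `example : TwoLattice.Stmt.stub_cmpTwoLoop ↔ LIM := R75.cmpTwoLoop_iff_labelLimit`) moved VERBATIM to Annex G §P13y at rev 82; compiled through rev 81, last at crux write 0edd25e0f37c.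

/-! ## (BU) Cycle 63: FREE RESTATEMENTS of the open swap LIM (⟺ `Stmt.stub_cmpTwoLoop`, R75) — ★ LIM ⟺ TAIL (`∃ Λ0 ∃ L0 ∀ L ≥ L0`: a statement about `L → ∞` only);
## ★ LIM ⟹ ONE depth for all `s` in a compact `[a, b] ⊂ (0, ∞)` (Pólya: monotone clocks, ✓`traceRatio_mono`, uniform continuity of `r_𝔥`), ⟺;
## ★ LIM ⟺ X-FORM `∀ s ε, ∃ X0, ∀ L ≥ 1, ∀ β ≥ 1, X0 ≤ 1/ḡ²(β, L) → |r_L − r_𝔥(s)| ≤ ε` — S-BASE's thresholds on ONE two-loop scaling trajectory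
## `β/2 + (b₁/b₀) log(2b₀/β) ≥ X0(s, ε) + 2b₀ log L` for every cutoff; the X-FORM's single guard `1 ≤ β` is load-bearing (strong root: `1/ḡ² → +∞` as `β → 0⁺`),
## its sign condition cosmetic, and lattice by lattice it is a THEOREM (open content `∃ X0 ∀ L`); the guard is EXACTLY the exclusion of `β → 0⁺` — any fixed cut
## `c > 0` in place of `1 ≤ β` gives the same LIM ∕ X-FORM (⟺ stub), the cut `0 < β` a false one — files `Negative/LabelLimitCompact.lean` (p765081, `…R76`),
## `Negative/InvCouplingFormGuard.lean` (p765418, `…R77`), `Negative/GuardCutEquivalence.lean` (p765658, `…R78`); not free: `s → 0⁺` uniformity, a rate in `Λ`, an `ε`-free depth; no new CMP-2LOOP text this cycle; no kill.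
## [cite: Luscher1983, §3] [cite: LuscherMunster1984, §2] -/

namespace R76

export Summit.QuantumFields.YangMills.Theorems.TwistedTraceScaling.Negative.R76
  (labelLimit_iff_tail femtoSteps_mono two_le_femtoSteps labelLimit_compactUniform labelLimit_iff_compactUniform
    cmpTwoLoop_iff_tail cmpTwoLoop_iff_compactUniform inv_cube_le_invRunningCoupling luscherLambda_le_of_le_invRunningCoupling
    labelLimit_iff_invCouplingForm cmpTwoLoop_iff_invCouplingForm)

export Summit.QuantumFields.YangMills.Theorems.TwistedTraceScaling.Negative.R77
  (cbrt_inv_pow_three cbrt_inv_inv_cube invCouplingForm_false_without_betaGeOne invCouplingForm_false_without_betaGeOne_keeping_threshold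
    invCouplingForm_iff_realThreshold invCouplingForm_pointwise invCouplingForm_of_bounded_pointwise cmpTwoLoop_invCouplingForm_guard)

export Summit.QuantumFields.YangMills.Theorems.TwistedTraceScaling.Negative.R78
  (invRunningCoupling_le_of_cut invCouplingForm_cut_mono invCouplingForm_cut_iff invCouplingForm_false_posCut labelLimit_iff_invCouplingForm_cut
    labelLimit_cut_iff labelLimit_false_posCut cmpTwoLoop_iff_labelLimit_cut cmpTwoLoop_iff_invCouplingForm_cut guard_dichotomy)

end R76

-- `section CycleSixtyThreeChecks` (re-export `example`s of cycle 63, R76/R77/R78; (i) stub ↔ TAIL (ii) stub ↔ COMPACT (iii) stub ↔ X-FORM (iv) Pólya step (v) X-FORM guard behind thresholds (vi) X-FORM pointwise (vii) stub ↔ LIM[c ≤ β] (viii) ¬LIM[0 < β]) moved VERBATIM to Annex G §P13z at rev 83; compiled through rev 82b, last at crux write d5d5c31baf1e.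

/-! ## (BV) Cycle 64: ★★ OVER-CORRECTED running clocks (`c > b₁/b₀` in the label `A_c = β/2 − 2b₀ log L − c·log(β/(2b₀))`, clock `Λ_c = (max A_c 0)^{−1/3}`) are FALSE AS
## TYPED, UNCONDITIONALLY (the label dies in the window: `A_c ≤ 0` eventually, junk `T = ⌈sL/0⌉ = 0` for every `s`; two femto times `r_𝔥(1) > 3r_𝔥(s₂)`) — the side cycle 3
## (§F, ✓`Negative/ClockRigidity`) left open; hence ★★★ the clock coefficient is TWO-SIDEDLY RIGID: mod FTL ∕ the crux ∕ LIM ∕ the open stub, (law clocked by `Λ_c`) ⟺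
## `c = b₁/b₀` — file `Negative/ClockCoefficientRigidity.lean` (p766595, `…Negative.R79`); no new CMP-2LOOP text this cycle; no kill. [cite: LuscherMunster1984, §2] [cite: Luscher1983, §3] -/

namespace R79

export Summit.QuantumFields.YangMills.Theorems.TwistedTraceScaling.Negative.R79
  (clockLabel_eq clockLabel_nonpos_eventually clockSteps_eq_zero_of_nonpos clockSteps_two_loop_eq not_fastClockTraceLaw
    clockTraceLaw_twoLoop_iff_femtoTraceLaw clockTraceLaw_iff_coeff_eq not_fastClockLabelLimit clockTraceLaw_of_clockLabelLimit
    clockLabelLimit_twoLoop_iff_labelLimit clockLabelLimit_iff_coeff_eq clockLabelLimit_iff_coeff_eq_of_cmpTwoLoop)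

end R79

-- `section CycleSixtyFourChecks` (re-export `example`s of cycle 64, R79; (i) `¬law_c` for `c > b₁/b₀` (ii) instance `c = 2b₁/b₀` (iii) crux-level rigidity (iv) stub-level rigidity (v) `¬LIM_c`) moved VERBATIM to Annex G §P13aa at rev 84; compiled through rev 83, last at crux write 2c4827e0efc0.

/-! ## (BW) Cycle 67: ★★ the LARGE-FIELD ENTROPY THRESHOLD of the two-loop femto window is `1/b₀ = 24π²/11` (two-sided; the window IS the scaling trajectory
## `4b₀ log L < β ≤ (4b₀ + θ) log L + C`); every cutoff-scale large-field event (`δ ≤ 2N = 4`) is entropically ABUNDANT on the window (union bound void ⇒ suppliers of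
## CMP-2LOOP ∕ LIM must be multi-scale), while at FIXED `L` (S-BASE regime) the same weights vanish — files `Negative/WindowLargeFieldEntropy.lean` (p768115, `…Negative.R80`)
## and `Negative/WindowLargeFieldEntropyFixedLattice.lean` (p768167, `…Negative.R80b`); no new CMP-2LOOP text this cycle; no kill. [cite: LuscherMunster1984, §2] -/

namespace R80

export Summit.QuantumFields.YangMills.Theorems.TwistedTraceScaling.Negative.R80
  (inv_b0_eq inv_b0_bounds four_lt_inv_b0 sixteen_b0_lt_one half_beta_le_of_window beta_mul_le_of_window beta_le_of_window_sharp
    beta_le_of_window_loglog beta_window_two_sided fourVolume_defect_le fourVolume_defect_ge fourVolume_defect_unbounded fourVolume_defect_small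
    window_entropy_threshold femtoSteps_ge_of_window femtoSteps_le_of_window femtoVolume_defect_unbounded femtoVolume_defect_small
    cutoffScale_defect_ge_cube fourVolume_defect_tendsto_zero_fixedL exists_window_point_ge)

export Summit.QuantumFields.YangMills.Theorems.TwistedTraceScaling.Negative.R80b
  (femtoSteps_le_of_one_le femtoVolume_defect_tendsto_zero_fixedL femtoVolume_defect_fixedL_vs_window)

end R80

section CycleSixtySevenChecks

open Filter Topology

/-- §BW (i) ★ (`R80.beta_window_two_sided`): the window is the two-loop scaling trajectory — `4b₀ log L < β ≤ (4b₀ + θ) log L + C(θ, lam)` for every slack `θ > 0`. -/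
example {θ lam : ℝ} (hθ : 0 < θ) (hlam : 0 < lam) :
    ∃ C : ℝ, ∀ (L : ℕ) [NeZero L] (β : ℝ), InFemtoWindow lam β L → 4 * b0 * Real.log L < β ∧ β ≤ (4 * b0 + θ) * Real.log L + C :=
  R80.beta_window_two_sided hθ hlam

/-- §BW (ii) ★★ (`R80.window_entropy_threshold`): the threshold `1/b₀` — below it `L⁴e^{−δβ}` exceeds every bound along the window, above it it tends to `0`. -/
example {lam : ℝ} (hlam : 0 < lam) (δ : ℝ) :
    (δ < 1 / b0 → ∀ M : ℝ, ∃ L1 : ℕ, ∀ (L : ℕ) [NeZero L], L1 ≤ L → ∀ β : ℝ, InFemtoWindow lam β L →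
        M ≤ (L : ℝ) ^ 4 * Real.exp (-(δ * β))) ∧
    (1 / b0 < δ → ∀ ε : ℝ, 0 < ε → ∃ L1 : ℕ, ∀ (L : ℕ) [NeZero L], L1 ≤ L → ∀ β : ℝ, InFemtoWindow lam β L →
        (L : ℝ) ^ 4 * Real.exp (-(δ * β)) ≤ ε) :=
  R80.window_entropy_threshold hlam δ

/-- §BW (iii) the number: `21 < 1/b₀ = 24π²/11 < 22`. -/
example : 1 / b0 = 24 * Real.pi ^ 2 / 11 ∧ (21 : ℝ) < 1 / b0 ∧ 1 / b0 < 22 :=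
  ⟨R80.inv_b0_eq, R80.inv_b0_bounds.1, R80.inv_b0_bounds.2⟩

/-- §BW (iv) ★★ (`R80.cutoffScale_defect_ge_cube` at the MAXIMAL single-plaquette defect `δ = 2N = 4`): even the most expensive cutoff-scale event is entropically abundant on the
window — `L³ ≤ L⁴e^{−4β}` eventually; the union bound «plaquettes × worst Boltzmann factor» certifies nothing there. -/
example {lam : ℝ} (hlam : 0 < lam) :
    ∃ L1 : ℕ, ∀ (L : ℕ) [NeZero L], L1 ≤ L → ∀ β : ℝ, InFemtoWindow lam β L → (L : ℝ) ^ 3 ≤ (L : ℝ) ^ 4 * Real.exp (-(4 * β)) :=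
  R80.cutoffScale_defect_ge_cube (by norm_num) le_rfl hlam

/-- §BW (v) ★★ (`R80.femtoVolume_defect_fixedL_vs_window` at `δ = 4`): the femto 4-volume weight `L³·⌈sL/Λ⌉·e^{−4β}` vanishes as `β → ∞` on every FIXED lattice (S-BASE regime)
yet is unbounded along the window (CMP-2LOOP regime) — the entropy face of `∀ L ∃` versus `∃ ∀ L`. -/
example {s lam : ℝ} (hs : 0 < s) (hlam : 0 < lam) :
    (∀ (L : ℕ) [NeZero L], Tendsto (fun β : ℝ => (L : ℝ) ^ 3 * (femtoSteps s β L : ℝ) * Real.exp (-(4 * β))) atTop (𝓝 0)) ∧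
    (∀ M : ℝ, ∃ L1 : ℕ, ∀ (L : ℕ) [NeZero L], L1 ≤ L → ∀ β : ℝ, InFemtoWindow lam β L →
      M ≤ (L : ℝ) ^ 3 * (femtoSteps s β L : ℝ) * Real.exp (-(4 * β))) :=
  R80.femtoVolume_defect_fixedL_vs_window hs (by norm_num) R80.four_lt_inv_b0 hlam

end CycleSixtySevenChecks




/-! ## (E) Near-miss — CLOSED at cycle 60 -/

/-- The crux with ONLY `1 ≤ β` removed (threshold kept). -/
def WithoutBetaGeOneKeepingThreshold : Prop :=
  ∀ s : ℝ, 0 < s → ∀ ε : ℝ, 0 < ε → ∃ lam0 : ℝ, 0 < lam0 ∧ ∀ lam : ℝ, 0 < lam → lam ≤ lam0 → ∃ L0 : ℕ,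
    ∀ (L : ℕ) [NeZero L], L0 ≤ L → ∀ β : ℝ, lam ≤ luscherLambda β L → luscherLambda β L ≤ 2 * lam →
      |physTrace L β (2 * ⌈s * L / luscherLambda β L⌉₊) / physTrace L β ⌈s * L / luscherLambda β L⌉₊ ^ 2 -
        physTrace 1 (oneSiteCoupling β L) (2 * ⌈s * L / luscherLambda β L⌉₊) /
          physTrace 1 (oneSiteCoupling β L) ⌈s * L / luscherLambda β L⌉₊ ^ 2| ≤ ε

/-- ★ CLOSED at cycle 60 (the only `sorry` of this file during cycles 1–59).  History: with `L ≥ L0(lam)` adversarial the strong root is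
`β ≈ 2b₀L^{−121/51}e^{−(b₀/b₁)/lam³}` and every pointwise / operator-norm / renewal / Birkhoff–Hopf estimate loses `e^{±cβL³T}` with `βL³T ∝ L^{4−121/51} → ∞`;
what was missing was an `L`-UNIFORM time-direction cluster expansion of `traceRatio`.  Supplied by R73a–c: the operator bridge `K_β ↔ 𝕎` (`c_{β,L}λ₊ ≤ λ₀`,
`c_{β,L}𝕎 = A` on the physical subspace, `P_L ≤ c^T Z^{cyc}_L`) carries the Literature's landed volume-uniform strong-coupling bound
`Missing.traceExcess_le_of_strongCoupling` to `r_L(β,T) ≥ 1 − 24L³Te^{−⌊T/2⌋}` (`0 < β ≤ r_{su2}`, `T ≥ 2`, every `L`), and the endgame runs at the strong root on a lattice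
`L ≥ 23040/(lam·(1 − r_𝔥(1)))` chosen AFTER the adversary's threshold.  Landed as `Negative.twistedTraceScaling_false_without_betaGeOne_keeping_threshold`
(`Negative/FalseWithoutBetaGeOneKeepingThreshold.lean`, R73c). [folklore] -/
theorem false_without_betaGeOne_keeping_threshold : ¬ WithoutBetaGeOneKeepingThreshold :=
  Negative.twistedTraceScaling_false_without_betaGeOne_keeping_threshold

end Summit.QuantumFields.YangMills.Cruxes.TwistedTraceScaling.Disproof

end
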